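import Summits.QuantumFields.YangMills.Theorems.BalabanUVNodesN06AtOpsYSectEStKnitRecordKESCCP
import Literature.MathematicalPhysics.QuantumFieldTheory.Balaban1983to89.B9SectionCarryingMembersV1
/-!
# BalabanUVNodes ∕ N06 ([B9], `Dag.B9_main`) — «KESC-C·» (KESCCP) AT `J := SCMemberY`: THE KNIT CERTIFICATE AT THE RECORD ₁₁ OVER THE SECTION-CARRYING MEMBERS WITH THEIR CANONICAL SECTIONS,
# AT THE (C) BOND LETTER OF RECORD (print's Dirichlet operator of the cube sequence)
Track A of `YM-PLAN.md` (cell `pub-ymgap`, HUMAN RULING D-0062), node **N06**.  Seat `pub-ymgap-dag-n06-d` g35 (the N24 instance at the latest head; dag-n24-c word «latest-head instance only», bus 2026-08-31).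
WHAT.  `b9LeafXUR_opsYSectESt_knitRecord_KESCCP_at_scMemberY` = ✓`…KnitRecordKESCCP.b9LeafXUR_opsYSectESt_knitRecord_KESCCP` (the head of record) with the sub-family FIXED to the section-carrying
members: `J := SCMemberY θ.d₆ θ.ℓ₆ θ.hd' θ.hL' θ.b₀ θ.b₁ Mstar`, `f := SCMemberY.val`, the (α3) block's sections `ιB := SCMemberY.ιBsc`, `hι := SCMemberY.hιsc` and
`hSC := SCMemberY.surjective_beta` SUPPLIED from ✓`B9SectionCarryingMembersV1` (n06 lineage); every other binder passed by name; conclusion = «KESC-CP»'s with `f j ↦ j.val`,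
`ιB j ↦ SCMemberY.ιBsc j`.  PROOF: one named application (the shape of ✓`…KnitRecordKESCVal` for ✓«KESC»).  One file, the named instance asked on the bus by the K1ᴬ junction
(dag-n24-c (t2): the carrier-generic socket `h06F : ∃ Y₀, B9LeafX Y₀` tracks the head of record).
HONEST FRAMING.  Helper at the record (instantiation), COUNT-NEUTRAL (`--supports stmt-QuantumFields-27239 --as helper`); every remaining displayed row of «KESC-CP» (bond ∕ site
estimate tables, the supplier rows, inner-corner rows, locality `hRfagrA`, geometry, thresholds ∕ datum ∕ numerics, Thm 3.14 data, the (3.185) record, regime bridges, pins) is a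
HYPOTHESIS; it does not decide whether the record's RG members carry sections; nothing of [B9] ∕ [4] asserted beyond the landed theorems; N06 NOT discharged; K1ᴬ NOT closed;
nothing continuum ∕ OS ∕ mass gap ∕ Clay — the Yang–Mills mass gap is NOT proved by any of this.  0 `def`, 0 `sorry`.  NEW file.
[cite: Balaban1985BackgroundPropagators, Thms 3.7–3.15 pp.409–432, p.409 l.1–5, (3.105) p.414, Thm 3.11 p.416; Balaban1984PropagatorsII, (2.1)–(2.4) p.224, (2.45) p.231]
-/
noncomputable section

namespace Summit.QuantumFields.YangMills.BalabanUVNodes.N06AtOpsYSectEStKnitRecordKESCCPVal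
open Literature.MathematicalPhysics.QuantumFieldTheory.Balaban1983to89 open T4Continuum (T4Family) open Node00 open B9PinMembersKLevelV1 (MemberY geo9Y bg9Y) open B9PinGeometryKLevelV1 (dOmegaY OmKY inΛY unitDistY c35Y) open B7Prop2SpecialUnitary (specialUnitaryUnits specialUnitaryUnits_le_unitaryUnits) open B9Ineq347GAAtLetters (hGA_opsYOfLetters) open B9Ineq344LocalPairHolds (hGp_opsYOfLetters_holds) open B9Cor35ComparisonsGAAtLetters
 (hGA_e_opsYOfLetters hGA_h1_opsYOfLetters hGA_e4_opsYOfLetters hGA_h2_opsYOfLetters hGA_l2_opsYOfLetters) open B9CoReadingCoordsHolderAdm (holderProbesKA bond_h1ReadsNbr_of_pinsA) open B9CoReadingCoordsHolderAdmReadings (bond_coReadsHHolderNbr_of_pinsA bond_inputReadsFam_of_pinsA) open B9CoReadingCoordsHolderSNear (holderProbesSN site_h1ReadsNbr_of_pinsSN) open B9CoReadingCoordsHolderSNearReadings (site_inputReadsFam_of_pinsSN) open N06DirKinematicsAtPinsR (h36HA_of_dir_pinsR h36_of_dirSq_pinsR h36A_of_dirSq_pinsR) open N06DirKinematics3AtPinsSNO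 (h36H_of_dir_pins₃SN_of_transpose) open Node00.OpsYSectDCoords (TpicoK T2coK RcoK) open Node00.OpsYOps312OfRecordPar (S0coKq QcoKHq QscoKHq CcoKq C1coKq) open B9CoReadingCoordsH (blkHK HcoK) open Node00.OpsYQLetter (qKnitOfRecord qsKnitOfRecord regQY) open B9B8AveragingJunction (parKnitY) open B9B8KnitLetterGpDecay (symm0_parKnitY) open B9PinGeometryKLevelV1 (c35Y_eq) open B9C2FormBoxRegimeY (Kpl) open B6KLevelCensusIndexV1 (kGeo) open N06WalkLettersAtRecordROPar (laws_parKnitY_of_reg335P identities₂_opsWalkYO_of_reg335R_laws) open B9Thm311ReadingCoords (PosDefTr) open B9LeafXCodedKnitUParH (b9LeafX_carriersYUParH) open B9LeafXCodedKnitUParHX (b9LeafX_carriersYUParHX Y9OfRecordUPbParHX carriersYUParHX) open B9SectBCodedClassKnitY (C37KY) open Node00 (carriersYUParH Y9OfRecordUPbParH kernelFamilyS kernelFamilyB cqY GAQY GpY parBY CY opsYSectESt deltaAQY siteKernelOfOp) open B9SectBCodedReadingsUParH (SectBStepUPar) open B9SectBKerFrameCodedYR (CinvY) open B9SectBCodedClassGY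 (C37GY) open Node00 (opsYS349NuOfLettersH parSymY_one) open Node00.OpsYExpsOfRecordV3Par (expsYOfRecordV3Par) open B9Thm39FacesAtLettersRCPar (t39_hksum_oneCube_opsYOfLetters_FRC_par) open B9Thm39OneCubeReadingAtLettersY (oneCubeOps39) open B9Thm39ReadingAtLetters (L39) open B9Ineq349SiteFromConv348 (blk39F) open B9Thm311ReadingAtLettersQ (t311_of_pins_opsYOfLettersRQ inputs311YQ_of_laws) open B9BackgroundsKLevelV1R (kernelFamilyRY hKernelRY siteKernelR) open B9Thm315SectEStarRepAtLettersR (t315_opsYSectESt_sectEStYOfRecordV7_of_3185_onR) open Node00.OpsYExpsOfRecordV3 (expsYOfRecordV3) open B9WalkLettersOpsO (opsWalkYO dirOpsWalkYO dirLettersWalkYO rdWalkYO agreeWalkYO staticOK_opsWalkYO) open N06WalkLettersAtRecordRO (localityDir_opsWalkYO_of_agree identities₂_opsWalkYO_of_reg335R) open B9Local342AtOpsWalkYO (local342_opsWalkYO_of_blocks) open B9Thm37CubeCoverCommutators (cutMulY hTY) open Node00 (SiteY SiteOpY deltaPrimeAY) open B9WalkLettersOps (nearDomY) open B9Thm37KLetterDir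 (FactorsL2Mixed37Dir) open B9H43GpFromPinsSN (h43Gp_of_thm37PrintedSN) open B9HpDGWFromPinsSN (hpDGW_of_thm37PrintedSN_unif) open B9H44GFromPinsSN (h44G_hp45W_of_thm37PrintedSN) open B9H44mFromPinsKA (h44m_h45X_h45Y_of_local3107 thm33G0DirT_of_local3107 inputConst44_pins_nonneg inputConst45_pins_nonneg const37_pins_nonneg) open B9SmoothHolderClassPI (bHZPIfam bHZKPIfam) open B9RWSums347DefiniteFaces (exp261) open B9RWSums344Input (inputConst44 inputConst45) open B9RWSums343Holder (holderConst) open B9Thm37Whole (const37)  open N06CurrentMajAtPinsIdPhys (hBJ_of_pins_P) open B9WalkLettersOps (opsWalkY dirOpsWalkY dirLettersWalkY kappaWalkY thetaWalkY KcWalkY rdWalkY) open B9WalkLettersOpsFacts (staticOK_opsWalkY bounded_kappaWalkY) open N06WalkLettersAtRecordR (localityDir_opsWalkY_of_agree identities₂_opsWalkY_of_reg335R)  open N06DgLegAtPinsPhysPU (hκ13_of_pinsP dgDH_dgDHd_of_pinsP_geo9Y) open B9SmoothHolderClassP (bHZPG bHZKP bHZKPG) open N06WELegAtPinsPhysPUB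 (hκX_of_pinsP hWE_of_pinsP_geo9Y_budget) open N06WGpLegAtPinsPhysPU (hwGp_of_pinsP_geo9Y) open N06RgdH43LegAtPinsPhysPU (hrgdH_of_pinsP43_geo9Y) open B9SmoothHolderClassPProducers (CTel) open B9Ineq349SiteThresholdRateNamed (thrM349 cg349 cg349_pos fineEntryS_le_named) open B9Thm39ReadingAtLetters (basis39 κ39) open B9MultiscaleSmoothPartitionYNear (rNear) open B9Thm313WholeDvHolderAtPinsGraded (thetaL CJG) open B9PlaquetteBinderOfReg335Y (plaqV_binder_of_regYR_budget_SU budget_nonneg) open B9SectDSup (weightNorm) open B9MultiscaleSmoothPartitionYLip (CLip) open B9GradViaDivLettersTransported (taxiS taxiB) open B9OpsRTransport (ops312RY) open B9Ineq349SiteFacesAtLettersR (s349_site_of_t37_display348_of_R) open B9Thm314Thm315LayerR (thm314_pair_layerOfLettersR) open B9Eq335ClassBridgePV1 (regY335_of_regYP335 regY336_of_regYP336) open B9BackgroundsKLevelV1P (bg9YP)  open N06MixedFactorAtPinsPhysR (h36H_of_mixedFactorR) open B9RWSums346MixedFactorOfLegsY (factorsL2Mixed37Dir_of_legs MLeg BLeg)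 open N06SplitMajorantsAtPinsPhysR (split_majorants_of_letter_schemasR) open N06Thm312313AtPinsStateSUCLE (t312_t313_of_pins_stateSUCLE) open B9Thm313WholeLeafCompletePairMBCZcUSXCL (letters313L2Pc_of_fields) open N06Rgd2LegAtPinsPhysPU (hrgd2_of_pinsP_geo9Y) open B9SectBStepUClosedSUOfSections (sectBStepU_C37GY_su_extraYPb_closed) open Node00.OpsYExpsOfRecordV2 (expsYOfRecordV2) open Node00.OpsYOps312OfRecord (ops312YOfRecord) open Node00.OpsYBondMapOfRecord (bIYOfRecord) open N06G0QstarLettersLegAtPinsPU (g0qstar_letters_of_pins)  open B9Thm39FacesAtLettersRC (t39_hksum_oneCube_opsYOfLetters_FRC) open B9Thm311Thm315FacesAtLettersR (t311_of_pins_opsYOfLettersR) open B9Thm315SectEStarRepAtLettersR (DecayMidOnStY t315_opsYNuStOfRecordV4PE_sectEStYOfRecordV7_of_3185_onR) open B9BackgroundsKLevelV1R (RegFamY MemOfFam mem_of_reg335R bg9YR regYP335 regYP336 regYP335_one kernelFamilyR hKernelR rwExpansionR fineKernelR) open B9LeafXClassAntitone (ClassIncl residualGpAtOne_R residualGAGlobAtOne_R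 rwSumsYieldIneqs_R rwKernelSumYields_R thm37Printed_antitone cor38Printed_antitone thm39Printed_antitone thm310Printed_antitone thm311Printed_antitone thm312Printed_antitone thm313Printed_antitone thm314Printed_antitone thm315FullPrinted_antitone stmt349Printed_antitone stmt3132Printed_antitone thm314LocalPrinted_antitone) open B9PinGeometryKLevelV1B (c35B ten_L3_le_c35B ten_L4_le_c35B c35Y_le_ten) open DagBinding (B9LeafX) open N06Ids3152AtPinsPhys (ids3124_ids3152_of_hZ_pins) open Node00.OpsYNablaBridge (cf_mul_etaS_of_hcfk)
open B9Cor35ComparisonsGpCAtLetters (hGp_e_opsYOfLetters hGp_h1_opsYOfLetters hC_opsYOfLetters) open B9Cor35ComparisonsEH (hE4_of_hGA_e4 hH2_of_hGA_h2) open B9GeoLemma21KLevelV1 (geo9Y_len_pos) open B9Thm39WholeBlk (Conv348Blk) open B9Thm39OneCubeReadingAtLettersY (oneCubeOps39YF) open B9RowSum261DefiniteFaces (rowConst261) open B9Thm312Whole (GeoOK FormSmall cNorm PosDefEnd) open B11SectG (BlockNorm HasMaj) open B9GeoNormsKLevelV1 (geo9K_dist_nonneg geo9K_supNorm_nonneg)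 open B9GeoLemma21KLevelV1 (geo9Y_dist_triangle geo9Y_dist_comm) open B9GeoNormsKLevelModelSignsV1 (modelSignsOn_geo9K) open B9Thm34Ext (toB6) open B9CoRealizesRelAtLetters (RelB maj342_relB_left maj342_relB_right dist_eq_of_relB len_eq_of_relB relB_refl) open B9SectCDiffDict (maj342) open B6Ineq2142KLevelV1 (β) open B9CarrierBlockMultiplicity (card_sameCarrier_le_kIdx) open B9Thm311ReadingCoords (PosDefTr) open B9PinGeometryKLevelV1 (kLab) open B9Thm314GpFlatTorusGeometry (tdistK OmegaC) open B9Thm314WholePinGeometry (locDataY) open B9Thm314WholePair (locData₂) open B9Thm314WholePairWalks (pairWalkSets) open B9Thm314WholeSummation (WalkSetsSpec WalkWeightsSummable) open B9SectCWalkTermsAllNorms (Thm310AllNormsPrinted) open B9Thm314WholeExpansionReads (ExpansionReads) open B9Thm314WholeCancellationLayer (pairOp) open B9Thm37Whole (Ops Sizes StaticOK Local342)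
open B9Cor38Whole (WalkReading) open B9C2FormMajTorusLettersAtMemberY (c2FormMaj_c2YOfRecord_of_hβ1) open B7Prop2Explicit (C0 c2') open B7Prop3Flat (c3) open B7Prop5GeneralLevels (C3Gen thetaGen) open B6RandomWalk (HasMajorant) open Node00.OpsYLocalInverse (GsqY) open B9BlockKeyTransferXBK (local342G_of_blocks_idxPins) open B6GlobalChartV1 (blkV1) open B9GeoNbrCountBlocksY (nbrM₀BY nbrCountBY hnbrBY_real_of_le) open B9Local342MonoConst (local342_mono_const local342G_mono_const) open B9SectBAllBlocksGeometryY (geoBY) open Node00.OpsYBlockPinOfRecord (blkOfSK dist_beta_blkSK_sIK_bIYOfRecord_le_one len_blkSK_sIK_bIYOfRecord_eq) open B6Geom246MultiLevelBox (blkOf) open B9Eq352DivFormLetters (conj) open B9Eq352GradLetters (diffLetter) open B9Thm310Whole (Ops310 WalkReading310 Sizes310 StaticOK310 Locality310 Local342G) open B9Thm310WholeDir (DirLetters310 Identities310₂) open B9RWSumsDefinitePins (PinPrims) open B9RWSumsDefinitePinsPair (PairPrims) open B9RWSumsDefinitePinsPairM (MixedPrims E310YPairM) open B9RWSumsDefinitePinsPairMDir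 (E37YPairMDir) open B9RWSumsDefinitePinsPairMDir4Rows (rows131819_definite_geo9Y_pairM_dir₄) open B9Thm37WholeDir (DirLetters37 Identities₂) open B9Cor38WholeDir (LocalityDir) open B9Thm37KLetterDir (HolderV37Dir FactorsInputPair37Dir) open B9RWSums344InputFam (InputReadsFam sliceProbe) open B9RWSums344InputPair (InputLegsPair37 InputLegsPair310 FactorsInputPair310) open B9RWSums346MixedPair (L2MixedLegs310 FactorsL2Mixed310 L2MixedLegs37) open B9CoReadingCoordsTranspose (TrIdx trBasis isTransposePair_GcoK_trBasis isTransposePair_DcoK_GcoK_trBasis isTransposePair_GcoS_trBasis isTransposePair_DcoS_GcoS_trBasis) open B9Thm311SymmAtRecordV4 (symm0_parSymY symmG_parSymY) open B9Thm311AdjointPairs (GpY_isSymmTr) open B9RWSums346SecondDiff (familyOp DirOps310 L2SecondLegs310) open B9RWSums346SecondDiffGp (DirOps37 L2SecondLegs37) open B9Thm37Glue (IsTransposePair) open B9RWSumsReadsNbr (H1ReadsNbr) open B9RWSums346Two (L2TwoLegs310 FactorsL2_310) open B9RWSums343Holder (HolderProbes HolderLegs310 FactorsHolder310) open B9RWSums343HolderGp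 (HolderLegs37) open B9Thm39ReadingCoords (cR39) open B9CoReadingCoords (XBK evBK blkBK GcoK DcoK DscoK LcoK coordOpK cdBₗ cdsBₗ) open B9CoReadingCoordsS (XSK evSK blkSK sIK sIK_faithful off_bound_evSK GcoS DcoS DscoS LcoS) open B9CoReadingCoordsL2S (sIK_dist_le_one site_l2ReadsNbr012_of_pins site_l2ReadsNbr345_of_pins) open B9CoReadingCoordsL2Pair (bond_l2ReadsNbr345_of_pins) open B9Ineq349SiteComposite (cdSL cdsSL) open B9Thm312WholeHHolderNbr (CoReadsHHolderNbr) open B9Thm311ReadingCoords (IsSymmTr) open N06CoReadingsOfPins (bond_coReadings3_of_pins bond_coReadingsLap_of_pins site_coReadings4_of_pins bond_l2ReadsNbr3_of_pins) open B9GeoNbrCountKLevelV1 (nbrM₀Y nbrCountY hnbr_two_of_le) open B9CoReadingCoordsH (XHK) open B6Ineq2142KLevelV1 (lvl) open B9Thm314WholePinGeometry (locDataY_laws) open B9PinGeometryKLevelV1 (dOmegaY_nonneg) open scoped Matrix.Norms.L2Operator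
open N06Proj349AtPinsPhysRC (proj349Maj_of_t37_display348_rateR_ge cP349_nonneg) open B9Eq346GradGpDivAtPinsL2Closed (M46 a46 B46 δ46 M46_pos a46_pos B46_pos blockBd_DvGcoSDvs_memberY_at) open B9PerturbationL2Delta2 (D2coK constL2Pi constL2Pi_nonneg) open B9PerturbationL2Letters (constL2 constL2_nonneg) open N06SectDUnitsAtPinsPhys (isUnit_deltaPiAY_of_formSmall_phys isUnit_deltaOneY_of_formSmall_phys posDefEnd_S0coK_of_posDefTr_phys posDefTr_deltaOneY_of_formSmall_pins_phys identitiesDef_of_pins_phys isUnit_deltaAY_phys_of_posDefTr) open B9Thm313WholeLettersCut (Letters313HZc Letters313L2Pc) open B9Thm313WholeRgdFrom3152 (Ids3152) open B9SectDSup (weightNorm) open B9Thm313WholeLeftZ (Letters313DZ) open B9Thm313WholeDirZ (Letters313DMZ) open B9Thm313WholeHolderZ (Letters313HZ) open B9LettersHZAtOne (plateau_pos) open B9Thm312WholeClasses (cNormR) open B9CoReadingCoordsHolder (PK) open B9CoReadingCoordsInput (bHK) open B9CoReadingCoordsInputS (bHS) open N06G0QstarL2LettersLegAtPinsPU (g0qstar_l2_letters_of_pins)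  open N06RgdILegAtPinsPhysR (rgdI_of_pinsR) open N06RgdDsLegAtPinsPhysR (rgdDs_rgdDd_of_pinsR) open N06DivLegAtPinsPhysR (hdivDs_of_pinsR) open N06HHLegAtPinsPhysRU (hLHH_of_pinsRU) open N06CutL2LettersAtPinsPhysR (vDRDG_vGDRD_of_pinsR) open N06MixedLegAtPinsPhys (hcntM_of_walkCnt) open N06Row17FromRow19LettersDir (row17_of_row19_letters₂) open B9WalkLettersCoordsS (SblkY hWalkY gsqcoS walkCntM₀Y walkCntY nearBlkCntY cubeDomY) open B6Cover236MultiLevelBlocks (cubes)  open B9Thm39ReadingCoords (coordBound39 basisBound39) open B9Thm31GpMajFromPinsPairMR (thm31GpMaj_of_t37_pairMR) open B9PerturbationMajorantLetters (const3131) open B9RowSum261DefiniteFaces (rowConst261) open B9Thm312WholeIdentitiesSplit (Ids3124 identities_of_def_3124) open Node00.OpsYSectDCoords (DvcoKH DvscoKH GcoK_GAY_mul_S0coK cR39_trBasis_pos) open B9Thm311ReadingCoords (isUnit_of_posDefTr) open N06Level13D2Rgdd13LayerAtPinsPUW (level13_d2_rgdd13_layer_of_pinsP_geo9Y) open N06G0CoreFromThm310GUSPC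 (g0_core_of_thm310_coreDir₃USP) open N06StepL2AtPinsPhysR (blockBd_tpi_of_letter_schemasR) open B9Delta2FormMajorant (C2FormMaj) open B9GradLetterTransportedInputClassesPI (bHZPIfam_κ exists_l1_control_bHZPIfam) open B9MultiscaleSmoothPartitionYNear (rNear) open B9RWSumsDefinitePins (PinPrims.rate_pos) open B9Eq3132FromStateR (s3132Nu_opsYSectE_of_stepS_R_of_refinesY) open B9StateAprioriL1 (exists_l1_control_bHK exists_l1_control_bHS) open B9MultiscaleSmoothPartitionYLip (CLip_nonneg) open B9Thm312WholeClasses (rwt rwt_nonneg)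
open B9LeafXCodedKnitU (b9LeafX_carriersYU) open B9SectBCodedClassR (regC335 regC336 bg9YC extraYPb classIncl_regC335Pb_regYPb335 classIncl_regC336Pb_regYPb336 classIncl_regYPb335_regC335Pb) open Node00 (Y9OfRecordUPb carriersYU CfgY BlkY IBondY deltaAY) open B9Eq360DeltaPrimeAY (AfldY) open B9PinMembersKLevelV1 (mstar_le_M) open B9LettersZSchemasMono (kernel_mono letters313DMZ_mono)
variable {N : ℕ}
section Pointed
variable [NeZero N] [Nonempty (Fin N)] {F : T4Family}
open Summit.QuantumFields.YangMills.BalabanUVNodes.N06AtOpsYSectEStKnitSectDKDR (t312_t313_opsYSectESt_knit_KDR)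
open Literature.MathematicalPhysics.QuantumFieldTheory.Balaban1983to89.B9Delta2FormMajorant (C2FormMaj) open Literature.MathematicalPhysics.QuantumFieldTheory.Balaban1983to89.Node00 (C2Y delta2OfQY trDualMatY GpPhysY) open Literature.MathematicalPhysics.QuantumFieldTheory.Balaban1983to89.B6RandomWalkHom (HasMajorantHom) open Literature.MathematicalPhysics.QuantumFieldTheory.Balaban1983to89.Node00.OpsYOps312OfRecordPar (QcoKHq) open Literature.MathematicalPhysics.QuantumFieldTheory.Balaban1983to89.B9Eq3115KnitLetterYOnto (kCol) open Literature.MathematicalPhysics.QuantumFieldTheory.Balaban1983to89.B9Eq316AveragingTransposeZd (alphaQ) open Literature.MathematicalPhysics.QuantumFieldTheory.Balaban1983to89.B9GeoNbrCountKLevelV1 (nbrM₀Y) open Literature.MathematicalPhysics.QuantumFieldTheory.Balaban1983to89.B9Eq3132TentBumps (Cth) open Literature.MathematicalPhysics.QuantumFieldTheory.Balaban1983to89.B9CoReadingCoordsH (blkHK) open Literature.MathematicalPhysics.QuantumFieldTheory.Balaban1983to89.Node00.OpsYQLetter (qKnitOfRecord qsKnitOfRecord)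
open Summit.QuantumFields.YangMills.BalabanUVNodes.N06AtOpsYSectEStKnitPairKCXS (b9LeafXUR_opsYSectESt_knit_pairKCXS)
open Literature.MathematicalPhysics.QuantumFieldTheory.Balaban1983to89.B9Eq316AveragingTransposeZd (alphaQ)
open Literature.MathematicalPhysics.QuantumFieldTheory.Balaban1983to89.B9Eq3115KnitLetterYOnto (kCol)
open Literature.MathematicalPhysics.QuantumFieldTheory.Balaban1983to89.Node00 (resYOfRecordPK)
open Literature.MathematicalPhysics.QuantumFieldTheory.Balaban1983to89.Node00.OpsYBondMapOfRecord (lawsY_of_eq)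
open Literature.MathematicalPhysics.QuantumFieldTheory.Balaban1983to89.B9PinGeometryKLevelV1 (c35Y_eq)
open Literature.MathematicalPhysics.QuantumFieldTheory.Balaban1983to89.B9WalkLettersOps310 (hWalkBY ops310WalkYO dirOps310WalkYO dirLetters310WalkYO kappa310WalkY agree310WalkYO rd310WalkYO)
open Literature.MathematicalPhysics.QuantumFieldTheory.Balaban1983to89.B9WalkLettersOps310Facts (staticOK310_ops310WalkYO bounded_kappa310WalkY okRel_rd310WalkYO locality310_ops310WalkYO)
open Literature.MathematicalPhysics.QuantumFieldTheory.Balaban1983to89.B9CoReadingCoords (XBK GcoK)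
open Summit.QuantumFields.YangMills.BalabanUVNodes.N06AtOpsYSectEStKnitRecordKESCGH (b9LeafXUR_opsYSectESt_knitRecord_KESCGH)
open Literature.MathematicalPhysics.QuantumFieldTheory.Balaban1983to89.Node00.OpsYCubeDirInverse (GpDirY padDeltaCubeY)
open Literature.MathematicalPhysics.QuantumFieldTheory.Balaban1983to89.B9KnitTransporterLocalityY (knitReachY)
open Literature.MathematicalPhysics.QuantumFieldTheory.Balaban1983to89.B7Prop2Explicit (unitaryUnits)
open Literature.MathematicalPhysics.QuantumFieldTheory.Balaban1983to89.B9KnitTransporterUnitaryY (parKnitY_mem_unitaryUnits_of_le)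
open Literature.MathematicalPhysics.QuantumFieldTheory.Balaban1983to89.B9CubeDirInversePosOnNearHY (isUnit_padDeltaCubeY_parKnitY)
open Literature.MathematicalPhysics.QuantumFieldTheory.Balaban1983to89.B9BackgroundsKLevelV1R (mem_of_reg335R)
open Literature.MathematicalPhysics.QuantumFieldTheory.Balaban1983to89.B7Prop2SpecialUnitary (specialUnitaryUnits_le_unitaryUnits)
open Literature.MathematicalPhysics.QuantumFieldTheory.Balaban1983to89.Node00.OpsYCubeDirInverseBond (GDirBY padDeltaLocBY bondsOverY mem_bondsOverY_of_hBdY_ne_zero)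
open Literature.MathematicalPhysics.QuantumFieldTheory.Balaban1983to89.Node00.OpsYOps312OfRecordPar (S0coKq)
open Literature.MathematicalPhysics.QuantumFieldTheory.Balaban1983to89.Node00.OpsYSectDCoords (cR39_trBasis_pos)
open Literature.MathematicalPhysics.QuantumFieldTheory.Balaban1983to89.B9Thm39ReadingCoords (cR39)
open Literature.MathematicalPhysics.QuantumFieldTheory.Balaban1983to89.B9Eq3104CutoffCommutators (DPDsY)
open Literature.MathematicalPhysics.QuantumFieldTheory.Balaban1983to89.B9Eq3105CoordsDirichletBondY (eq3105FamQY eq3105FamQTY eq3105Q_coords_GDirBY_member eq3105QT_coords_GDirBY_member)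
open Summit.QuantumFields.YangMills.BalabanUVNodes (N06DeltaAInverseAtRecord.invLaws_GcoK_GA_S0coKq_at_scMember)
open Summit.QuantumFields.YangMills.BalabanUVNodes.N06AtOpsYSectEStKnitRecordKESCGJ (b9LeafXUR_opsYSectESt_knitRecord_KESCGJ)
open Literature.MathematicalPhysics.QuantumFieldTheory.Balaban1983to89.Node00.OpsYCubeKnitPar (parKnitCubeY GpDirY_parKnitCubeY_isSymmTr_of_le)
open Literature.MathematicalPhysics.QuantumFieldTheory.Balaban1983to89.B9CubeDirInverseKnitCubeLawsY (blkHullCubeY GpDirY_parKnitCubeY_congr_of_agreeWalkYO localInverse_laws_hTY_GpDirY_parKnitCubeY isUnit_padDeltaCubeY_parKnitCubeY blkHullCubeY_dirDomY_subset)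
open Literature.MathematicalPhysics.QuantumFieldTheory.Balaban1983to89.B9Eq3105CoordsDirichletBondGY (eq3105FamQGY eq3105FamQTGY eq3105Q_coords_GDirBY_member_plc eq3105QT_coords_GDirBY_member_plc)
open Literature.MathematicalPhysics.QuantumFieldTheory.Balaban1983to89.Node00.OpsYCubeProjectionG (insideBlkY DPDsCubeDY P1CubeDY DPDsDirCubeY P1DirCubeY DPDsDirCubeY_comp_cutMulY IsUnitXDirCubeY)
open Literature.MathematicalPhysics.QuantumFieldTheory.Balaban1983to89.B9Cor36GpDirMemberBlocksAtRecordY (Datum36Y gpd36δ gpd36B gpd36M₀ gpd36T₀ gpd36N₀ gpd36a₁ h36b_at_member)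
open Literature.MathematicalPhysics.QuantumFieldTheory.Balaban1983to89.B9CubeGeometryInputs (RM1)
open Literature.MathematicalPhysics.QuantumFieldTheory.Balaban1983to89.B9Cor36GpDirMemberBlocksAtRecordY (Datum36UY datum36Y_of_unitary)
open Literature.MathematicalPhysics.QuantumFieldTheory.Balaban1983to89.B9CubeDirInverseBondLocalityY (isLocalQs_qsKnitOfRecord)
open Literature.MathematicalPhysics.QuantumFieldTheory.Balaban1983to89.B9CubeDirInverseBondLocalityAtRecordY (bondReadSetY GDirBY_DPDsDirCubeY_congr_of_agree310WalkYO)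
open Literature.MathematicalPhysics.QuantumFieldTheory.Balaban1983to89.B9Eq3115KnitLetterYLocalQ (knitDepY isLocalQ_qKnitOfRecord)
open Literature.MathematicalPhysics.QuantumFieldTheory.Balaban1983to89.B9CubeLettersBondOpsL0 (IBondCubeY)
open Literature.MathematicalPhysics.QuantumFieldTheory.Balaban1983to89.B9DirichletBondCubePairY (padDeltaLocCY)
open Literature.MathematicalPhysics.QuantumFieldTheory.Balaban1983to89.B9Eq3115KnitCubeLetterY (knitDepP QknitCubeY QsknitCubeY GDirCKY)
open Literature.MathematicalPhysics.QuantumFieldTheory.Balaban1983to89.B9Eq3105CoordsDirichletBondLY (eq3105FamQLY eq3105FamQTLY eq3105Q_coords_GDirCKY_member eq3105QT_coords_GDirCKY_member)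
open Literature.MathematicalPhysics.QuantumFieldTheory.Balaban1983to89.B9CubeDirInverseBondCLocalityAtRecordY (GDirCKY_congr_of_agree310WalkYO)
open Literature.MathematicalPhysics.QuantumFieldTheory.Balaban1983to89.B9BondReadDomainsPinY (nearAPinCY nearPinY bondReadSetY_subset_nearAPinCY knitDep_src_mem_nearAPinCY nearDomY_subset_nearPinY dirDomY_subset_nearPinY)
open Literature.MathematicalPhysics.QuantumFieldTheory.Balaban1983to89.B9CubeDirInverseBondCMemberRowsAtRecordY (CubeRowsGDirCY h36Ab_at_member_of_cubeRows hUnitA_at_member_of_cubeRows)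
open Literature.MathematicalPhysics.QuantumFieldTheory.Balaban1983to89.B9Thm39ReadingCoords (coordBound39)
open Summit.QuantumFields.YangMills.BalabanUVNodes.N06AtOpsYSectEStKnitRecordKESCCM (b9LeafXUR_opsYSectESt_knitRecord_KESCCM)
open Literature.MathematicalPhysics.QuantumFieldTheory.Balaban1983to89.B9CubeDirInverseBondCRowsNamedY (GDirPackY gdirδ gdirB gdirM₀ gdirT₀ gdirN₀ gdirdB gdira₁ cubeRowsGDirCY_named gdirδ_pos gdirB_nonneg)
open Literature.MathematicalPhysics.QuantumFieldTheory.Balaban1983to89.B9BackgroundsKLevelV1R (mem_of_reg335R)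
open Literature.MathematicalPhysics.QuantumFieldTheory.Balaban1983to89.B7Prop2SpecialUnitary (specialUnitaryUnits_le_unitaryUnits)
open Summit.QuantumFields.YangMills.BalabanUVNodes.N06AtOpsYSectEStKnitRecordKESCCN (b9LeafXUR_opsYSectESt_knitRecord_KESCCN)
open Literature.MathematicalPhysics.QuantumFieldTheory.Balaban1983to89.B9CubeDirInverseBondSocketAtOne (exists_bondSocket)
open Summit.QuantumFields.YangMills.BalabanUVNodes.N06AtOpsYSectEStKnitRecordKESCCO (b9LeafXUR_opsYSectESt_knitRecord_KESCCO)
set_option maxHeartbeats 2400000 in set_option synthInstance.maxSize 2048 in set_option maxRecDepth 8192 in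
/-- ★★★ **THE N06 KNIT CERTIFICATE «KESC-CP» AT THE RECORD ₁₁ OVER THE SECTION-CARRYING MEMBERS, WITH THEIR CANONICAL SECTIONS** — the head of record instantiated at
`J := SCMemberY …`, `f := SCMemberY.val`, `ιB := SCMemberY.ιBsc`, `hι := SCMemberY.hιsc`, `hSC := SCMemberY.surjective_beta` (✓`B9SectionCarryingMembersV1`): the leaf
`B9LeafX (Y9OfRecordUPbParHX … SCMemberY.val …)` at the (C) bond letter of record — the shape the K1ᴬ junction reads at SC members.  PROOF: one named application.
[cite: Balaban1985BackgroundPropagators, Thm 3.11 p.416, p.409 l.1–5, (3.105) p.414, Thms 3.7–3.15 pp.409–432; Balaban1984PropagatorsII, (2.1)–(2.4) p.224, (2.3)+(2.45) pp.224–231] -/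
theorem b9LeafXUR_opsYSectESt_knitRecord_KESCCP_at_scMemberY
    (θ : Stage11Params F N) (hθ : θ.Admissible) (Mstar : ℕ)
    -- [CASCADE-K K3] THE FOUR LETTER PINS (node00-def-Y's knit record `lettersYOfRecordV11K` closes them by `rfl`): bond transporter `parBY` and the three composites over print's KNIT averaging contours `parKnitY` and print's `Q` of (3.115): `G′ = GpY parKnitY`, `G = G[Qknit](parKnitY, G′)`, `C = (Q′G′²Q′*)⁻¹(parKnitY, G′)`; the HÖLDER transporter of (3.40) is `parSymY`, entering at the `G′` slot of the object (`opsYS349NuOfLettersH … (fun x => parSymY x.toKIdx)`), in the Hölder probes `𝔭` and in Thm 3.7's residual family (node00-def-Y's ruling, 2026-08-30)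
    (𝔢₀ : SectEY N θ.toStage3Params Mstar) (𝔴 : RWEY N θ.toStage3Params Mstar) (𝔈₀ : ExpsY N θ.toStage3Params Mstar) {R₁ R₂ : RegFamY θ.d₆ θ.ℓ₆ θ.hd' θ.hL' θ.b₀ θ.b₁ Mstar (Matrix (Fin N) (Fin N) ℂ)} (c : ℝ) (hcB : c35B θ.ℓ₆ ≤ c) (hc : 0 < c) (hGR : MemOfFam (specialUnitaryUnits (Fin N)) R₁) (hRP1 : ∀ (x : MemberY θ.d₆ θ.ℓ₆ θ.hd' θ.hL' θ.b₀ θ.b₁ Mstar) (α₀ : ℝ) (U : (bg9YR (Matrix (Fin N) (Fin N) ℂ) (specialUnitaryUnits (Fin N)) R₁ R₂ x).Cfg), (bg9YR (Matrix (Fin N) (Fin N) ℂ) (specialUnitaryUnits (Fin N)) R₁ R₂ x).Reg335 c α₀ U → 0 ≤ α₀ ∧ (bg9YP (Matrix (Fin N) (Fin N) ℂ) (specialUnitaryUnits (Fin N)) x).Reg335 c35Y α₀ U) (hP1 : ClassIncl (regYP335 (Matrix (Fin N) (Fin N) ℂ) (specialUnitaryUnits (Fin N))) c35Y R₁ c)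 (hP2 : ClassIncl (regYP336 (Matrix (Fin N) (Fin N) ℂ) (specialUnitaryUnits (Fin N))) c35Y R₂ c) [∀ x : MemberY θ.d₆ θ.ℓ₆ θ.hd' θ.hL' θ.b₀ θ.b₁ Mstar, Fintype (geo9Y x).Site] [∀ x : MemberY θ.d₆ θ.ℓ₆ θ.hd' θ.hL' θ.b₀ θ.b₁ Mstar, DecidableEq (geo9Y x).Site] [∀ x : MemberY θ.d₆ θ.ℓ₆ θ.hd' θ.hL' θ.b₀ θ.b₁ Mstar, Fintype (geoBY x).Site] [∀ x : MemberY θ.d₆ θ.ℓ₆ θ.hd' θ.hL' θ.b₀ θ.b₁ Mstar, DecidableRel (RelB x.toKIdx)] (bI : ∀ x : MemberY θ.d₆ θ.ℓ₆ θ.hd' θ.hL' θ.b₀ θ.b₁ Mstar, FBondY x.toKIdx → IBondY x.toKIdx) (hbI : bI = bIYOfRecord θ.toStage3Params Mstar) (α' r39 δ39 B39 a39 : ℝ) (hα'0 : 0 < α') (hα'1 : α' < 1) (hr39 : 0 < r39) (hrδ39 : r39 ≤ δ39) (hB39 : 0 < B39) (ha39 : 0 < a39) (p q : PinPrims) (hp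 : p.OK) (hq : q.OK)
    -- [CASCADE-K K3] THE KNIT-LETTER NUMERICS (x-free; dag-n06-l `knitWindow_inhabited_le`): window `α₀K` with `C₀α₀K ≤ 1/3`, `2α₀K ≤ c₂′`, the plaquette threshold `aK` (`K_pl(a)·L⁴ < α₀K` for `0 ≤ a ≤ aK`) and the two regime thresholds read against it; they DERIVE the knit legs' unitarity + `Δ′_a(U; parKnitY) > 0` (K2 laws `laws_parKnitY_of_reg335P`) and `G_a`'s symmetry
    (α₀K aK : ℝ) (hαK : 0 < α₀K) (hαK3 : C0 (θ.d₆ + 1) * α₀K ≤ 1 / 3) (hαK2 : 2 * α₀K ≤ c2' (θ.d₆ + 1) (θ.ℓ₆ + 1)) (hKplK : ∀ (i : B6KLevelCensusIndexV1.KIdx θ.d₆ θ.ℓ₆ θ.hd' θ.hL' θ.b₀ θ.b₁) (a : ℝ), 0 ≤ a → a ≤ aK → Kpl i a * (kGeo i).L ^ 4 < α₀K) (hpaK : p.a₁ / c ≤ aK) (hqaK : q.a₁ / c ≤ aK) (p3 q3 : PairPrims) (hp3 : p3.OK) (hq3 : q3.OK) (pM qM : MixedPrims) (hpM : pM.OK)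 (hqM : qM.OK) (H : MemberY θ.d₆ θ.ℓ₆ θ.hd' θ.hL' θ.b₀ θ.b₁ Mstar → Prop) (hM₀ : nbrM₀Y θ.d₆ θ.ℓ₆ θ.hd' θ.hL' θ.b₀ θ.b₁ 2 ≤ Mstar) (𝔭 : ∀ x : MemberY θ.d₆ θ.ℓ₆ θ.hd' θ.hL' θ.b₀ θ.b₁ Mstar, HolderProbes (geo9Y x) (bg9YR (Matrix (Fin N) (Fin N) ℂ) (specialUnitaryUnits (Fin N)) R₁ R₂ x) (XSK (TrIdx N) x.toKIdx) (XSK (TrIdx N) x.toKIdx) (PK (SiteY x.toKIdx) (Fin (θ.d₆ + 1)) (TrIdx N)) (PK (SiteY x.toKIdx) (Fin (θ.d₆ + 1)) (TrIdx N))) (h𝔭 : ∀ x : MemberY θ.d₆ θ.ℓ₆ θ.hd' θ.hL' θ.b₀ θ.b₁ Mstar, 𝔭 x = holderProbesSN x.toKIdx (trBasis N) (bg9YR (Matrix (Fin N) (Fin N) ℂ) (specialUnitaryUnits (Fin N)) R₁ R₂ x) (fun U => U) (parSymY x.toKIdx) (bI x)) (bHX : ∀ x : MemberY θ.d₆ θ.ℓ₆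 θ.hd' θ.hL' θ.b₀ θ.b₁ Mstar, ℝ → BlockNorm (toB6 (geo9Y x) 1 (H x)) ((XSK (TrIdx N) x.toKIdx) → ℝ)) (hbHX : ∀ x : MemberY θ.d₆ θ.ℓ₆ θ.hd' θ.hL' θ.b₀ θ.b₁ Mstar, bHX x = fun ε => letI : Fintype (B9GeoNormsKLevelV1.geo9K x.toKIdx).Site := (inferInstance : Fintype (geo9Y x).Site); bHS x.toKIdx (sIK x.toKIdx (bI x)) ε) (SH S3 SI : ∀ x : MemberY θ.d₆ θ.ℓ₆ θ.hd' θ.hL' θ.b₀ θ.b₁ Mstar, ↥(cubes x.toKIdx.D.toDomains) → Finset (geo9Y x).Site) (Bc : ℝ) (hBc : 0 ≤ Bc) (hM₀N : nbrM₀BY θ.d₆ θ.ℓ₆ θ.hd' θ.hL' θ.b₀ θ.b₁ 1 ≤ Mstar) (hB₀ge : (nbrCountBY θ.d₆ θ.ℓ₆ θ.hd' θ.hL' θ.b₀ θ.b₁ 1 : ℝ) * Real.exp (2 * p.δ₀) * (cR39 (trBasis N) * Bc) ≤ p.B₀)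
    -- [rows 18, ed. 115∕123∕125 — `h36b` CONSUMED g33 «KESC-AγI», see below] (3.42) block tables at the CUBE LETTER (laws `hnear hOagr hOsym hOloc hOlocT`); (3.46) per-cube legs `hMixO hOneO` + sandwiched member `hmixO` displayed
    -- [g33 «KESC-AβH»] THE SITE CUBE LETTER AT THE (β) LETTER OF RECORD: `GpDirY x.toKIdx □ (parKnitCubeY x.toKIdx □) (dirDomY x.toKIdx □)` = print's `G′_□(U)` for the SEQUENCE `{Ω_n(□)}` —
    -- the knit legs read at the cube sequence's OWN levels `lev_□` on all of Ω₀(□) (node00-def-Y ✓`Node00.OpsYCubeKnitPar.parKnitCubeY`, (T-□) word), Dirichlet exterior = print's placement `dirDomY`;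
    -- `hOagr hOsym hOloc hOlocT hparU hUnitD hSh` ALL CONSUMED at (β) (✓`B9CubeDirInverseKnitCubeLawsY`: block-hull locality, (3.87)–(3.88) against the member's `Δ′_a(U; parKnitY)`, positivity on EVERY exterior;
    -- def-Y ✓`GpDirY_parKnitCubeY_isSymmTr_of_le`); [g33 «KESC-AγH»] the reach row `hSblk` is GONE too (✓`blkHullCubeY_dirDomY_subset`: Ω₀(□) is a union of 𝔅_□-blocks); displayed: `hnear hSnear`
    -- [g34 «KESC-CM»] THE READING DOMAINS ARE PINNED to the minimal admissible sets (✓`B9BondReadDomainsPinY`): `near := □ ↦ nearPinY x □ = nearDomY x □ ∪ Ω₀(□)`, `nearA := □ ↦ nearAPinCY x.toKIdx □ Ω₀(□)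
    -- = bondReadSetY ∪ (sources of the cube-knit dependency sets meeting Ω₀(□))`; the inclusion rows `hnear hSnear hRnearA hDnearCA` are GONE (theorems by construction); print's «Ω₀(□) ⊂ □̃⁵» is the
    -- ONE statement `nearAPinCY ⊆ □̃⁵`, not claimed here (no row reads it)
    -- [g33 «KESC-AβH»] `hOagr` CONSUMED AT (β) (✓`B9CubeDirInverseKnitCubeLawsY.GpDirY_parKnitCubeY_congr_of_agreeWalkYO`: every averaging leg of `Ω₀Δ′_{a,□}(U; parKnitCubeY □)Ω₀` lives in ONE 𝔅_□-block): cover GEOMETRY displayed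
    (δM : ℝ) (hδM : 0 < δM) (hM1L : MLeg θ.d₆ θ.ℓ₆ θ.hd' θ.hL' θ.b₀ θ.b₁ Mstar hδM ≤ p.M₁) (hδ1L : p.δ₀ ≤ δM / 2) (hθ1L : p.θ₀ * Real.exp ((3 / 4 + p.δ₀) * p.ρ) * (BLeg θ.d₆ θ.ℓ₆ θ.hd' θ.hL' θ.b₀ θ.b₁ Mstar hδM * pM.BM) ≤ pM.θM) (hMixO : ∀ x, p.M₁ ≤ (geo9Y x).M → ∀ α₀ : ℝ, 0 < α₀ → c * (geo9Y x).M * α₀ ≤ p.a₁ → ∀ U : (bg9YR (Matrix (Fin N) (Fin N) ℂ) (specialUnitaryUnits (Fin N)) R₁ R₂ x).Cfg, (bg9YR (Matrix (Fin N) (Fin N) ℂ) (specialUnitaryUnits (Fin N)) R₁ R₂ x).Reg335 c α₀ U → ∀ (q' : ↥(cubes x.toKIdx.D.toDomains)) (ν μ : Fin (θ.d₆ + 1)), B9SectDL2Decay.BlockBd (g := toB6 (geo9Y x) 1 (H x)) (opsWalkYO x (trBasis N) (bg9YR (Matrix (Fin N) (Fin N) ℂ) (specialUnitaryUnits (Fin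 N)) R₁ R₂ x) (fun U => U) (parKnitY x.toKIdx) (bI x) (fun cc : ↥(cubes x.toKIdx.D.toDomains) => GpDirY x.toKIdx cc (parKnitCubeY x.toKIdx cc) (B9Cor35GpDirInputsAtOne.dirDomY x.toKIdx cc))).blk (opsWalkYO x (trBasis N) (bg9YR (Matrix (Fin N) (Fin N) ℂ) (specialUnitaryUnits (Fin N)) R₁ R₂ x) (fun U => U) (parKnitY x.toKIdx) (bI x) (fun cc : ↥(cubes x.toKIdx.D.toDomains) => GpDirY x.toKIdx cc (parKnitCubeY x.toKIdx cc) (B9Cor35GpDirInputsAtOne.dirDomY x.toKIdx cc))).blk ((dirOpsWalkYO x (trBasis N) (bg9YR (Matrix (Fin N) (Fin N) ℂ) (specialUnitaryUnits (Fin N)) R₁ R₂ x) (fun U => U) (parKnitY x.toKIdx) (bI x) (fun cc : ↥(cubes x.toKIdx.D.toDomains) => GpDirY x.toKIdx cc (parKnitCubeY x.toKIdx cc) (B9Cor35GpDirInputsAtOne.dirDomY x.toKIdx cc))).Dd U ν ∘ₗ (((opsWalkYO x (trBasis N) (bg9YR (Matrix (Fin N) (Fin N) ℂ) (specialUnitaryUnits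 (Fin N)) R₁ R₂ x) (fun U => U) (parKnitY x.toKIdx) (bI x) (fun cc : ↥(cubes x.toKIdx.D.toDomains) => GpDirY x.toKIdx cc (parKnitCubeY x.toKIdx cc) (B9Cor35GpDirInputsAtOne.dirDomY x.toKIdx cc))).Gsq U q' * B9Thm37Sum.mulOp ((opsWalkYO x (trBasis N) (bg9YR (Matrix (Fin N) (Fin N) ℂ) (specialUnitaryUnits (Fin N)) R₁ R₂ x) (fun U => U) (parKnitY x.toKIdx) (bI x) (fun cc : ↥(cubes x.toKIdx.D.toDomains) => GpDirY x.toKIdx cc (parKnitCubeY x.toKIdx cc) (B9Cor35GpDirInputsAtOne.dirDomY x.toKIdx cc))).h q')) ∘ₗ (dirOpsWalkYO x (trBasis N) (bg9YR (Matrix (Fin N) (Fin N) ℂ) (specialUnitaryUnits (Fin N)) R₁ R₂ x) (fun U => U) (parKnitY x.toKIdx) (bI x) (fun cc : ↥(cubes x.toKIdx.D.toDomains) => GpDirY x.toKIdx cc (parKnitCubeY x.toKIdx cc) (B9Cor35GpDirInputsAtOne.dirDomY x.toKIdx cc))).Dsd U μ)) (fun (y y' : (geo9Y x).Site) => pM.BM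 * Real.exp (-(δM * (geo9Y x).dist y y'))))
    (hOneO : ∀ x, p.M₁ ≤ (geo9Y x).M → ∀ α₀ : ℝ, 0 < α₀ → c * (geo9Y x).M * α₀ ≤ p.a₁ → ∀ U : (bg9YR (Matrix (Fin N) (Fin N) ℂ) (specialUnitaryUnits (Fin N)) R₁ R₂ x).Cfg, (bg9YR (Matrix (Fin N) (Fin N) ℂ) (specialUnitaryUnits (Fin N)) R₁ R₂ x).Reg335 c α₀ U → ∀ (q' : ↥(cubes x.toKIdx.D.toDomains)) (μ : Fin (θ.d₆ + 1)), B9SectDL2Decay.BlockBd (g := toB6 (geo9Y x) 1 (H x)) (opsWalkYO x (trBasis N) (bg9YR (Matrix (Fin N) (Fin N) ℂ) (specialUnitaryUnits (Fin N)) R₁ R₂ x) (fun U => U) (parKnitY x.toKIdx) (bI x) (fun cc : ↥(cubes x.toKIdx.D.toDomains) => GpDirY x.toKIdx cc (parKnitCubeY x.toKIdx cc) (B9Cor35GpDirInputsAtOne.dirDomY x.toKIdx cc))).blk (opsWalkYO x (trBasis N) (bg9YR (Matrix (Fin N) (Fin N) ℂ) (specialUnitaryUnits (Fin N)) R₁ R₂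 x) (fun U => U) (parKnitY x.toKIdx) (bI x) (fun cc : ↥(cubes x.toKIdx.D.toDomains) => GpDirY x.toKIdx cc (parKnitCubeY x.toKIdx cc) (B9Cor35GpDirInputsAtOne.dirDomY x.toKIdx cc))).blk (((opsWalkYO x (trBasis N) (bg9YR (Matrix (Fin N) (Fin N) ℂ) (specialUnitaryUnits (Fin N)) R₁ R₂ x) (fun U => U) (parKnitY x.toKIdx) (bI x) (fun cc : ↥(cubes x.toKIdx.D.toDomains) => GpDirY x.toKIdx cc (parKnitCubeY x.toKIdx cc) (B9Cor35GpDirInputsAtOne.dirDomY x.toKIdx cc))).Gsq U q' * B9Thm37Sum.mulOp ((opsWalkYO x (trBasis N) (bg9YR (Matrix (Fin N) (Fin N) ℂ) (specialUnitaryUnits (Fin N)) R₁ R₂ x) (fun U => U) (parKnitY x.toKIdx) (bI x) (fun cc : ↥(cubes x.toKIdx.D.toDomains) => GpDirY x.toKIdx cc (parKnitCubeY x.toKIdx cc) (B9Cor35GpDirInputsAtOne.dirDomY x.toKIdx cc))).h q')) ∘ₗ (dirOpsWalkYO x (trBasis N) (bg9YR (Matrix (Fin N) (Fin N) ℂ)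 (specialUnitaryUnits (Fin N)) R₁ R₂ x) (fun U => U) (parKnitY x.toKIdx) (bI x) (fun cc : ↥(cubes x.toKIdx.D.toDomains) => GpDirY x.toKIdx cc (parKnitCubeY x.toKIdx cc) (B9Cor35GpDirInputsAtOne.dirDomY x.toKIdx cc))).Dsd U μ) (fun (y y' : (geo9Y x).Site) => pM.BM * (geo9Y x).len y ^ (1 : ℝ) * Real.exp (-(δM * (geo9Y x).dist y y')))) (hmixO : ∀ x, p.M₁ ≤ (geo9Y x).M → ∀ α₀ : ℝ, 0 < α₀ → c * (geo9Y x).M * α₀ ≤ p.a₁ → ∀ U : (bg9YR (Matrix (Fin N) (Fin N) ℂ) (specialUnitaryUnits (Fin N)) R₁ R₂ x).Cfg, (bg9YR (Matrix (Fin N) (Fin N) ℂ) (specialUnitaryUnits (Fin N)) R₁ R₂ x).Reg335 c α₀ U → L2MixedLegs37 (opsWalkYO x (trBasis N) (bg9YR (Matrix (Fin N) (Fin N) ℂ) (specialUnitaryUnits (Fin N)) R₁ R₂ x) (fun U => U) (parKnitY x.toKIdx) (bI x) (fun cc : ↥(cubes x.toKIdx.D.toDomains) => GpDirY x.toKIdx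 cc (parKnitCubeY x.toKIdx cc) (B9Cor35GpDirInputsAtOne.dirDomY x.toKIdx cc))) (dirOpsWalkYO x (trBasis N) (bg9YR (Matrix (Fin N) (Fin N) ℂ) (specialUnitaryUnits (Fin N)) R₁ R₂ x) (fun U => U) (parKnitY x.toKIdx) (bI x) (fun cc : ↥(cubes x.toKIdx.D.toDomains) => GpDirY x.toKIdx cc (parKnitCubeY x.toKIdx cc) (B9Cor35GpDirInputsAtOne.dirDomY x.toKIdx cc))) 1 (H x) (SblkY x (bI x)) pM.BM p.δ₀ U) 
    -- [g33 «KESC-AγI»] rows 18's (3.42) block tables `h36b` of `η²G′_□(U)` CONSUMED — Cor. 3.6 PROVED for the sequence at the (β) letter by dag-n06-c ✓`B9Cor36GpDirAtMemberBlocks.gpDir_at_member_blocks`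
    -- (read at the named constants ✓`B9Cor36GpDirMemberBlocksAtRecordY`; the collar geometry of Ω₀(□) by n06-c ✓`hS2_dirDomY`); DISPLAYED instead: three member thresholds, ★ THE (3.35) DATUM OF Ω₀(□) PER (x, □, U) (LOCATED-32:
    -- a gauge straightening `U` to a small field on a box ⊇ Ω₀(□) — NOT supplied by the record's class cubes), and two x-free numerics tying the datum's constants to the certificate's `(Bc, p.δ₀)`
    (hM36 : ∀ x : MemberY θ.d₆ θ.ℓ₆ θ.hd' θ.hL' θ.b₀ θ.b₁ Mstar, gpd36M₀ N θ.d₆ θ.ℓ₆ θ.hL' ≤ ((θ.ℓ₆ : ℝ) + 1) * (toKT x.toKIdx).Mh) (hN36 : ∀ x : MemberY θ.d₆ θ.ℓ₆ θ.hd' θ.hL' θ.b₀ θ.b₁ Mstar, gpd36N₀ N θ.d₆ θ.ℓ₆ θ.hL' + 1 ≤ (toKT x.toKIdx).R * ((θ.ℓ₆ + 1) * (toKT x.toKIdx).Mh)) (hT36 : ∀ x : MemberY θ.d₆ θ.ℓ₆ θ.hd' θ.hL' θ.b₀ θ.b₁ Mstar, gpd36T₀ N θ.d₆ θ.ℓ₆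 θ.hL' ≤ RM1 x.toKIdx)
    -- [g33 «KESC-AγJ»] the (3.35) datum row RE-KEYED on the UNITARY datum ✓`Datum36UY` (gauge `g x ∈ U(N)`; the bi-contractivity rows of `R(Uᵍ)^{±1}`, `g^{±1}` of «KESC-AγI»'s `Datum36Y` are
    -- THEOREMS for unitary-valued `U`, dag-n06-c ✓`hR_of_unitary` ∕ ✓`hg_of_unitary` ∕ ✓`gpDir_at_member_blocks_unitary`; `U`'s unitarity = the regime's class membership `mem_of_reg335R hGR`)
    (hDat36u : ∀ x, p.M₁ ≤ (geo9Y x).M → ∀ α₀ : ℝ, 0 < α₀ → c * (geo9Y x).M * α₀ ≤ p.a₁ → ∀ U : (bg9YR (Matrix (Fin N) (Fin N) ℂ) (specialUnitaryUnits (Fin N)) R₁ R₂ x).Cfg, (bg9YR (Matrix (Fin N) (Fin N) ℂ) (specialUnitaryUnits (Fin N)) R₁ R₂ x).Reg335 c α₀ U → ∀ c' : ↥(cubes x.toKIdx.D.toDomains), Datum36UY x.toKIdx c' U (gpd36a₁ N θ.d₆ θ.ℓ₆ θ.hL'))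
    (hB36 : gpd36B N θ.d₆ θ.ℓ₆ θ.hL' ≤ Bc) (hδ36 : p.δ₀ ≤ gpd36δ N θ.d₆ θ.ℓ₆ θ.hL')
    (h36H : ∀ x, p.M₁ ≤ (geo9Y x).M → ∀ α₀ : ℝ, 0 < α₀ → c * (geo9Y x).M * α₀ ≤ p.a₁ → ∀ U : (bg9YR (Matrix (Fin N) (Fin N) ℂ) (specialUnitaryUnits (Fin N)) R₁ R₂ x).Cfg, (bg9YR (Matrix (Fin N) (Fin N) ℂ) (specialUnitaryUnits (Fin N)) R₁ R₂ x).Reg335 c α₀ U → HolderLegs37 (opsWalkYO x (trBasis N) (bg9YR (Matrix (Fin N) (Fin N) ℂ) (specialUnitaryUnits (Fin N)) R₁ R₂ x) (fun U => U) (parKnitY x.toKIdx) (bI x) (fun cc : ↥(cubes x.toKIdx.D.toDomains) => GpDirY x.toKIdx cc (parKnitCubeY x.toKIdx cc) (B9Cor35GpDirInputsAtOne.dirDomY x.toKIdx cc))) (𝔭 x) 1 (H x) (SH x) p.Bl p.δ₀ U ∧ HolderV37Dir (opsWalkYO x (trBasis N) (bg9YR (Matrix (Fin N) (Fin N) ℂ)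 (specialUnitaryUnits (Fin N)) R₁ R₂ x) (fun U => U) (parKnitY x.toKIdx) (bI x) (fun cc : ↥(cubes x.toKIdx.D.toDomains) => GpDirY x.toKIdx cc (parKnitCubeY x.toKIdx cc) (B9Cor35GpDirInputsAtOne.dirDomY x.toKIdx cc))) (dirOpsWalkYO x (trBasis N) (bg9YR (Matrix (Fin N) (Fin N) ℂ) (specialUnitaryUnits (Fin N)) R₁ R₂ x) (fun U => U) (parKnitY x.toKIdx) (bI x) (fun cc : ↥(cubes x.toKIdx.D.toDomains) => GpDirY x.toKIdx cc (parKnitCubeY x.toKIdx cc) (B9Cor35GpDirInputsAtOne.dirDomY x.toKIdx cc))) (dirLettersWalkYO x (trBasis N) (bg9YR (Matrix (Fin N) (Fin N) ℂ) (specialUnitaryUnits (Fin N)) R₁ R₂ x) (fun U => U) (parKnitY x.toKIdx) (bI x) (fun cc : ↥(cubes x.toKIdx.D.toDomains) => GpDirY x.toKIdx cc (parKnitCubeY x.toKIdx cc) (B9Cor35GpDirInputsAtOne.dirDomY x.toKIdx cc))) (𝔭 x) 1 (H x) p.Bt p.δ₀ U ∧ (L2SecondLegs37 (opsWalkYO x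 (trBasis N) (bg9YR (Matrix (Fin N) (Fin N) ℂ) (specialUnitaryUnits (Fin N)) R₁ R₂ x) (fun U => U) (parKnitY x.toKIdx) (bI x) (fun cc : ↥(cubes x.toKIdx.D.toDomains) => GpDirY x.toKIdx cc (parKnitCubeY x.toKIdx cc) (B9Cor35GpDirInputsAtOne.dirDomY x.toKIdx cc))) (dirOpsWalkYO x (trBasis N) (bg9YR (Matrix (Fin N) (Fin N) ℂ) (specialUnitaryUnits (Fin N)) R₁ R₂ x) (fun U => U) (parKnitY x.toKIdx) (bI x) (fun cc : ↥(cubes x.toKIdx.D.toDomains) => GpDirY x.toKIdx cc (parKnitCubeY x.toKIdx cc) (B9Cor35GpDirInputsAtOne.dirDomY x.toKIdx cc))) 1 (H x) (S3 x) p3.B3 p.δ₀ U ∧ (∀ q' μ, IsTransposePair ((dirLettersWalkYO x (trBasis N) (bg9YR (Matrix (Fin N) (Fin N) ℂ) (specialUnitaryUnits (Fin N)) R₁ R₂ x) (fun U => U) (parKnitY x.toKIdx) (bI x) (fun cc : ↥(cubes x.toKIdx.D.toDomains) => GpDirY x.toKIdx cc (parKnitCubeY x.toKIdx cc) (B9Cor35GpDirInputsAtOne.dirDomY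 x.toKIdx cc))).Pt U q' μ) ((dirLettersWalkYO x (trBasis N) (bg9YR (Matrix (Fin N) (Fin N) ℂ) (specialUnitaryUnits (Fin N)) R₁ R₂ x) (fun U => U) (parKnitY x.toKIdx) (bI x) (fun cc : ↥(cubes x.toKIdx.D.toDomains) => GpDirY x.toKIdx cc (parKnitCubeY x.toKIdx cc) (B9Cor35GpDirInputsAtOne.dirDomY x.toKIdx cc))).P U q' μ)) ∧ (∀ q', IsTransposePair ((opsWalkYO x (trBasis N) (bg9YR (Matrix (Fin N) (Fin N) ℂ) (specialUnitaryUnits (Fin N)) R₁ R₂ x) (fun U => U) (parKnitY x.toKIdx) (bI x) (fun cc : ↥(cubes x.toKIdx.D.toDomains) => GpDirY x.toKIdx cc (parKnitCubeY x.toKIdx cc) (B9Cor35GpDirInputsAtOne.dirDomY x.toKIdx cc))).Ct U q') ((opsWalkYO x (trBasis N) (bg9YR (Matrix (Fin N) (Fin N) ℂ) (specialUnitaryUnits (Fin N)) R₁ R₂ x) (fun U => U) (parKnitY x.toKIdx) (bI x) (fun cc : ↥(cubes x.toKIdx.D.toDomains) => GpDirY x.toKIdx cc (parKnitCubeY x.toKIdx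 cc) (B9Cor35GpDirInputsAtOne.dirDomY x.toKIdx cc))).Cop U q'))) ∧ (InputLegsPair37 (opsWalkYO x (trBasis N) (bg9YR (Matrix (Fin N) (Fin N) ℂ) (specialUnitaryUnits (Fin N)) R₁ R₂ x) (fun U => U) (parKnitY x.toKIdx) (bI x) (fun cc : ↥(cubes x.toKIdx.D.toDomains) => GpDirY x.toKIdx cc (parKnitCubeY x.toKIdx cc) (B9Cor35GpDirInputsAtOne.dirDomY x.toKIdx cc))) (dirOpsWalkYO x (trBasis N) (bg9YR (Matrix (Fin N) (Fin N) ℂ) (specialUnitaryUnits (Fin N)) R₁ R₂ x) (fun U => U) (parKnitY x.toKIdx) (bI x) (fun cc : ↥(cubes x.toKIdx.D.toDomains) => GpDirY x.toKIdx cc (parKnitCubeY x.toKIdx cc) (B9Cor35GpDirInputsAtOne.dirDomY x.toKIdx cc))) (𝔭 x) 1 (H x) (bHX x) (SI x) p.BI p.BI2 p.δ₀ U ∧ FactorsInputPair37Dir (opsWalkYO x (trBasis N) (bg9YR (Matrix (Fin N) (Fin N) ℂ) (specialUnitaryUnits (Fin N)) R₁ R₂ x) (fun U => U) (parKnitY x.toKIdx)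 (bI x) (fun cc : ↥(cubes x.toKIdx.D.toDomains) => GpDirY x.toKIdx cc (parKnitCubeY x.toKIdx cc) (B9Cor35GpDirInputsAtOne.dirDomY x.toKIdx cc))) (dirOpsWalkYO x (trBasis N) (bg9YR (Matrix (Fin N) (Fin N) ℂ) (specialUnitaryUnits (Fin N)) R₁ R₂ x) (fun U => U) (parKnitY x.toKIdx) (bI x) (fun cc : ↥(cubes x.toKIdx.D.toDomains) => GpDirY x.toKIdx cc (parKnitCubeY x.toKIdx cc) (B9Cor35GpDirInputsAtOne.dirDomY x.toKIdx cc))) (dirLettersWalkYO x (trBasis N) (bg9YR (Matrix (Fin N) (Fin N) ℂ) (specialUnitaryUnits (Fin N)) R₁ R₂ x) (fun U => U) (parKnitY x.toKIdx) (bI x) (fun cc : ↥(cubes x.toKIdx.D.toDomains) => GpDirY x.toKIdx cc (parKnitCubeY x.toKIdx cc) (B9Cor35GpDirInputsAtOne.dirDomY x.toKIdx cc))) 1 (H x) (bHX x) p.θI p.δ₀ U)) (hcntH : ∀ x (a : (geo9Y x).Site), (∑ c, if a ∈ SH x c then (1 : ℝ) else 0) ≤ p.NH) (hcnt3 : ∀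 x (a : (geo9Y x).Site), (∑ c, if a ∈ S3 x c then (1 : ℝ) else 0) ≤ p3.N3) (hcntI : ∀ x (a : (geo9Y x).Site), (∑ c, if a ∈ SI x c then (1 : ℝ) else 0) ≤ p.NI) (hMw : ∀ x : MemberY θ.d₆ θ.ℓ₆ θ.hd' θ.hL' θ.b₀ θ.b₁ Mstar, walkCntM₀Y θ.d₆ θ.ℓ₆ θ.hd' θ.hL' θ.b₀ θ.b₁ Mstar ≤ (geo9Y x).M) (hNMw : walkCntY θ.d₆ θ.ℓ₆ θ.hd' θ.hL' θ.b₀ θ.b₁ Mstar ≤ pM.NM) (hM3 : nbrM₀Y θ.d₆ θ.ℓ₆ θ.hd' θ.hL' θ.b₀ θ.b₁ 3 ≤ Mstar) (hρ3 : 3 ≤ p.ρ) (hNc : walkCntY θ.d₆ θ.ℓ₆ θ.hd' θ.hL' θ.b₀ θ.b₁ Mstar ≤ p.Nc) (hN' : walkCntY θ.d₆ θ.ℓ₆ θ.hd' θ.hL' θ.b₀ θ.b₁ Mstar ≤ p.N') (hCℓ : (((θ.ℓ₆ + 1 : ℕ) : ℝ)) ^ 2 ≤ p.Cℓ) (hKc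 : KcWalkY θ.d₆ θ.ℓ₆ θ.hd' θ.hL' θ.b₀ θ.b₁ (trBasis N) ≤ p.Kc) (hθ₀ : thetaWalkY θ.d₆ θ.ℓ₆ θ.hd' θ.hL' θ.b₀ θ.b₁ (trBasis N) p.Cℓ ≤ p.θ₀)
    -- [W-b] THE rows-19 BOND-SECTOR WALK LETTERS INSTANTIATED (`𝔬A := ops310WalkYO …`, ✓`B9WalkLettersOps310`): the cube letters `OcA`, print's `Δ_a` on the bond carrier `ΔaA`, the (3.105) factor families `RfA ∕ RtA` with localisations `SFA`, the reading domain `nearA` and the factor agreement `AgreeFA` stay GENERIC ((Q1) = P0)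
    (SFA : ∀ x : MemberY θ.d₆ θ.ℓ₆ θ.hd' θ.hL' θ.b₀ θ.b₁ Mstar, (↥(cubes x.toKIdx.D.toDomains) ⊕ ↥(cubes x.toKIdx.D.toDomains) ⊕ ↥(cubes x.toKIdx.D.toDomains) ⊕ ↥(cubes x.toKIdx.D.toDomains)) → Finset (geo9Y x).Site)
    (AgreeFA : ∀ x : MemberY θ.d₆ θ.ℓ₆ θ.hd' θ.hL' θ.b₀ θ.b₁ Mstar, (↥(cubes x.toKIdx.D.toDomains) ⊕ ↥(cubes x.toKIdx.D.toDomains) ⊕ ↥(cubes x.toKIdx.D.toDomains) ⊕ ↥(cubes x.toKIdx.D.toDomains)) → (bg9YR (Matrix (Fin N) (Fin N) ℂ) (specialUnitaryUnits (Fin N)) R₁ R₂ x).Cfg → (bg9YR (Matrix (Fin N) (Fin N) ℂ) (specialUnitaryUnits (Fin N)) R₁ R₂ x).Cfg → Prop)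
    -- [W-b] the static thresholds of the bond record (site ones: `hρ3 hNc hN' hCℓ hKc`) and the count of the generic factor localisations
    (hρ3A : 3 ≤ q.ρ) (hNcA : walkCntY θ.d₆ θ.ℓ₆ θ.hd' θ.hL' θ.b₀ θ.b₁ Mstar ≤ q.Nc) (hN'A : walkCntY θ.d₆ θ.ℓ₆ θ.hd' θ.hL' θ.b₀ θ.b₁ Mstar ≤ q.N') (hCℓA : (((θ.ℓ₆ + 1 : ℕ) : ℝ)) ^ 2 ≤ q.Cℓ) (hKcA : KcWalkY θ.d₆ θ.ℓ₆ θ.hd' θ.hL' θ.b₀ θ.b₁ (trBasis N) ≤ q.Kc)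
    (hcntFA : ∀ (x : MemberY θ.d₆ θ.ℓ₆ θ.hd' θ.hL' θ.b₀ θ.b₁ Mstar) (a : (geo9Y x).Site), (∑ q', if a ∈ SFA x q' then (1 : ℝ) else 0) ≤ q.NF)
    -- [W-b] what is left DISPLAYED of `h36A'`: the (3.89)-type factor bounds of the families `RfA ∕ RtA` at the instance, and the four U-laws of the generic letters ((3.27) `GΔ_a = Δ_aG = 1`, (3.105) «Δ_aG₀ = I − R» and its transpose)
    -- [g34 «KESC-CL»] THE BOND LETTER AT THE (C) LETTER OF RECORD (dag-n06-c LOCATED-34 ∕ dag-n06-d ANSWER, 2026-08-31): print's `G_□(U)` OF THE SEQUENCE {Ω_n(□)} (p. 409 l. 1–5) —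
    -- `GDirCKY x.toKIdx □ (DP_□D*) (bondsOverY Ω₀(□)) = dirInv_{𝟙_B}(Δ_{loc,□}[Q^knit_□](U) − DP_□D*(U))` keyed on the cube sequence's OWN knit averaging pair `(QknitCubeY, QsknitCubeY)` (✓`B9Eq3115KnitCubeLetterY`),
    -- replacing the hybrid (M) letter `GDirBY 𝔮ʳᵉᶜ 𝔮⋆ʳᵉᶜ (DP_□D*) (bondsOverY Ω₀)` (member-levelled `Q*aQ`); every bond row below (`hfacA hUnitA hRfagrA h36HA h36Ab hopIA h36A2`, the (3.105) families, the
    -- conclusion's ops record) is re-read at this letter; the (3.105) rows `hlawsA`.3∕.4 stay THEOREMS (row∕column agreement of the knit pairs on `supp h_□`, ✓`B9KnitCubeRowAgreementY`)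
    (hfacA : ∀ x, q.M₁ ≤ (geo9Y x).M → ∀ α₀ : ℝ, 0 < α₀ → c * (geo9Y x).M * α₀ ≤ q.a₁ → ∀ U : (bg9YR (Matrix (Fin N) (Fin N) ℂ) (specialUnitaryUnits (Fin N)) R₁ R₂ x).Cfg, (bg9YR (Matrix (Fin N) (Fin N) ℂ) (specialUnitaryUnits (Fin N)) R₁ R₂ x).Reg335 c α₀ U → B9Thm310Whole.Factors389 (ops310WalkYO x (trBasis N) (bg9YR (Matrix (Fin N) (Fin N) ℂ) (specialUnitaryUnits (Fin N)) R₁ R₂ x) (fun U => U) (bI x) (lettersYOfRecordV11K N θ.toStage3Params Mstar (resYOfRecordPK N θ.toStage3Params Mstar) x).GA (fun cc : ↥(cubes x.toKIdx.D.toDomains) => GDirCKY x.toKIdx cc (DPDsDirCubeY x.toKIdx cc (B9Cor35GpDirInputsAtOne.dirDomY x.toKIdx cc)) (bondsOverY x.toKIdx (B9Cor35GpDirInputsAtOne.dirDomY x.toKIdx cc))) (S0coKq x.toKIdx (trBasis N) (bg9YR (Matrix (Fin N) (Fin N) ℂ) (specialUnitaryUnits (Fin N)) R₁ R₂ x) (fun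 V => V) (qKnitOfRecord N θ.toStage3Params x.toKIdx) (qsKnitOfRecord N θ.toStage3Params x.toKIdx) (parKnitY x.toKIdx) (GpPhysY x.toKIdx (parKnitY x.toKIdx))) (fun U => eq3105FamQLY x.toKIdx (trBasis N) (qKnitOfRecord N θ.toStage3Params x.toKIdx) (qsKnitOfRecord N θ.toStage3Params x.toKIdx) (parKnitY x.toKIdx) (GpPhysY x.toKIdx (parKnitY x.toKIdx)) (fun cc : ↥(cubes x.toKIdx.D.toDomains) => GDirCKY x.toKIdx cc (DPDsDirCubeY x.toKIdx cc (B9Cor35GpDirInputsAtOne.dirDomY x.toKIdx cc)) (bondsOverY x.toKIdx (B9Cor35GpDirInputsAtOne.dirDomY x.toKIdx cc))) (fun cc : ↥(cubes x.toKIdx.D.toDomains) => (DPDsDirCubeY x.toKIdx cc (B9Cor35GpDirInputsAtOne.dirDomY x.toKIdx cc))) (fun (cc : ↥(cubes x.toKIdx.D.toDomains)) (U : (bg9YR (Matrix (Fin N) (Fin N) ℂ) (specialUnitaryUnits (Fin N)) R₁ R₂ x).Cfg) => (P1DirCubeY x.toKIdx cc (hTY x.toKIdx cc) (B9Cor35GpDirInputsAtOne.dirDomY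 x.toKIdx cc)) U) U) (fun U => eq3105FamQTLY x.toKIdx (trBasis N) (qKnitOfRecord N θ.toStage3Params x.toKIdx) (qsKnitOfRecord N θ.toStage3Params x.toKIdx) (parKnitY x.toKIdx) (GpPhysY x.toKIdx (parKnitY x.toKIdx)) (fun cc : ↥(cubes x.toKIdx.D.toDomains) => GDirCKY x.toKIdx cc (DPDsDirCubeY x.toKIdx cc (B9Cor35GpDirInputsAtOne.dirDomY x.toKIdx cc)) (bondsOverY x.toKIdx (B9Cor35GpDirInputsAtOne.dirDomY x.toKIdx cc))) (fun cc : ↥(cubes x.toKIdx.D.toDomains) => (DPDsDirCubeY x.toKIdx cc (B9Cor35GpDirInputsAtOne.dirDomY x.toKIdx cc))) (fun (cc : ↥(cubes x.toKIdx.D.toDomains)) (U : (bg9YR (Matrix (Fin N) (Fin N) ℂ) (specialUnitaryUnits (Fin N)) R₁ R₂ x).Cfg) => (P1DirCubeY x.toKIdx cc (hTY x.toKIdx cc) (B9Cor35GpDirInputsAtOne.dirDomY x.toKIdx cc)) U) U) (SFA x)) 1 (H x) q.θ₀ q.δ₀ U)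
    -- [W-b] locality of the generic letters (print p.410 l.14–15 «G_□ depends on U restricted to Ω₀(□)», p.413 «R_α(X) … U restricted to X̃⁵»)
    -- [g33 «KESC-AγH»] THE BOND LETTER AT THE (γ) LETTER OF RECORD (node00-def-Y ALERT (δ) + CURE, 2026-08-31): `G_□(U) = GDirBY 𝔮 𝔮⋆ (DP_□D*) (bondsOverY Ω₀(□))` with print's
    -- `P_□ = G′_□Q′*_□(Q′_□G′_□²Q′*_□)⁻¹Q′_□G′_□` built OVER THE CUBE SEQUENCE's BLOCKS 𝔅_□ and `X_□` inverted on the blocks INSIDE Ω₀(□) (✓`Node00.OpsYCubeProjectionG.DPDsDirCubeY … (dirDomY …)` = `DPDsCubeDY … (parKnitCubeY …) (G′_□) (insideBlkY … Ω₀(□))`), replacing the pin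
    -- `DPDsY … (parKnitCubeY …) (G′_□)` (member blocks; `Ring.inverse` of a non-unit = 0 off the tiny-torus regime); the (3.105) families are ✓`B9Eq3105CoordsDirichletBondGY.eq3105FamQGY∕QTGY`
    -- [g32 «KESCAG» ∕ g33 «KESC-AγH»] `hlawsA` CONSUMED at the pinned bond letters: .1∕.2 (G·Δ_a = Δ_a·G = 1) are Thm-3.11-fed — THEOREMS at section-carrying members (✓`N06DeltaAInverseAtRecord.invLaws_GcoK_GA_S0coKq_at_scMember`),
    -- DISPLAYED at inner-corner members (R0′, like `hΔAKn`); .3∕.4 ((3.105) and its transpose) are THEOREMS (✓`B9Eq3105CoordsDirichletBondY` over node00-def-Y ✓`Node00.OpsYCubeDirInverseBond`) modulo the regime row `hUnitA`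
    (hinvA12n : ∀ x : MemberY θ.d₆ θ.ℓ₆ θ.hd' θ.hL' θ.b₀ θ.b₁ Mstar, ¬ Function.Surjective (β x.hN x.D x.hk) → q.M₁ ≤ (geo9Y x).M → ∀ α₀ : ℝ, 0 < α₀ → c * (geo9Y x).M * α₀ ≤ q.a₁ → ∀ U : (bg9YR (Matrix (Fin N) (Fin N) ℂ) (specialUnitaryUnits (Fin N)) R₁ R₂ x).Cfg, (bg9YR (Matrix (Fin N) (Fin N) ℂ) (specialUnitaryUnits (Fin N)) R₁ R₂ x).Reg335 c α₀ U → GcoK x.toKIdx (trBasis N) (bg9YR (Matrix (Fin N) (Fin N) ℂ) (specialUnitaryUnits (Fin N)) R₁ R₂ x) (fun U => U) (lettersYOfRecordV11K N θ.toStage3Params Mstar (resYOfRecordPK N θ.toStage3Params Mstar) x).GA U * (S0coKq x.toKIdx (trBasis N) (bg9YR (Matrix (Fin N) (Fin N) ℂ) (specialUnitaryUnits (Fin N)) R₁ R₂ x) (fun V => V) (qKnitOfRecord N θ.toStage3Params x.toKIdx) (qsKnitOfRecord N θ.toStage3Params x.toKIdx) (parKnitY x.toKIdx) (GpPhysY x.toKIdx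 (parKnitY x.toKIdx))) U = 1 ∧ (S0coKq x.toKIdx (trBasis N) (bg9YR (Matrix (Fin N) (Fin N) ℂ) (specialUnitaryUnits (Fin N)) R₁ R₂ x) (fun V => V) (qKnitOfRecord N θ.toStage3Params x.toKIdx) (qsKnitOfRecord N θ.toStage3Params x.toKIdx) (parKnitY x.toKIdx) (GpPhysY x.toKIdx (parKnitY x.toKIdx))) U * GcoK x.toKIdx (trBasis N) (bg9YR (Matrix (Fin N) (Fin N) ℂ) (specialUnitaryUnits (Fin N)) R₁ R₂ x) (fun U => U) (lettersYOfRecordV11K N θ.toStage3Params Mstar (resYOfRecordPK N θ.toStage3Params Mstar) x).GA U = 1)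
    -- [g32 «KESCAG»] THE REGIME OF PRINT's `G_□(U)`: the compressed `Ω₀Δ_{a,□}[𝔮](U)Ω₀ ⊕ 1` is a unit (Thm 3.3 ∕ Cor. 3.6 FOR THE SEQUENCE — NOT in the tree at U ≠ 1: `curv2Y` is unsigned, dag-n06-j 2026-08-31) — DISPLAYED
    -- [g33 «KESC-AγK»] the locality row `hOagrA` (G_□(U) = G_□(U′) at the bond letter of record under `agree310WalkYO … (nearA x) □ U U′`) CONSUMED —
    -- ✓`B9CubeDirInverseBondLocalityAtRecordY.GDirBY_DPDsDirCubeY_congr_of_agree310WalkYO` (+ ✓`B9CubeDirInverseBondLocalityY`, (L2) ✓`isLocalQ_qKnitOfRecord`); DISPLAYED instead: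
    -- two GEOMETRIC inclusions of the cover (print p. 410 «Ω₀(□) ⊂ □̃⁵»): the reading set of G_□ over Ω₀(□), and the knit letter's double blocks meeting the bonds over Ω₀(□), lie in `nearA x □`
    -- [g34 «KESC-CL»] re-read over the index bonds of the CUBE SEQUENCE (the (C) letter's averaging is `Q^knit_□`; dependency sets ✓`B9Eq3115KnitCubeLetterY.knitDepP` at `ι.1`)
    (hRfagrA : ∀ (x : MemberY θ.d₆ θ.ℓ₆ θ.hd' θ.hL' θ.b₀ θ.b₁ Mstar) (a : (↥(cubes x.toKIdx.D.toDomains) ⊕ ↥(cubes x.toKIdx.D.toDomains) ⊕ ↥(cubes x.toKIdx.D.toDomains) ⊕ ↥(cubes x.toKIdx.D.toDomains))) (U U' : (bg9YR (Matrix (Fin N) (Fin N) ℂ) (specialUnitaryUnits (Fin N)) R₁ R₂ x).Cfg), AgreeFA x a U U' → (eq3105FamQLY x.toKIdx (trBasis N) (qKnitOfRecord N θ.toStage3Params x.toKIdx) (qsKnitOfRecord N θ.toStage3Params x.toKIdx) (parKnitY x.toKIdx) (GpPhysY x.toKIdx (parKnitY x.toKIdx)) (fun cc : ↥(cubes x.toKIdx.D.toDomains)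 => GDirCKY x.toKIdx cc (DPDsDirCubeY x.toKIdx cc (B9Cor35GpDirInputsAtOne.dirDomY x.toKIdx cc)) (bondsOverY x.toKIdx (B9Cor35GpDirInputsAtOne.dirDomY x.toKIdx cc))) (fun cc : ↥(cubes x.toKIdx.D.toDomains) => (DPDsDirCubeY x.toKIdx cc (B9Cor35GpDirInputsAtOne.dirDomY x.toKIdx cc))) (fun (cc : ↥(cubes x.toKIdx.D.toDomains)) (U : (bg9YR (Matrix (Fin N) (Fin N) ℂ) (specialUnitaryUnits (Fin N)) R₁ R₂ x).Cfg) => (P1DirCubeY x.toKIdx cc (hTY x.toKIdx cc) (B9Cor35GpDirInputsAtOne.dirDomY x.toKIdx cc)) U) U) a = (eq3105FamQLY x.toKIdx (trBasis N) (qKnitOfRecord N θ.toStage3Params x.toKIdx) (qsKnitOfRecord N θ.toStage3Params x.toKIdx) (parKnitY x.toKIdx) (GpPhysY x.toKIdx (parKnitY x.toKIdx)) (fun cc : ↥(cubes x.toKIdx.D.toDomains) => GDirCKY x.toKIdx cc (DPDsDirCubeY x.toKIdx cc (B9Cor35GpDirInputsAtOne.dirDomY x.toKIdx cc)) (bondsOverY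 x.toKIdx (B9Cor35GpDirInputsAtOne.dirDomY x.toKIdx cc))) (fun cc : ↥(cubes x.toKIdx.D.toDomains) => (DPDsDirCubeY x.toKIdx cc (B9Cor35GpDirInputsAtOne.dirDomY x.toKIdx cc))) (fun (cc : ↥(cubes x.toKIdx.D.toDomains)) (U : (bg9YR (Matrix (Fin N) (Fin N) ℂ) (specialUnitaryUnits (Fin N)) R₁ R₂ x).Cfg) => (P1DirCubeY x.toKIdx cc (hTY x.toKIdx cc) (B9Cor35GpDirInputsAtOne.dirDomY x.toKIdx cc)) U) U') a)
    (𝔭A : ∀ x : MemberY θ.d₆ θ.ℓ₆ θ.hd' θ.hL' θ.b₀ θ.b₁ Mstar, HolderProbes (geo9Y x) (bg9YR (Matrix (Fin N) (Fin N) ℂ) (specialUnitaryUnits (Fin N)) R₁ R₂ x) (XBK (TrIdx N) x.toKIdx) (XBK (TrIdx N) x.toKIdx) (PK (FBondY x.toKIdx) (Fin (θ.d₆ + 1)) (TrIdx N)) (PK (FBondY x.toKIdx) (Fin (θ.d₆ + 1)) (TrIdx N))) (h𝔭A : ∀ x : MemberY θ.d₆ θ.ℓ₆ θ.hd' θ.hL'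 θ.b₀ θ.b₁ Mstar, 𝔭A x = holderProbesKA x.toKIdx (trBasis N) (bg9YR (Matrix (Fin N) (Fin N) ℂ) (specialUnitaryUnits (Fin N)) R₁ R₂ x) (fun U => U) (lettersYOfRecordV11K N θ.toStage3Params Mstar (resYOfRecordPK N θ.toStage3Params Mstar) x).parB (bI x)) (bHXA : ∀ x : MemberY θ.d₆ θ.ℓ₆ θ.hd' θ.hL' θ.b₀ θ.b₁ Mstar, ℝ → BlockNorm (toB6 (geo9Y x) 1 (H x)) ((XBK (TrIdx N) x.toKIdx) → ℝ)) (SHA S3A SIA SMA : ∀ x : MemberY θ.d₆ θ.ℓ₆ θ.hd' θ.hL' θ.b₀ θ.b₁ Mstar, ↥(cubes x.toKIdx.D.toDomains) → Finset (geo9Y x).Site) (hbHXA : ∀ x : MemberY θ.d₆ θ.ℓ₆ θ.hd' θ.hL' θ.b₀ θ.b₁ Mstar, bHXA x = fun ε => letI : Fintype (B9GeoNormsKLevelV1.geo9K x.toKIdx).Site := (inferInstance : Fintype (geo9Y x).Site); bHK x.toKIdx (bI x) ε) (h36HA : ∀ x, q.M₁ ≤ (geo9Y x).M → ∀ α₀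 : ℝ, 0 < α₀ → c * (geo9Y x).M * α₀ ≤ q.a₁ → ∀ U : (bg9YR (Matrix (Fin N) (Fin N) ℂ) (specialUnitaryUnits (Fin N)) R₁ R₂ x).Cfg, (bg9YR (Matrix (Fin N) (Fin N) ℂ) (specialUnitaryUnits (Fin N)) R₁ R₂ x).Reg335 c α₀ U → HolderLegs310 (ops310WalkYO x (trBasis N) (bg9YR (Matrix (Fin N) (Fin N) ℂ) (specialUnitaryUnits (Fin N)) R₁ R₂ x) (fun U => U) (bI x) (lettersYOfRecordV11K N θ.toStage3Params Mstar (resYOfRecordPK N θ.toStage3Params Mstar) x).GA (fun cc : ↥(cubes x.toKIdx.D.toDomains) => GDirCKY x.toKIdx cc (DPDsDirCubeY x.toKIdx cc (B9Cor35GpDirInputsAtOne.dirDomY x.toKIdx cc)) (bondsOverY x.toKIdx (B9Cor35GpDirInputsAtOne.dirDomY x.toKIdx cc))) (S0coKq x.toKIdx (trBasis N) (bg9YR (Matrix (Fin N) (Fin N) ℂ) (specialUnitaryUnits (Fin N)) R₁ R₂ x) (fun V => V) (qKnitOfRecord N θ.toStage3Params x.toKIdx) (qsKnitOfRecord N θ.toStage3Params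 x.toKIdx) (parKnitY x.toKIdx) (GpPhysY x.toKIdx (parKnitY x.toKIdx))) (fun U => eq3105FamQLY x.toKIdx (trBasis N) (qKnitOfRecord N θ.toStage3Params x.toKIdx) (qsKnitOfRecord N θ.toStage3Params x.toKIdx) (parKnitY x.toKIdx) (GpPhysY x.toKIdx (parKnitY x.toKIdx)) (fun cc : ↥(cubes x.toKIdx.D.toDomains) => GDirCKY x.toKIdx cc (DPDsDirCubeY x.toKIdx cc (B9Cor35GpDirInputsAtOne.dirDomY x.toKIdx cc)) (bondsOverY x.toKIdx (B9Cor35GpDirInputsAtOne.dirDomY x.toKIdx cc))) (fun cc : ↥(cubes x.toKIdx.D.toDomains) => (DPDsDirCubeY x.toKIdx cc (B9Cor35GpDirInputsAtOne.dirDomY x.toKIdx cc))) (fun (cc : ↥(cubes x.toKIdx.D.toDomains)) (U : (bg9YR (Matrix (Fin N) (Fin N) ℂ) (specialUnitaryUnits (Fin N)) R₁ R₂ x).Cfg) => (P1DirCubeY x.toKIdx cc (hTY x.toKIdx cc) (B9Cor35GpDirInputsAtOne.dirDomY x.toKIdx cc)) U) U) (fun U => eq3105FamQTLY x.toKIdx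 (trBasis N) (qKnitOfRecord N θ.toStage3Params x.toKIdx) (qsKnitOfRecord N θ.toStage3Params x.toKIdx) (parKnitY x.toKIdx) (GpPhysY x.toKIdx (parKnitY x.toKIdx)) (fun cc : ↥(cubes x.toKIdx.D.toDomains) => GDirCKY x.toKIdx cc (DPDsDirCubeY x.toKIdx cc (B9Cor35GpDirInputsAtOne.dirDomY x.toKIdx cc)) (bondsOverY x.toKIdx (B9Cor35GpDirInputsAtOne.dirDomY x.toKIdx cc))) (fun cc : ↥(cubes x.toKIdx.D.toDomains) => (DPDsDirCubeY x.toKIdx cc (B9Cor35GpDirInputsAtOne.dirDomY x.toKIdx cc))) (fun (cc : ↥(cubes x.toKIdx.D.toDomains)) (U : (bg9YR (Matrix (Fin N) (Fin N) ℂ) (specialUnitaryUnits (Fin N)) R₁ R₂ x).Cfg) => (P1DirCubeY x.toKIdx cc (hTY x.toKIdx cc) (B9Cor35GpDirInputsAtOne.dirDomY x.toKIdx cc)) U) U) (SFA x)) (𝔭A x) 1 (H x) (SHA x) q.Bl q.δ₀ U ∧ FactorsHolder310 (ops310WalkYO x (trBasis N) (bg9YR (Matrix (Fin N) (Fin N)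 ℂ) (specialUnitaryUnits (Fin N)) R₁ R₂ x) (fun U => U) (bI x) (lettersYOfRecordV11K N θ.toStage3Params Mstar (resYOfRecordPK N θ.toStage3Params Mstar) x).GA (fun cc : ↥(cubes x.toKIdx.D.toDomains) => GDirCKY x.toKIdx cc (DPDsDirCubeY x.toKIdx cc (B9Cor35GpDirInputsAtOne.dirDomY x.toKIdx cc)) (bondsOverY x.toKIdx (B9Cor35GpDirInputsAtOne.dirDomY x.toKIdx cc))) (S0coKq x.toKIdx (trBasis N) (bg9YR (Matrix (Fin N) (Fin N) ℂ) (specialUnitaryUnits (Fin N)) R₁ R₂ x) (fun V => V) (qKnitOfRecord N θ.toStage3Params x.toKIdx) (qsKnitOfRecord N θ.toStage3Params x.toKIdx) (parKnitY x.toKIdx) (GpPhysY x.toKIdx (parKnitY x.toKIdx))) (fun U => eq3105FamQLY x.toKIdx (trBasis N) (qKnitOfRecord N θ.toStage3Params x.toKIdx) (qsKnitOfRecord N θ.toStage3Params x.toKIdx) (parKnitY x.toKIdx) (GpPhysY x.toKIdx (parKnitY x.toKIdx)) (fun cc : ↥(cubes x.toKIdx.D.toDomains) => GDirCKY x.toKIdx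 cc (DPDsDirCubeY x.toKIdx cc (B9Cor35GpDirInputsAtOne.dirDomY x.toKIdx cc)) (bondsOverY x.toKIdx (B9Cor35GpDirInputsAtOne.dirDomY x.toKIdx cc))) (fun cc : ↥(cubes x.toKIdx.D.toDomains) => (DPDsDirCubeY x.toKIdx cc (B9Cor35GpDirInputsAtOne.dirDomY x.toKIdx cc))) (fun (cc : ↥(cubes x.toKIdx.D.toDomains)) (U : (bg9YR (Matrix (Fin N) (Fin N) ℂ) (specialUnitaryUnits (Fin N)) R₁ R₂ x).Cfg) => (P1DirCubeY x.toKIdx cc (hTY x.toKIdx cc) (B9Cor35GpDirInputsAtOne.dirDomY x.toKIdx cc)) U) U) (fun U => eq3105FamQTLY x.toKIdx (trBasis N) (qKnitOfRecord N θ.toStage3Params x.toKIdx) (qsKnitOfRecord N θ.toStage3Params x.toKIdx) (parKnitY x.toKIdx) (GpPhysY x.toKIdx (parKnitY x.toKIdx)) (fun cc : ↥(cubes x.toKIdx.D.toDomains) => GDirCKY x.toKIdx cc (DPDsDirCubeY x.toKIdx cc (B9Cor35GpDirInputsAtOne.dirDomY x.toKIdx cc)) (bondsOverY x.toKIdx (B9Cor35GpDirInputsAtOne.dirDomY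 x.toKIdx cc))) (fun cc : ↥(cubes x.toKIdx.D.toDomains) => (DPDsDirCubeY x.toKIdx cc (B9Cor35GpDirInputsAtOne.dirDomY x.toKIdx cc))) (fun (cc : ↥(cubes x.toKIdx.D.toDomains)) (U : (bg9YR (Matrix (Fin N) (Fin N) ℂ) (specialUnitaryUnits (Fin N)) R₁ R₂ x).Cfg) => (P1DirCubeY x.toKIdx cc (hTY x.toKIdx cc) (B9Cor35GpDirInputsAtOne.dirDomY x.toKIdx cc)) U) U) (SFA x)) (𝔭A x) 1 (H x) q.Bt q.δ₀ U ∧ (L2SecondLegs310 (ops310WalkYO x (trBasis N) (bg9YR (Matrix (Fin N) (Fin N) ℂ) (specialUnitaryUnits (Fin N)) R₁ R₂ x) (fun U => U) (bI x) (lettersYOfRecordV11K N θ.toStage3Params Mstar (resYOfRecordPK N θ.toStage3Params Mstar) x).GA (fun cc : ↥(cubes x.toKIdx.D.toDomains) => GDirCKY x.toKIdx cc (DPDsDirCubeY x.toKIdx cc (B9Cor35GpDirInputsAtOne.dirDomY x.toKIdx cc)) (bondsOverY x.toKIdx (B9Cor35GpDirInputsAtOne.dirDomY x.toKIdx cc)))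 (S0coKq x.toKIdx (trBasis N) (bg9YR (Matrix (Fin N) (Fin N) ℂ) (specialUnitaryUnits (Fin N)) R₁ R₂ x) (fun V => V) (qKnitOfRecord N θ.toStage3Params x.toKIdx) (qsKnitOfRecord N θ.toStage3Params x.toKIdx) (parKnitY x.toKIdx) (GpPhysY x.toKIdx (parKnitY x.toKIdx))) (fun U => eq3105FamQLY x.toKIdx (trBasis N) (qKnitOfRecord N θ.toStage3Params x.toKIdx) (qsKnitOfRecord N θ.toStage3Params x.toKIdx) (parKnitY x.toKIdx) (GpPhysY x.toKIdx (parKnitY x.toKIdx)) (fun cc : ↥(cubes x.toKIdx.D.toDomains) => GDirCKY x.toKIdx cc (DPDsDirCubeY x.toKIdx cc (B9Cor35GpDirInputsAtOne.dirDomY x.toKIdx cc)) (bondsOverY x.toKIdx (B9Cor35GpDirInputsAtOne.dirDomY x.toKIdx cc))) (fun cc : ↥(cubes x.toKIdx.D.toDomains) => (DPDsDirCubeY x.toKIdx cc (B9Cor35GpDirInputsAtOne.dirDomY x.toKIdx cc))) (fun (cc : ↥(cubes x.toKIdx.D.toDomains)) (U : (bg9YR (Matrix (Fin N) (Fin N)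 ℂ) (specialUnitaryUnits (Fin N)) R₁ R₂ x).Cfg) => (P1DirCubeY x.toKIdx cc (hTY x.toKIdx cc) (B9Cor35GpDirInputsAtOne.dirDomY x.toKIdx cc)) U) U) (fun U => eq3105FamQTLY x.toKIdx (trBasis N) (qKnitOfRecord N θ.toStage3Params x.toKIdx) (qsKnitOfRecord N θ.toStage3Params x.toKIdx) (parKnitY x.toKIdx) (GpPhysY x.toKIdx (parKnitY x.toKIdx)) (fun cc : ↥(cubes x.toKIdx.D.toDomains) => GDirCKY x.toKIdx cc (DPDsDirCubeY x.toKIdx cc (B9Cor35GpDirInputsAtOne.dirDomY x.toKIdx cc)) (bondsOverY x.toKIdx (B9Cor35GpDirInputsAtOne.dirDomY x.toKIdx cc))) (fun cc : ↥(cubes x.toKIdx.D.toDomains) => (DPDsDirCubeY x.toKIdx cc (B9Cor35GpDirInputsAtOne.dirDomY x.toKIdx cc))) (fun (cc : ↥(cubes x.toKIdx.D.toDomains)) (U : (bg9YR (Matrix (Fin N) (Fin N) ℂ) (specialUnitaryUnits (Fin N)) R₁ R₂ x).Cfg) => (P1DirCubeY x.toKIdx cc (hTY x.toKIdx cc) (B9Cor35GpDirInputsAtOne.dirDomY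 x.toKIdx cc)) U) U) (SFA x)) (dirOps310WalkYO x (trBasis N) (bg9YR (Matrix (Fin N) (Fin N) ℂ) (specialUnitaryUnits (Fin N)) R₁ R₂ x) (fun U => U) (bI x) (lettersYOfRecordV11K N θ.toStage3Params Mstar (resYOfRecordPK N θ.toStage3Params Mstar) x).GA (fun cc : ↥(cubes x.toKIdx.D.toDomains) => GDirCKY x.toKIdx cc (DPDsDirCubeY x.toKIdx cc (B9Cor35GpDirInputsAtOne.dirDomY x.toKIdx cc)) (bondsOverY x.toKIdx (B9Cor35GpDirInputsAtOne.dirDomY x.toKIdx cc))) (S0coKq x.toKIdx (trBasis N) (bg9YR (Matrix (Fin N) (Fin N) ℂ) (specialUnitaryUnits (Fin N)) R₁ R₂ x) (fun V => V) (qKnitOfRecord N θ.toStage3Params x.toKIdx) (qsKnitOfRecord N θ.toStage3Params x.toKIdx) (parKnitY x.toKIdx) (GpPhysY x.toKIdx (parKnitY x.toKIdx))) (fun U => eq3105FamQLY x.toKIdx (trBasis N) (qKnitOfRecord N θ.toStage3Params x.toKIdx) (qsKnitOfRecord N θ.toStage3Params x.toKIdx) (parKnitY x.toKIdx) (GpPhysY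 x.toKIdx (parKnitY x.toKIdx)) (fun cc : ↥(cubes x.toKIdx.D.toDomains) => GDirCKY x.toKIdx cc (DPDsDirCubeY x.toKIdx cc (B9Cor35GpDirInputsAtOne.dirDomY x.toKIdx cc)) (bondsOverY x.toKIdx (B9Cor35GpDirInputsAtOne.dirDomY x.toKIdx cc))) (fun cc : ↥(cubes x.toKIdx.D.toDomains) => (DPDsDirCubeY x.toKIdx cc (B9Cor35GpDirInputsAtOne.dirDomY x.toKIdx cc))) (fun (cc : ↥(cubes x.toKIdx.D.toDomains)) (U : (bg9YR (Matrix (Fin N) (Fin N) ℂ) (specialUnitaryUnits (Fin N)) R₁ R₂ x).Cfg) => (P1DirCubeY x.toKIdx cc (hTY x.toKIdx cc) (B9Cor35GpDirInputsAtOne.dirDomY x.toKIdx cc)) U) U) (fun U => eq3105FamQTLY x.toKIdx (trBasis N) (qKnitOfRecord N θ.toStage3Params x.toKIdx) (qsKnitOfRecord N θ.toStage3Params x.toKIdx) (parKnitY x.toKIdx) (GpPhysY x.toKIdx (parKnitY x.toKIdx)) (fun cc : ↥(cubes x.toKIdx.D.toDomains) => GDirCKY x.toKIdx cc (DPDsDirCubeY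 x.toKIdx cc (B9Cor35GpDirInputsAtOne.dirDomY x.toKIdx cc)) (bondsOverY x.toKIdx (B9Cor35GpDirInputsAtOne.dirDomY x.toKIdx cc))) (fun cc : ↥(cubes x.toKIdx.D.toDomains) => (DPDsDirCubeY x.toKIdx cc (B9Cor35GpDirInputsAtOne.dirDomY x.toKIdx cc))) (fun (cc : ↥(cubes x.toKIdx.D.toDomains)) (U : (bg9YR (Matrix (Fin N) (Fin N) ℂ) (specialUnitaryUnits (Fin N)) R₁ R₂ x).Cfg) => (P1DirCubeY x.toKIdx cc (hTY x.toKIdx cc) (B9Cor35GpDirInputsAtOne.dirDomY x.toKIdx cc)) U) U) (SFA x)) 1 (H x) (S3A x) q3.B3 q.δ₀ U ∧ ∀ a, IsTransposePair ((ops310WalkYO x (trBasis N) (bg9YR (Matrix (Fin N) (Fin N) ℂ) (specialUnitaryUnits (Fin N)) R₁ R₂ x) (fun U => U) (bI x) (lettersYOfRecordV11K N θ.toStage3Params Mstar (resYOfRecordPK N θ.toStage3Params Mstar) x).GA (fun cc : ↥(cubes x.toKIdx.D.toDomains) => GDirCKY x.toKIdx cc (DPDsDirCubeY x.toKIdx cc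 (B9Cor35GpDirInputsAtOne.dirDomY x.toKIdx cc)) (bondsOverY x.toKIdx (B9Cor35GpDirInputsAtOne.dirDomY x.toKIdx cc))) (S0coKq x.toKIdx (trBasis N) (bg9YR (Matrix (Fin N) (Fin N) ℂ) (specialUnitaryUnits (Fin N)) R₁ R₂ x) (fun V => V) (qKnitOfRecord N θ.toStage3Params x.toKIdx) (qsKnitOfRecord N θ.toStage3Params x.toKIdx) (parKnitY x.toKIdx) (GpPhysY x.toKIdx (parKnitY x.toKIdx))) (fun U => eq3105FamQLY x.toKIdx (trBasis N) (qKnitOfRecord N θ.toStage3Params x.toKIdx) (qsKnitOfRecord N θ.toStage3Params x.toKIdx) (parKnitY x.toKIdx) (GpPhysY x.toKIdx (parKnitY x.toKIdx)) (fun cc : ↥(cubes x.toKIdx.D.toDomains) => GDirCKY x.toKIdx cc (DPDsDirCubeY x.toKIdx cc (B9Cor35GpDirInputsAtOne.dirDomY x.toKIdx cc)) (bondsOverY x.toKIdx (B9Cor35GpDirInputsAtOne.dirDomY x.toKIdx cc))) (fun cc : ↥(cubes x.toKIdx.D.toDomains) => (DPDsDirCubeY x.toKIdx cc (B9Cor35GpDirInputsAtOne.dirDomY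 x.toKIdx cc))) (fun (cc : ↥(cubes x.toKIdx.D.toDomains)) (U : (bg9YR (Matrix (Fin N) (Fin N) ℂ) (specialUnitaryUnits (Fin N)) R₁ R₂ x).Cfg) => (P1DirCubeY x.toKIdx cc (hTY x.toKIdx cc) (B9Cor35GpDirInputsAtOne.dirDomY x.toKIdx cc)) U) U) (fun U => eq3105FamQTLY x.toKIdx (trBasis N) (qKnitOfRecord N θ.toStage3Params x.toKIdx) (qsKnitOfRecord N θ.toStage3Params x.toKIdx) (parKnitY x.toKIdx) (GpPhysY x.toKIdx (parKnitY x.toKIdx)) (fun cc : ↥(cubes x.toKIdx.D.toDomains) => GDirCKY x.toKIdx cc (DPDsDirCubeY x.toKIdx cc (B9Cor35GpDirInputsAtOne.dirDomY x.toKIdx cc)) (bondsOverY x.toKIdx (B9Cor35GpDirInputsAtOne.dirDomY x.toKIdx cc))) (fun cc : ↥(cubes x.toKIdx.D.toDomains) => (DPDsDirCubeY x.toKIdx cc (B9Cor35GpDirInputsAtOne.dirDomY x.toKIdx cc))) (fun (cc : ↥(cubes x.toKIdx.D.toDomains)) (U : (bg9YR (Matrix (Fin N) (Fin N) ℂ)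 (specialUnitaryUnits (Fin N)) R₁ R₂ x).Cfg) => (P1DirCubeY x.toKIdx cc (hTY x.toKIdx cc) (B9Cor35GpDirInputsAtOne.dirDomY x.toKIdx cc)) U) U) (SFA x)).Rt U a) ((ops310WalkYO x (trBasis N) (bg9YR (Matrix (Fin N) (Fin N) ℂ) (specialUnitaryUnits (Fin N)) R₁ R₂ x) (fun U => U) (bI x) (lettersYOfRecordV11K N θ.toStage3Params Mstar (resYOfRecordPK N θ.toStage3Params Mstar) x).GA (fun cc : ↥(cubes x.toKIdx.D.toDomains) => GDirCKY x.toKIdx cc (DPDsDirCubeY x.toKIdx cc (B9Cor35GpDirInputsAtOne.dirDomY x.toKIdx cc)) (bondsOverY x.toKIdx (B9Cor35GpDirInputsAtOne.dirDomY x.toKIdx cc))) (S0coKq x.toKIdx (trBasis N) (bg9YR (Matrix (Fin N) (Fin N) ℂ) (specialUnitaryUnits (Fin N)) R₁ R₂ x) (fun V => V) (qKnitOfRecord N θ.toStage3Params x.toKIdx) (qsKnitOfRecord N θ.toStage3Params x.toKIdx) (parKnitY x.toKIdx) (GpPhysY x.toKIdx (parKnitY x.toKIdx))) (fun U => eq3105FamQLY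 x.toKIdx (trBasis N) (qKnitOfRecord N θ.toStage3Params x.toKIdx) (qsKnitOfRecord N θ.toStage3Params x.toKIdx) (parKnitY x.toKIdx) (GpPhysY x.toKIdx (parKnitY x.toKIdx)) (fun cc : ↥(cubes x.toKIdx.D.toDomains) => GDirCKY x.toKIdx cc (DPDsDirCubeY x.toKIdx cc (B9Cor35GpDirInputsAtOne.dirDomY x.toKIdx cc)) (bondsOverY x.toKIdx (B9Cor35GpDirInputsAtOne.dirDomY x.toKIdx cc))) (fun cc : ↥(cubes x.toKIdx.D.toDomains) => (DPDsDirCubeY x.toKIdx cc (B9Cor35GpDirInputsAtOne.dirDomY x.toKIdx cc))) (fun (cc : ↥(cubes x.toKIdx.D.toDomains)) (U : (bg9YR (Matrix (Fin N) (Fin N) ℂ) (specialUnitaryUnits (Fin N)) R₁ R₂ x).Cfg) => (P1DirCubeY x.toKIdx cc (hTY x.toKIdx cc) (B9Cor35GpDirInputsAtOne.dirDomY x.toKIdx cc)) U) U) (fun U => eq3105FamQTLY x.toKIdx (trBasis N) (qKnitOfRecord N θ.toStage3Params x.toKIdx) (qsKnitOfRecord N θ.toStage3Params x.toKIdx) (parKnitY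 x.toKIdx) (GpPhysY x.toKIdx (parKnitY x.toKIdx)) (fun cc : ↥(cubes x.toKIdx.D.toDomains) => GDirCKY x.toKIdx cc (DPDsDirCubeY x.toKIdx cc (B9Cor35GpDirInputsAtOne.dirDomY x.toKIdx cc)) (bondsOverY x.toKIdx (B9Cor35GpDirInputsAtOne.dirDomY x.toKIdx cc))) (fun cc : ↥(cubes x.toKIdx.D.toDomains) => (DPDsDirCubeY x.toKIdx cc (B9Cor35GpDirInputsAtOne.dirDomY x.toKIdx cc))) (fun (cc : ↥(cubes x.toKIdx.D.toDomains)) (U : (bg9YR (Matrix (Fin N) (Fin N) ℂ) (specialUnitaryUnits (Fin N)) R₁ R₂ x).Cfg) => (P1DirCubeY x.toKIdx cc (hTY x.toKIdx cc) (B9Cor35GpDirInputsAtOne.dirDomY x.toKIdx cc)) U) U) (SFA x)).Rf U a)) ∧ (InputLegsPair310 (ops310WalkYO x (trBasis N) (bg9YR (Matrix (Fin N) (Fin N) ℂ) (specialUnitaryUnits (Fin N)) R₁ R₂ x) (fun U => U) (bI x) (lettersYOfRecordV11K N θ.toStage3Params Mstar (resYOfRecordPK N θ.toStage3Params Mstar)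 x).GA (fun cc : ↥(cubes x.toKIdx.D.toDomains) => GDirCKY x.toKIdx cc (DPDsDirCubeY x.toKIdx cc (B9Cor35GpDirInputsAtOne.dirDomY x.toKIdx cc)) (bondsOverY x.toKIdx (B9Cor35GpDirInputsAtOne.dirDomY x.toKIdx cc))) (S0coKq x.toKIdx (trBasis N) (bg9YR (Matrix (Fin N) (Fin N) ℂ) (specialUnitaryUnits (Fin N)) R₁ R₂ x) (fun V => V) (qKnitOfRecord N θ.toStage3Params x.toKIdx) (qsKnitOfRecord N θ.toStage3Params x.toKIdx) (parKnitY x.toKIdx) (GpPhysY x.toKIdx (parKnitY x.toKIdx))) (fun U => eq3105FamQLY x.toKIdx (trBasis N) (qKnitOfRecord N θ.toStage3Params x.toKIdx) (qsKnitOfRecord N θ.toStage3Params x.toKIdx) (parKnitY x.toKIdx) (GpPhysY x.toKIdx (parKnitY x.toKIdx)) (fun cc : ↥(cubes x.toKIdx.D.toDomains) => GDirCKY x.toKIdx cc (DPDsDirCubeY x.toKIdx cc (B9Cor35GpDirInputsAtOne.dirDomY x.toKIdx cc)) (bondsOverY x.toKIdx (B9Cor35GpDirInputsAtOne.dirDomY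 x.toKIdx cc))) (fun cc : ↥(cubes x.toKIdx.D.toDomains) => (DPDsDirCubeY x.toKIdx cc (B9Cor35GpDirInputsAtOne.dirDomY x.toKIdx cc))) (fun (cc : ↥(cubes x.toKIdx.D.toDomains)) (U : (bg9YR (Matrix (Fin N) (Fin N) ℂ) (specialUnitaryUnits (Fin N)) R₁ R₂ x).Cfg) => (P1DirCubeY x.toKIdx cc (hTY x.toKIdx cc) (B9Cor35GpDirInputsAtOne.dirDomY x.toKIdx cc)) U) U) (fun U => eq3105FamQTLY x.toKIdx (trBasis N) (qKnitOfRecord N θ.toStage3Params x.toKIdx) (qsKnitOfRecord N θ.toStage3Params x.toKIdx) (parKnitY x.toKIdx) (GpPhysY x.toKIdx (parKnitY x.toKIdx)) (fun cc : ↥(cubes x.toKIdx.D.toDomains) => GDirCKY x.toKIdx cc (DPDsDirCubeY x.toKIdx cc (B9Cor35GpDirInputsAtOne.dirDomY x.toKIdx cc)) (bondsOverY x.toKIdx (B9Cor35GpDirInputsAtOne.dirDomY x.toKIdx cc))) (fun cc : ↥(cubes x.toKIdx.D.toDomains) => (DPDsDirCubeY x.toKIdx cc (B9Cor35GpDirInputsAtOne.dirDomY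 x.toKIdx cc))) (fun (cc : ↥(cubes x.toKIdx.D.toDomains)) (U : (bg9YR (Matrix (Fin N) (Fin N) ℂ) (specialUnitaryUnits (Fin N)) R₁ R₂ x).Cfg) => (P1DirCubeY x.toKIdx cc (hTY x.toKIdx cc) (B9Cor35GpDirInputsAtOne.dirDomY x.toKIdx cc)) U) U) (SFA x)) (dirOps310WalkYO x (trBasis N) (bg9YR (Matrix (Fin N) (Fin N) ℂ) (specialUnitaryUnits (Fin N)) R₁ R₂ x) (fun U => U) (bI x) (lettersYOfRecordV11K N θ.toStage3Params Mstar (resYOfRecordPK N θ.toStage3Params Mstar) x).GA (fun cc : ↥(cubes x.toKIdx.D.toDomains) => GDirCKY x.toKIdx cc (DPDsDirCubeY x.toKIdx cc (B9Cor35GpDirInputsAtOne.dirDomY x.toKIdx cc)) (bondsOverY x.toKIdx (B9Cor35GpDirInputsAtOne.dirDomY x.toKIdx cc))) (S0coKq x.toKIdx (trBasis N) (bg9YR (Matrix (Fin N) (Fin N) ℂ) (specialUnitaryUnits (Fin N)) R₁ R₂ x) (fun V => V) (qKnitOfRecord N θ.toStage3Params x.toKIdx) (qsKnitOfRecord N θ.toStage3Params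 x.toKIdx) (parKnitY x.toKIdx) (GpPhysY x.toKIdx (parKnitY x.toKIdx))) (fun U => eq3105FamQLY x.toKIdx (trBasis N) (qKnitOfRecord N θ.toStage3Params x.toKIdx) (qsKnitOfRecord N θ.toStage3Params x.toKIdx) (parKnitY x.toKIdx) (GpPhysY x.toKIdx (parKnitY x.toKIdx)) (fun cc : ↥(cubes x.toKIdx.D.toDomains) => GDirCKY x.toKIdx cc (DPDsDirCubeY x.toKIdx cc (B9Cor35GpDirInputsAtOne.dirDomY x.toKIdx cc)) (bondsOverY x.toKIdx (B9Cor35GpDirInputsAtOne.dirDomY x.toKIdx cc))) (fun cc : ↥(cubes x.toKIdx.D.toDomains) => (DPDsDirCubeY x.toKIdx cc (B9Cor35GpDirInputsAtOne.dirDomY x.toKIdx cc))) (fun (cc : ↥(cubes x.toKIdx.D.toDomains)) (U : (bg9YR (Matrix (Fin N) (Fin N) ℂ) (specialUnitaryUnits (Fin N)) R₁ R₂ x).Cfg) => (P1DirCubeY x.toKIdx cc (hTY x.toKIdx cc) (B9Cor35GpDirInputsAtOne.dirDomY x.toKIdx cc)) U) U) (fun U => eq3105FamQTLY x.toKIdx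 (trBasis N) (qKnitOfRecord N θ.toStage3Params x.toKIdx) (qsKnitOfRecord N θ.toStage3Params x.toKIdx) (parKnitY x.toKIdx) (GpPhysY x.toKIdx (parKnitY x.toKIdx)) (fun cc : ↥(cubes x.toKIdx.D.toDomains) => GDirCKY x.toKIdx cc (DPDsDirCubeY x.toKIdx cc (B9Cor35GpDirInputsAtOne.dirDomY x.toKIdx cc)) (bondsOverY x.toKIdx (B9Cor35GpDirInputsAtOne.dirDomY x.toKIdx cc))) (fun cc : ↥(cubes x.toKIdx.D.toDomains) => (DPDsDirCubeY x.toKIdx cc (B9Cor35GpDirInputsAtOne.dirDomY x.toKIdx cc))) (fun (cc : ↥(cubes x.toKIdx.D.toDomains)) (U : (bg9YR (Matrix (Fin N) (Fin N) ℂ) (specialUnitaryUnits (Fin N)) R₁ R₂ x).Cfg) => (P1DirCubeY x.toKIdx cc (hTY x.toKIdx cc) (B9Cor35GpDirInputsAtOne.dirDomY x.toKIdx cc)) U) U) (SFA x)) (𝔭A x) 1 (H x) (bHXA x) (SIA x) q.BI q.BI2 q.δ₀ U ∧ FactorsInputPair310 (ops310WalkYO x (trBasis N) (bg9YR (Matrix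 (Fin N) (Fin N) ℂ) (specialUnitaryUnits (Fin N)) R₁ R₂ x) (fun U => U) (bI x) (lettersYOfRecordV11K N θ.toStage3Params Mstar (resYOfRecordPK N θ.toStage3Params Mstar) x).GA (fun cc : ↥(cubes x.toKIdx.D.toDomains) => GDirCKY x.toKIdx cc (DPDsDirCubeY x.toKIdx cc (B9Cor35GpDirInputsAtOne.dirDomY x.toKIdx cc)) (bondsOverY x.toKIdx (B9Cor35GpDirInputsAtOne.dirDomY x.toKIdx cc))) (S0coKq x.toKIdx (trBasis N) (bg9YR (Matrix (Fin N) (Fin N) ℂ) (specialUnitaryUnits (Fin N)) R₁ R₂ x) (fun V => V) (qKnitOfRecord N θ.toStage3Params x.toKIdx) (qsKnitOfRecord N θ.toStage3Params x.toKIdx) (parKnitY x.toKIdx) (GpPhysY x.toKIdx (parKnitY x.toKIdx))) (fun U => eq3105FamQLY x.toKIdx (trBasis N) (qKnitOfRecord N θ.toStage3Params x.toKIdx) (qsKnitOfRecord N θ.toStage3Params x.toKIdx) (parKnitY x.toKIdx) (GpPhysY x.toKIdx (parKnitY x.toKIdx)) (fun cc : ↥(cubes x.toKIdx.D.toDomains)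 => GDirCKY x.toKIdx cc (DPDsDirCubeY x.toKIdx cc (B9Cor35GpDirInputsAtOne.dirDomY x.toKIdx cc)) (bondsOverY x.toKIdx (B9Cor35GpDirInputsAtOne.dirDomY x.toKIdx cc))) (fun cc : ↥(cubes x.toKIdx.D.toDomains) => (DPDsDirCubeY x.toKIdx cc (B9Cor35GpDirInputsAtOne.dirDomY x.toKIdx cc))) (fun (cc : ↥(cubes x.toKIdx.D.toDomains)) (U : (bg9YR (Matrix (Fin N) (Fin N) ℂ) (specialUnitaryUnits (Fin N)) R₁ R₂ x).Cfg) => (P1DirCubeY x.toKIdx cc (hTY x.toKIdx cc) (B9Cor35GpDirInputsAtOne.dirDomY x.toKIdx cc)) U) U) (fun U => eq3105FamQTLY x.toKIdx (trBasis N) (qKnitOfRecord N θ.toStage3Params x.toKIdx) (qsKnitOfRecord N θ.toStage3Params x.toKIdx) (parKnitY x.toKIdx) (GpPhysY x.toKIdx (parKnitY x.toKIdx)) (fun cc : ↥(cubes x.toKIdx.D.toDomains) => GDirCKY x.toKIdx cc (DPDsDirCubeY x.toKIdx cc (B9Cor35GpDirInputsAtOne.dirDomY x.toKIdx cc)) (bondsOverY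 x.toKIdx (B9Cor35GpDirInputsAtOne.dirDomY x.toKIdx cc))) (fun cc : ↥(cubes x.toKIdx.D.toDomains) => (DPDsDirCubeY x.toKIdx cc (B9Cor35GpDirInputsAtOne.dirDomY x.toKIdx cc))) (fun (cc : ↥(cubes x.toKIdx.D.toDomains)) (U : (bg9YR (Matrix (Fin N) (Fin N) ℂ) (specialUnitaryUnits (Fin N)) R₁ R₂ x).Cfg) => (P1DirCubeY x.toKIdx cc (hTY x.toKIdx cc) (B9Cor35GpDirInputsAtOne.dirDomY x.toKIdx cc)) U) U) (SFA x)) (dirOps310WalkYO x (trBasis N) (bg9YR (Matrix (Fin N) (Fin N) ℂ) (specialUnitaryUnits (Fin N)) R₁ R₂ x) (fun U => U) (bI x) (lettersYOfRecordV11K N θ.toStage3Params Mstar (resYOfRecordPK N θ.toStage3Params Mstar) x).GA (fun cc : ↥(cubes x.toKIdx.D.toDomains) => GDirCKY x.toKIdx cc (DPDsDirCubeY x.toKIdx cc (B9Cor35GpDirInputsAtOne.dirDomY x.toKIdx cc)) (bondsOverY x.toKIdx (B9Cor35GpDirInputsAtOne.dirDomY x.toKIdx cc))) (S0coKq x.toKIdx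 (trBasis N) (bg9YR (Matrix (Fin N) (Fin N) ℂ) (specialUnitaryUnits (Fin N)) R₁ R₂ x) (fun V => V) (qKnitOfRecord N θ.toStage3Params x.toKIdx) (qsKnitOfRecord N θ.toStage3Params x.toKIdx) (parKnitY x.toKIdx) (GpPhysY x.toKIdx (parKnitY x.toKIdx))) (fun U => eq3105FamQLY x.toKIdx (trBasis N) (qKnitOfRecord N θ.toStage3Params x.toKIdx) (qsKnitOfRecord N θ.toStage3Params x.toKIdx) (parKnitY x.toKIdx) (GpPhysY x.toKIdx (parKnitY x.toKIdx)) (fun cc : ↥(cubes x.toKIdx.D.toDomains) => GDirCKY x.toKIdx cc (DPDsDirCubeY x.toKIdx cc (B9Cor35GpDirInputsAtOne.dirDomY x.toKIdx cc)) (bondsOverY x.toKIdx (B9Cor35GpDirInputsAtOne.dirDomY x.toKIdx cc))) (fun cc : ↥(cubes x.toKIdx.D.toDomains) => (DPDsDirCubeY x.toKIdx cc (B9Cor35GpDirInputsAtOne.dirDomY x.toKIdx cc))) (fun (cc : ↥(cubes x.toKIdx.D.toDomains)) (U : (bg9YR (Matrix (Fin N) (Fin N) ℂ) (specialUnitaryUnits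 (Fin N)) R₁ R₂ x).Cfg) => (P1DirCubeY x.toKIdx cc (hTY x.toKIdx cc) (B9Cor35GpDirInputsAtOne.dirDomY x.toKIdx cc)) U) U) (fun U => eq3105FamQTLY x.toKIdx (trBasis N) (qKnitOfRecord N θ.toStage3Params x.toKIdx) (qsKnitOfRecord N θ.toStage3Params x.toKIdx) (parKnitY x.toKIdx) (GpPhysY x.toKIdx (parKnitY x.toKIdx)) (fun cc : ↥(cubes x.toKIdx.D.toDomains) => GDirCKY x.toKIdx cc (DPDsDirCubeY x.toKIdx cc (B9Cor35GpDirInputsAtOne.dirDomY x.toKIdx cc)) (bondsOverY x.toKIdx (B9Cor35GpDirInputsAtOne.dirDomY x.toKIdx cc))) (fun cc : ↥(cubes x.toKIdx.D.toDomains) => (DPDsDirCubeY x.toKIdx cc (B9Cor35GpDirInputsAtOne.dirDomY x.toKIdx cc))) (fun (cc : ↥(cubes x.toKIdx.D.toDomains)) (U : (bg9YR (Matrix (Fin N) (Fin N) ℂ) (specialUnitaryUnits (Fin N)) R₁ R₂ x).Cfg) => (P1DirCubeY x.toKIdx cc (hTY x.toKIdx cc) (B9Cor35GpDirInputsAtOne.dirDomY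 x.toKIdx cc)) U) U) (SFA x)) 1 (H x) (bHXA x) q.θI q.δ₀ U) ∧ (L2MixedLegs310 (ops310WalkYO x (trBasis N) (bg9YR (Matrix (Fin N) (Fin N) ℂ) (specialUnitaryUnits (Fin N)) R₁ R₂ x) (fun U => U) (bI x) (lettersYOfRecordV11K N θ.toStage3Params Mstar (resYOfRecordPK N θ.toStage3Params Mstar) x).GA (fun cc : ↥(cubes x.toKIdx.D.toDomains) => GDirCKY x.toKIdx cc (DPDsDirCubeY x.toKIdx cc (B9Cor35GpDirInputsAtOne.dirDomY x.toKIdx cc)) (bondsOverY x.toKIdx (B9Cor35GpDirInputsAtOne.dirDomY x.toKIdx cc))) (S0coKq x.toKIdx (trBasis N) (bg9YR (Matrix (Fin N) (Fin N) ℂ) (specialUnitaryUnits (Fin N)) R₁ R₂ x) (fun V => V) (qKnitOfRecord N θ.toStage3Params x.toKIdx) (qsKnitOfRecord N θ.toStage3Params x.toKIdx) (parKnitY x.toKIdx) (GpPhysY x.toKIdx (parKnitY x.toKIdx))) (fun U => eq3105FamQLY x.toKIdx (trBasis N) (qKnitOfRecord N θ.toStage3Params x.toKIdx) (qsKnitOfRecord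 N θ.toStage3Params x.toKIdx) (parKnitY x.toKIdx) (GpPhysY x.toKIdx (parKnitY x.toKIdx)) (fun cc : ↥(cubes x.toKIdx.D.toDomains) => GDirCKY x.toKIdx cc (DPDsDirCubeY x.toKIdx cc (B9Cor35GpDirInputsAtOne.dirDomY x.toKIdx cc)) (bondsOverY x.toKIdx (B9Cor35GpDirInputsAtOne.dirDomY x.toKIdx cc))) (fun cc : ↥(cubes x.toKIdx.D.toDomains) => (DPDsDirCubeY x.toKIdx cc (B9Cor35GpDirInputsAtOne.dirDomY x.toKIdx cc))) (fun (cc : ↥(cubes x.toKIdx.D.toDomains)) (U : (bg9YR (Matrix (Fin N) (Fin N) ℂ) (specialUnitaryUnits (Fin N)) R₁ R₂ x).Cfg) => (P1DirCubeY x.toKIdx cc (hTY x.toKIdx cc) (B9Cor35GpDirInputsAtOne.dirDomY x.toKIdx cc)) U) U) (fun U => eq3105FamQTLY x.toKIdx (trBasis N) (qKnitOfRecord N θ.toStage3Params x.toKIdx) (qsKnitOfRecord N θ.toStage3Params x.toKIdx) (parKnitY x.toKIdx) (GpPhysY x.toKIdx (parKnitY x.toKIdx)) (fun cc : ↥(cubes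 x.toKIdx.D.toDomains) => GDirCKY x.toKIdx cc (DPDsDirCubeY x.toKIdx cc (B9Cor35GpDirInputsAtOne.dirDomY x.toKIdx cc)) (bondsOverY x.toKIdx (B9Cor35GpDirInputsAtOne.dirDomY x.toKIdx cc))) (fun cc : ↥(cubes x.toKIdx.D.toDomains) => (DPDsDirCubeY x.toKIdx cc (B9Cor35GpDirInputsAtOne.dirDomY x.toKIdx cc))) (fun (cc : ↥(cubes x.toKIdx.D.toDomains)) (U : (bg9YR (Matrix (Fin N) (Fin N) ℂ) (specialUnitaryUnits (Fin N)) R₁ R₂ x).Cfg) => (P1DirCubeY x.toKIdx cc (hTY x.toKIdx cc) (B9Cor35GpDirInputsAtOne.dirDomY x.toKIdx cc)) U) U) (SFA x)) (dirOps310WalkYO x (trBasis N) (bg9YR (Matrix (Fin N) (Fin N) ℂ) (specialUnitaryUnits (Fin N)) R₁ R₂ x) (fun U => U) (bI x) (lettersYOfRecordV11K N θ.toStage3Params Mstar (resYOfRecordPK N θ.toStage3Params Mstar) x).GA (fun cc : ↥(cubes x.toKIdx.D.toDomains) => GDirCKY x.toKIdx cc (DPDsDirCubeY x.toKIdx cc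 (B9Cor35GpDirInputsAtOne.dirDomY x.toKIdx cc)) (bondsOverY x.toKIdx (B9Cor35GpDirInputsAtOne.dirDomY x.toKIdx cc))) (S0coKq x.toKIdx (trBasis N) (bg9YR (Matrix (Fin N) (Fin N) ℂ) (specialUnitaryUnits (Fin N)) R₁ R₂ x) (fun V => V) (qKnitOfRecord N θ.toStage3Params x.toKIdx) (qsKnitOfRecord N θ.toStage3Params x.toKIdx) (parKnitY x.toKIdx) (GpPhysY x.toKIdx (parKnitY x.toKIdx))) (fun U => eq3105FamQLY x.toKIdx (trBasis N) (qKnitOfRecord N θ.toStage3Params x.toKIdx) (qsKnitOfRecord N θ.toStage3Params x.toKIdx) (parKnitY x.toKIdx) (GpPhysY x.toKIdx (parKnitY x.toKIdx)) (fun cc : ↥(cubes x.toKIdx.D.toDomains) => GDirCKY x.toKIdx cc (DPDsDirCubeY x.toKIdx cc (B9Cor35GpDirInputsAtOne.dirDomY x.toKIdx cc)) (bondsOverY x.toKIdx (B9Cor35GpDirInputsAtOne.dirDomY x.toKIdx cc))) (fun cc : ↥(cubes x.toKIdx.D.toDomains) => (DPDsDirCubeY x.toKIdx cc (B9Cor35GpDirInputsAtOne.dirDomY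 x.toKIdx cc))) (fun (cc : ↥(cubes x.toKIdx.D.toDomains)) (U : (bg9YR (Matrix (Fin N) (Fin N) ℂ) (specialUnitaryUnits (Fin N)) R₁ R₂ x).Cfg) => (P1DirCubeY x.toKIdx cc (hTY x.toKIdx cc) (B9Cor35GpDirInputsAtOne.dirDomY x.toKIdx cc)) U) U) (fun U => eq3105FamQTLY x.toKIdx (trBasis N) (qKnitOfRecord N θ.toStage3Params x.toKIdx) (qsKnitOfRecord N θ.toStage3Params x.toKIdx) (parKnitY x.toKIdx) (GpPhysY x.toKIdx (parKnitY x.toKIdx)) (fun cc : ↥(cubes x.toKIdx.D.toDomains) => GDirCKY x.toKIdx cc (DPDsDirCubeY x.toKIdx cc (B9Cor35GpDirInputsAtOne.dirDomY x.toKIdx cc)) (bondsOverY x.toKIdx (B9Cor35GpDirInputsAtOne.dirDomY x.toKIdx cc))) (fun cc : ↥(cubes x.toKIdx.D.toDomains) => (DPDsDirCubeY x.toKIdx cc (B9Cor35GpDirInputsAtOne.dirDomY x.toKIdx cc))) (fun (cc : ↥(cubes x.toKIdx.D.toDomains)) (U : (bg9YR (Matrix (Fin N) (Fin N) ℂ)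 (specialUnitaryUnits (Fin N)) R₁ R₂ x).Cfg) => (P1DirCubeY x.toKIdx cc (hTY x.toKIdx cc) (B9Cor35GpDirInputsAtOne.dirDomY x.toKIdx cc)) U) U) (SFA x)) 1 (H x) (SMA x) qM.BM q.δ₀ U ∧ FactorsL2Mixed310 (ops310WalkYO x (trBasis N) (bg9YR (Matrix (Fin N) (Fin N) ℂ) (specialUnitaryUnits (Fin N)) R₁ R₂ x) (fun U => U) (bI x) (lettersYOfRecordV11K N θ.toStage3Params Mstar (resYOfRecordPK N θ.toStage3Params Mstar) x).GA (fun cc : ↥(cubes x.toKIdx.D.toDomains) => GDirCKY x.toKIdx cc (DPDsDirCubeY x.toKIdx cc (B9Cor35GpDirInputsAtOne.dirDomY x.toKIdx cc)) (bondsOverY x.toKIdx (B9Cor35GpDirInputsAtOne.dirDomY x.toKIdx cc))) (S0coKq x.toKIdx (trBasis N) (bg9YR (Matrix (Fin N) (Fin N) ℂ) (specialUnitaryUnits (Fin N)) R₁ R₂ x) (fun V => V) (qKnitOfRecord N θ.toStage3Params x.toKIdx) (qsKnitOfRecord N θ.toStage3Params x.toKIdx) (parKnitY x.toKIdx) (GpPhysY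 x.toKIdx (parKnitY x.toKIdx))) (fun U => eq3105FamQLY x.toKIdx (trBasis N) (qKnitOfRecord N θ.toStage3Params x.toKIdx) (qsKnitOfRecord N θ.toStage3Params x.toKIdx) (parKnitY x.toKIdx) (GpPhysY x.toKIdx (parKnitY x.toKIdx)) (fun cc : ↥(cubes x.toKIdx.D.toDomains) => GDirCKY x.toKIdx cc (DPDsDirCubeY x.toKIdx cc (B9Cor35GpDirInputsAtOne.dirDomY x.toKIdx cc)) (bondsOverY x.toKIdx (B9Cor35GpDirInputsAtOne.dirDomY x.toKIdx cc))) (fun cc : ↥(cubes x.toKIdx.D.toDomains) => (DPDsDirCubeY x.toKIdx cc (B9Cor35GpDirInputsAtOne.dirDomY x.toKIdx cc))) (fun (cc : ↥(cubes x.toKIdx.D.toDomains)) (U : (bg9YR (Matrix (Fin N) (Fin N) ℂ) (specialUnitaryUnits (Fin N)) R₁ R₂ x).Cfg) => (P1DirCubeY x.toKIdx cc (hTY x.toKIdx cc) (B9Cor35GpDirInputsAtOne.dirDomY x.toKIdx cc)) U) U) (fun U => eq3105FamQTLY x.toKIdx (trBasis N) (qKnitOfRecord N θ.toStage3Params x.toKIdx)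 (qsKnitOfRecord N θ.toStage3Params x.toKIdx) (parKnitY x.toKIdx) (GpPhysY x.toKIdx (parKnitY x.toKIdx)) (fun cc : ↥(cubes x.toKIdx.D.toDomains) => GDirCKY x.toKIdx cc (DPDsDirCubeY x.toKIdx cc (B9Cor35GpDirInputsAtOne.dirDomY x.toKIdx cc)) (bondsOverY x.toKIdx (B9Cor35GpDirInputsAtOne.dirDomY x.toKIdx cc))) (fun cc : ↥(cubes x.toKIdx.D.toDomains) => (DPDsDirCubeY x.toKIdx cc (B9Cor35GpDirInputsAtOne.dirDomY x.toKIdx cc))) (fun (cc : ↥(cubes x.toKIdx.D.toDomains)) (U : (bg9YR (Matrix (Fin N) (Fin N) ℂ) (specialUnitaryUnits (Fin N)) R₁ R₂ x).Cfg) => (P1DirCubeY x.toKIdx cc (hTY x.toKIdx cc) (B9Cor35GpDirInputsAtOne.dirDomY x.toKIdx cc)) U) U) (SFA x)) (dirOps310WalkYO x (trBasis N) (bg9YR (Matrix (Fin N) (Fin N) ℂ) (specialUnitaryUnits (Fin N)) R₁ R₂ x) (fun U => U) (bI x) (lettersYOfRecordV11K N θ.toStage3Params Mstar (resYOfRecordPK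 N θ.toStage3Params Mstar) x).GA (fun cc : ↥(cubes x.toKIdx.D.toDomains) => GDirCKY x.toKIdx cc (DPDsDirCubeY x.toKIdx cc (B9Cor35GpDirInputsAtOne.dirDomY x.toKIdx cc)) (bondsOverY x.toKIdx (B9Cor35GpDirInputsAtOne.dirDomY x.toKIdx cc))) (S0coKq x.toKIdx (trBasis N) (bg9YR (Matrix (Fin N) (Fin N) ℂ) (specialUnitaryUnits (Fin N)) R₁ R₂ x) (fun V => V) (qKnitOfRecord N θ.toStage3Params x.toKIdx) (qsKnitOfRecord N θ.toStage3Params x.toKIdx) (parKnitY x.toKIdx) (GpPhysY x.toKIdx (parKnitY x.toKIdx))) (fun U => eq3105FamQLY x.toKIdx (trBasis N) (qKnitOfRecord N θ.toStage3Params x.toKIdx) (qsKnitOfRecord N θ.toStage3Params x.toKIdx) (parKnitY x.toKIdx) (GpPhysY x.toKIdx (parKnitY x.toKIdx)) (fun cc : ↥(cubes x.toKIdx.D.toDomains) => GDirCKY x.toKIdx cc (DPDsDirCubeY x.toKIdx cc (B9Cor35GpDirInputsAtOne.dirDomY x.toKIdx cc)) (bondsOverY x.toKIdx (B9Cor35GpDirInputsAtOne.dirDomY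 x.toKIdx cc))) (fun cc : ↥(cubes x.toKIdx.D.toDomains) => (DPDsDirCubeY x.toKIdx cc (B9Cor35GpDirInputsAtOne.dirDomY x.toKIdx cc))) (fun (cc : ↥(cubes x.toKIdx.D.toDomains)) (U : (bg9YR (Matrix (Fin N) (Fin N) ℂ) (specialUnitaryUnits (Fin N)) R₁ R₂ x).Cfg) => (P1DirCubeY x.toKIdx cc (hTY x.toKIdx cc) (B9Cor35GpDirInputsAtOne.dirDomY x.toKIdx cc)) U) U) (fun U => eq3105FamQTLY x.toKIdx (trBasis N) (qKnitOfRecord N θ.toStage3Params x.toKIdx) (qsKnitOfRecord N θ.toStage3Params x.toKIdx) (parKnitY x.toKIdx) (GpPhysY x.toKIdx (parKnitY x.toKIdx)) (fun cc : ↥(cubes x.toKIdx.D.toDomains) => GDirCKY x.toKIdx cc (DPDsDirCubeY x.toKIdx cc (B9Cor35GpDirInputsAtOne.dirDomY x.toKIdx cc)) (bondsOverY x.toKIdx (B9Cor35GpDirInputsAtOne.dirDomY x.toKIdx cc))) (fun cc : ↥(cubes x.toKIdx.D.toDomains) => (DPDsDirCubeY x.toKIdx cc (B9Cor35GpDirInputsAtOne.dirDomY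 x.toKIdx cc))) (fun (cc : ↥(cubes x.toKIdx.D.toDomains)) (U : (bg9YR (Matrix (Fin N) (Fin N) ℂ) (specialUnitaryUnits (Fin N)) R₁ R₂ x).Cfg) => (P1DirCubeY x.toKIdx cc (hTY x.toKIdx cc) (B9Cor35GpDirInputsAtOne.dirDomY x.toKIdx cc)) U) U) (SFA x)) 1 (H x) qM.θM q.δ₀ U)) (hcntHA : ∀ x (a : (geo9Y x).Site), (∑ c, if a ∈ SHA x c then (1 : ℝ) else 0) ≤ q.NH) (hcnt3A : ∀ x (a : (geo9Y x).Site), (∑ c, if a ∈ S3A x c then (1 : ℝ) else 0) ≤ q3.N3) (hcntIA : ∀ x (a : (geo9Y x).Site), (∑ c, if a ∈ SIA x c then (1 : ℝ) else 0) ≤ q.NI) (hcntMA : ∀ x (a : (geo9Y x).Site), (∑ c, if a ∈ SMA x c then (1 : ℝ) else 0) ≤ qM.NM) 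
    -- [rows 19, ed. 119] the bond cube letters `G_□(U) := OcA x □ U`, their (3.42) block tables `h36Ab` (`Local342G` DERIVED)
    (BcA : ℝ) (hBcA : 0 ≤ BcA) (hB₀geA : (nbrCountBY θ.d₆ θ.ℓ₆ θ.hd' θ.hL' θ.b₀ θ.b₁ 1 : ℝ) * Real.exp (2 * q.δ₀) * (cR39 (trBasis N) * BcA) ≤ q.B₀)
    (𝔬12 : ∀ x : MemberY θ.d₆ θ.ℓ₆ θ.hd' θ.hL' θ.b₀ θ.b₁ Mstar, B9Thm312Whole.Ops (geo9Y x) (bg9YR (Matrix (Fin N) (Fin N) ℂ) (specialUnitaryUnits (Fin N)) R₁ R₂ x) (XBK (TrIdx N) x.toKIdx) (XBK (TrIdx N) x.toKIdx) (XHK (TrIdx N) x.toKIdx) (XSK (TrIdx N) x.toKIdx))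
    -- gen 28 «KE₇X»: the twenty-two `𝔬12` pins `hblk12 … hRco12` FOLDED into ONE equation (node00-def-Y `OpsYOps312OfRecordPar.pins312K_of_eq`)
    (h𝔬12 : 𝔬12 = OpsYOps312OfRecordPar.ops312YOfRecordK N θ.toStage3Params Mstar (resYOfRecordPK N θ.toStage3Params Mstar) R₁ R₂ bI)
    -- [«KE₃X»] THE E-LETTER EXPS RECORD IS PINNED: `𝔈 := expsYOfRecordV3Par … (lettersYOfRecordV11K … resYOfRecordPK …) 𝔈₀ R₁ R₂ bI parKnitY parSymY qKnitOfRecord qsKnitOfRecord α' r39 B39 p q p3 q3 pM qM H O near 𝔬A rdA 𝔬12` (node00-def-Y W2 ✓`OpsYExpsOfRecordV3Par`; the former display `h𝔈` closes by `rfl`) — the object below reads it in place of the free `𝔈`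
    -- (editions 97∕99∕101) Thm 3.13's block-L² pair record of rows 20–21 is ASSEMBLED from the legs `g0qstar_l2_letters_of_pins` (n06-l), `dv_letters_of_pins`, `rgdI_of_pinsR`, `rgdDs_rgdDd_of_pinsR` (n06-c); its `C₁` line is derived INSIDE dag-n06-l's face v1.6 `…StateSUCL` — no field displayed
    -- rows 20–21's `Letters313DZ ∕ DMZ` records SPLIT (edition 53): the four non-Hölder fields displayed, the Hölder entries `dgDH ∕ dgDHd` DERIVED (`N06DgLegAtPinsPhysPU`, ed. 61) from the (3.44) members `h44m` below
    {E14₁ E14₂ : ∀ x : MemberY θ.d₆ θ.ℓ₆ θ.hd' θ.hL' θ.b₀ θ.b₁ Mstar, B9.RWExpansion (geo9Y x) (bg9YR (Matrix (Fin N) (Fin N) ℂ) (specialUnitaryUnits (Fin N)) R₁ R₂ x)} (T14₁ : ∀ x : MemberY θ.d₆ θ.ℓ₆ θ.hd' θ.hL' θ.b₀ θ.b₁ Mstar, (E14₁ x).Walk → BondOpY (Matrix (Fin N) (Fin N) ℂ) x.toKIdx) (T14₂ : ∀ x : MemberY θ.d₆ θ.ℓ₆ θ.hd' θ.hL' θ.b₀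 θ.b₁ Mstar, (E14₂ x).Walk → BondOpY (Matrix (Fin N) (Fin N) ℂ) x.toKIdx) (X14₁ : ∀ x : MemberY θ.d₆ θ.ℓ₆ θ.hd' θ.hL' θ.b₀ θ.b₁ Mstar, (E14₁ x).Walk → ℕ → (geo9Y x).Site → Prop) (M14₁ : ∀ x : MemberY θ.d₆ θ.ℓ₆ θ.hd' θ.hL' θ.b₀ θ.b₁ Mstar, (E14₁ x).Walk → ℕ → Prop) (X14₂ : ∀ x : MemberY θ.d₆ θ.ℓ₆ θ.hd' θ.hL' θ.b₀ θ.b₁ Mstar, (E14₂ x).Walk → ℕ → (geo9Y x).Site → Prop) (M14₂ : ∀ x : MemberY θ.d₆ θ.ℓ₆ θ.hd' θ.hL' θ.b₀ θ.b₁ Mstar, (E14₂ x).Walk → ℕ → Prop) (diam14 : MemberY θ.d₆ θ.ℓ₆ θ.hd' θ.hL' θ.b₀ θ.b₁ Mstar → ℝ) (r14 : ℝ) (hr14 : ∀ x, diam14 x ≤ r14) (near14₁ : ∀ (x : MemberY θ.d₆ θ.ℓ₆ θ.hd' θ.hL' θ.b₀ θ.b₁ Mstar) ω m p, M14₁ x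 ω m → X14₁ x ω m p → ∃ q, q ∈ OmegaC x.D x.D' ∧ tdistK (ℓ := θ.ℓ₆) (Mh := x.Mh) (k := x.k) (P := x.P') (kLab x p) q ≤ diam14 x) (first14₁ : ∀ (x : MemberY θ.d₆ θ.ℓ₆ θ.hd' θ.hL' θ.b₀ θ.b₁ Mstar) ω y, (E14₁ x).first ω y → X14₁ x ω 0 y) (chain14₁ : ∀ (x : MemberY θ.d₆ θ.ℓ₆ θ.hd' θ.hL' θ.b₀ θ.b₁ Mstar) ω y y', (E14₁ x).first ω y → (E14₁ x).last ω y' → ∃ l : List (geo9Y x).Site, l.length = (E14₁ x).wlen ω ∧ (∀ (m : ℕ) (hm : m < l.length), X14₁ x ω (m + 1) (l[m])) ∧ B9Thm314.chainSum (geo9Y x).dist y l y' ≤ (E14₁ x).wdist ω y y') (near14₂ : ∀ (x : MemberY θ.d₆ θ.ℓ₆ θ.hd' θ.hL' θ.b₀ θ.b₁ Mstar) ω m p, M14₂ x ω m → X14₂ x ω m p → ∃ q, q ∈ OmegaC x.D x.D' ∧ tdistK (ℓ := θ.ℓ₆) (Mh := x.Mh) (k := x.k) (P := x.P') (kLab x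 p) q ≤ diam14 x) (first14₂ : ∀ (x : MemberY θ.d₆ θ.ℓ₆ θ.hd' θ.hL' θ.b₀ θ.b₁ Mstar) ω y, (E14₂ x).first ω y → X14₂ x ω 0 y) (chain14₂ : ∀ (x : MemberY θ.d₆ θ.ℓ₆ θ.hd' θ.hL' θ.b₀ θ.b₁ Mstar) ω y y', (E14₂ x).first ω y → (E14₂ x).last ω y' → ∃ l : List (geo9Y x).Site, l.length = (E14₂ x).wlen ω ∧ (∀ (m : ℕ) (hm : m < l.length), X14₂ x ω (m + 1) (l[m])) ∧ B9Thm314.chainSum (geo9Y x).dist y l y' ≤ (E14₂ x).wdist ω y y') (h14₁ : Thm310AllNormsPrinted c geo9Y (bg9YR (Matrix (Fin N) (Fin N) ℂ) (specialUnitaryUnits (Fin N)) R₁ R₂) E14₁ (fun x ω => kernelFamilyB x.toKIdx (bg9YR (Matrix (Fin N) (Fin N) ℂ) (specialUnitaryUnits (Fin N)) R₁ R₂ x) (fun U => U) (T14₁ x ω) (lettersYOfRecordV11K N θ.toStage3Params Mstar (resYOfRecordPK N θ.toStage3Params Mstar) x).parB)) (h14₂ : Thm310AllNormsPrinted c geo9Y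 (bg9YR (Matrix (Fin N) (Fin N) ℂ) (specialUnitaryUnits (Fin N)) R₁ R₂) E14₂ (fun x ω => kernelFamilyB x.toKIdx (bg9YR (Matrix (Fin N) (Fin N) ℂ) (specialUnitaryUnits (Fin N)) R₁ R₂ x) (fun U => U) (T14₂ x ω) (lettersYOfRecordV11K N θ.toStage3Params Mstar (resYOfRecordPK N θ.toStage3Params Mstar) x).parB)) (W14₁ : ∀ x : MemberY θ.d₆ θ.ℓ₆ θ.hd' θ.hL' θ.b₀ θ.b₁ Mstar, ℕ → (geo9Y x).Site → (geo9Y x).Site → Finset (E14₁ x).Walk) (W14₂ : ∀ x : MemberY θ.d₆ θ.ℓ₆ θ.hd' θ.hL' θ.b₀ θ.b₁ Mstar, ℕ → (geo9Y x).Site → (geo9Y x).Site → Finset (E14₂ x).Walk) (hW14₁ : ∀ x, WalkSetsSpec (E14₁ x) (W14₁ x)) (hW14₂ : ∀ x, WalkSetsSpec (E14₂ x) (W14₂ x)) (hcnt14₁ : WalkWeightsSummable geo9Y (bg9YR (Matrix (Fin N) (Fin N) ℂ) (specialUnitaryUnits (Fin N)) R₁ R₂) E14₁ W14₁) (hcnt14₂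 : WalkWeightsSummable geo9Y (bg9YR (Matrix (Fin N) (Fin N) ℂ) (specialUnitaryUnits (Fin N)) R₁ R₂) E14₂ W14₂)
    (hexp14 : ∀ (x : MemberY θ.d₆ θ.ℓ₆ θ.hd' θ.hL' θ.b₀ θ.b₁ Mstar) (U : (bg9YR (Matrix (Fin N) (Fin N) ℂ) (specialUnitaryUnits (Fin N)) R₁ R₂ x).Cfg), (E14₁ x).Converges U ∧ (E14₂ x).Converges U → ExpansionReads x.toKIdx (B := bg9YR (Matrix (Fin N) (Fin N) ℂ) (specialUnitaryUnits (Fin N)) R₁ R₂ x) (fun U => U) (lettersYOfRecordV11K N θ.toStage3Params Mstar (resYOfRecordPK N θ.toStage3Params Mstar) x).Kdiff (pairOp (locDataY x (E14₁ x) (X14₁ x) (M14₁ x) (diam14 x)).Touches (locData₂ (locDataY x (E14₁ x) (X14₁ x) (M14₁ x) (diam14 x)) (X14₂ x) (M14₂ x)).Touches (T14₁ x) (T14₂ x)) (pairWalkSets (W14₁ x) (W14₂ x) (locDataY x (E14₁ x) (X14₁ x) (M14₁ x) (diam14 x)).Touches (locData₂ (locDataY x (E14₁ x) (X14₁ x)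 (M14₁ x) (diam14 x)) (X14₂ x) (M14₂ x)).Touches) U) {a₀E δ₁E B₁E : ℝ} (ha₀E : 0 < a₀E) (hδ₁E : 0 < δ₁E) (hB₁E : 0 < B₁E) (hE : ∀ (x : MemberY θ.d₆ θ.ℓ₆ θ.hd' θ.hL' θ.b₀ θ.b₁ Mstar), (Mstar : ℝ) ≤ (geo9Y x).M → ∀ (α₀ : ℝ), 0 < α₀ → (geo9Y x).M * α₀ ≤ a₀E → ∀ U : (bg9YR (Matrix (Fin N) (Fin N) ℂ) (specialUnitaryUnits (Fin N)) R₁ R₂ x).Cfg, (bg9YR (Matrix (Fin N) (Fin N) ℂ) (specialUnitaryUnits (Fin N)) R₁ R₂ x).Reg335 c α₀ U → (bg9YR (Matrix (Fin N) (Fin N) ℂ) (specialUnitaryUnits (Fin N)) R₁ R₂ x).Reg336 c α₀ U → givenBy3185stY x (lettersYOfRecordV11K N θ.toStage3Params Mstar (resYOfRecordPK N θ.toStage3Params Mstar) x) (sectEStYOfRecordV7 N θ.toStage3Params Mstar 𝔢₀ x) U ∧ hasRWExpCY (𝔴 x) U δ₁E ∧ DecayMidOnStY x (lettersYOfRecordV11K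 N θ.toStage3Params Mstar (resYOfRecordPK N θ.toStage3Params Mstar) x) (sectEStYOfRecordV7 N θ.toStage3Params Mstar 𝔢₀ x) B₁E U δ₁E) {ιR : Type} [Fintype ιR] [DecidableEq ιR] (bR : Module.Basis ιR ℝ (Matrix (Fin N) (Fin N) ℂ)) (C38 : ∀ j : B9SectionCarryingMembersV1.SCMemberY θ.d₆ θ.ℓ₆ θ.hd' θ.hL' θ.b₀ θ.b₁ Mstar, ℝ → CfgY (Matrix (Fin N) (Fin N) ℂ) j.val.toKIdx → AfldY (Matrix (Fin N) (Fin N) ℂ) j.val.toKIdx → Prop)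
    -- [«ed.2» X] THE KNIT CODED CLASS's CONSTANTS (dag-n06-c `B9SectBCodedClassKnitY.C37KY`: knit letters constant `CqK`, member thresholds `MK ∕ aInv`, [B8] Prop-7 window `ϱ′` in `β₀ := ϱ′·L³∕3`)
    (CqK MK aInv ϱ' : ℝ)
    -- [CASCADE-K K3] ROW 17 DISPLAYED AT THE KNIT LETTER (Thm 3.11's `Δ_a^Q(U)` symmetric and positive definite over (3.115)'s `Q` and the knit contours — K2 supplier: dag-n06-j `B9Thm311FormGapOfLawsAtLettersY`; the straight-pair reader `row17_of_row19_letters₂` is pinned to `(parSymY, GAY)`)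
    -- [CASCADE-K K3] THE SECT.-D OUTPUTS DISPLAYED (Thms 3.12 ∕ 3.13 at the object; the V4P-keyed network `t312_t313_of_pins_stateSUCLE` is re-pressed at the knit letters in the companion file «K3-D», dag-n06-l item 4), (3.49) DISPLAYED (n06-i's site reader is pinned to `G′ = GpY parSymY`; def-Y K0-H-P349), (3.132) DISPLAYED (n06-l's `s3132Nu_…` consumes the network's state layer)
    -- [CASCADE-K K1] THE CODED SECT.-B STEP AT THE KNIT LETTERS WITH THE TWO TRANSPORTERS, DISPLAYED (dag-n06-c's (C) road `sectBStepUPar_of_members`; the `hB` input of `B9LeafXCodedKnitUParH.b9LeafX_carriersYUParH`)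
    -- [«KE6X»] THE CODED SECT.-B STEP `hBK` IS FOLDED (dag-n06-c ✓`N06SectBStepUParKnitRecordKC.sectBStepUPar_knitRecordKC` at the knit class `C37KY`, its `hunitA` from `hΔAK` by `isUnit_of_posDefTr`); its x-free displays follow (n06-c's list VERBATIM): LOCATED-RANGE `N ≤ 25`, the block-labelling pin of `ιB`, the basis data of `bR`, the knit class constants' signs ∕ thresholds, `8α₀K ≤ c₂′`, dag-n06-l's [B8] Prop-7 window `ϱ′ ϱ`, the neighbour count, `2(d+1) < MInv`, `r_LB + 1 < MInv` — jointly inhabited by ✓`N06SectBKnitWindow.knitSectBWindow_inhabited`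
    (hCqK : 0 ≤ CqK) (haInv : 0 < aInv) (haIR : aInv ≤ q.a₁ / c) (hα8 : 8 * α₀K ≤ c2' (θ.d₆ + 1) (θ.ℓ₆ + 1)) (hα4N : 32 * (((θ.d₆ + 1 : ℕ) : ℝ) + 1) * ((θ.d₆ + 1 : ℕ) + 4) * (((θ.ℓ₆ + 1 : ℕ) : ℝ)) ^ 2 * α₀K ≤ 1 / 4) (hαπN : (N : ℝ) * (32 * (((θ.d₆ + 1 : ℕ) : ℝ) + 1) * ((θ.d₆ + 1 : ℕ) + 4) * (((θ.ℓ₆ + 1 : ℕ) : ℝ)) ^ 2 * α₀K) < Real.pi) (haIK : aInv ≤ aK) (ϱ : ℝ) (hϱ' : 0 < ϱ') (hϱ : 0 < ϱ) (hsmall' : Real.exp (4 * (800 * ((((θ.d₆ + 1 : ℕ) : ℝ)) + 1) ^ 2 * ((((θ.d₆ + 1 : ℕ) : ℝ)) + 4)) * α₀K) * (1 + 8 * (131072 * ((((θ.d₆ + 1 : ℕ) : ℝ)) + 1) ^ 2) * ϱ') ≤ 2) (hc₃' : 2 * ϱ' ≤ c3 (θ.d₆ + 1) (θ.ℓ₆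 + 1)) (hϱ'1 : 409600 * ((((θ.d₆ + 1 : ℕ) : ℝ)) + 1) ^ 2 * ϱ' ≤ 1) (hEc : Literature.MathematicalPhysics.QuantumFieldTheory.Balaban1983to89.B7Prop5CplxLevels.epsCplx (θ.d₆ + 1) (θ.ℓ₆ + 1) ϱ' 0 ≤ 1 / 16) (hdX : (((θ.d₆ + 1 : ℕ) : ℝ)) * (Literature.MathematicalPhysics.QuantumFieldTheory.Balaban1983to89.B7Prop5CplxLevels.epsCplx (θ.d₆ + 1) (θ.ℓ₆ + 1) ϱ' 0 + Literature.MathematicalPhysics.QuantumFieldTheory.Balaban1983to89.B7Prop5CplxLevels.tauCplx (θ.d₆ + 1) (θ.ℓ₆ + 1) α₀K 0 ϱ' 0) ≤ 1 / 16) (hsmall : Real.exp (4480 * ((((θ.d₆ + 1 : ℕ) : ℝ)) + 1) ^ 2 * ((((θ.d₆ + 1 : ℕ) : ℝ)) + 4) * α₀K + 240000 * ((((θ.d₆ + 1 : ℕ) : ℝ)) + 1) ^ 3 * ϱ') * (1 + 8 * (2097152 * ((((θ.d₆ + 1 : ℕ) : ℝ)) + 1) ^ 2) * ϱ) ≤ 2)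 (hc₃ : 2 * ϱ ≤ c3 (θ.d₆ + 1) (θ.ℓ₆ + 1) / 4) (hM₀K : nbrM₀Y θ.d₆ θ.ℓ₆ θ.hd' θ.hL' θ.b₀ θ.b₁ (2 * ((θ.d₆ : ℝ) + 1)) ≤ Mstar)
    -- [g35 «KESC-CO»] THE SUPPLIER's DELIVERABLE `hRowsA` OF «KESC-CN» (the bundle `CubeRowsGDirCY x.toKIdx □ U …` per (x, U, □)) IS CONSUMED BY NAME — dag-n06-c g34's chain F1–F6
    -- ✓`cubeRowsGDirCY_at_member` (Cor. 3.6 ∕ Thm 3.4 G-step at the sharp-cut small field of the (3.35) bond datum), its α₀-UNIFORM edition ✓`cubeRowsGDirCY_at_memberU` (LOCATED-37) and the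
    -- NAMED uniform constants `gdirδ ∕ gdirB ∕ gdirM₀ ∕ gdirT₀ ∕ gdirN₀ ∕ gdirdB ∕ gdira₁` (✓`B9CubeDirInverseBondCRowsNamedY`) — MODULO ITS FOUR DISPLAYED ROWS: [4] Prop. 2.6 for the Dirichlet
    -- bond family BY NAME (`h26`), the bond socket on the canonical flat matrix `mDirC` (`hKBA`; [4] (2.21)–(2.22), not in the tree for this letter), the (3.35) bond datum of `Ω₀(□)`
    -- at `U` (`hDatBu`, LOCATED-32∕35: gauge `u`, potential `A` on a box ⊇ chart⁻¹(bond cut set), `2CΛ² ≤ gdira₁`), the flat right half of (3.42)₃ at an x-free constant `BA₂`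
    -- (`hRflA`, cell GAPS G-B9-02); + the three member thresholds of the uniform constants and the two x-free numerics coupling `(BA₂ + gdirB, gdirdB, gdirδ)` to `(BcA, q.δ₀)`:
    (h26 : B6.Prop26DirichletPrinted (B9Cor35GDirInputsAtOne.geoDirBI (d := θ.d₆) (ℓ := θ.ℓ₆) (hd := θ.hd') (hL := θ.hL') (b₀ := θ.b₀) (b₁ := θ.b₁)) B9Cor35GDirInputsAtOne.domDirBI
      B9Cor35GDirInputsAtOne.admDirBI B9Cor35GDirInputsAtOne.GDirBFam)
    (hMA : ∀ x : MemberY θ.d₆ θ.ℓ₆ θ.hd' θ.hL' θ.b₀ θ.b₁ Mstar, gdirM₀ N θ.d₆ θ.ℓ₆ θ.hd' θ.hL' θ.b₀ θ.b₁ Mstar α₀K ϱ' ϱ ≤ ((θ.ℓ₆ : ℝ) + 1) * (toKT x.toKIdx).Mh)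
    (hNA : ∀ x : MemberY θ.d₆ θ.ℓ₆ θ.hd' θ.hL' θ.b₀ θ.b₁ Mstar, gdirN₀ N θ.d₆ θ.ℓ₆ θ.hd' θ.hL' θ.b₀ θ.b₁ Mstar α₀K ϱ' ϱ + 1 ≤ (toKT x.toKIdx).R * ((θ.ℓ₆ + 1) * (toKT x.toKIdx).Mh))
    (hTA : ∀ x : MemberY θ.d₆ θ.ℓ₆ θ.hd' θ.hL' θ.b₀ θ.b₁ Mstar, gdirT₀ N θ.d₆ θ.ℓ₆ θ.hd' θ.hL' θ.b₀ θ.b₁ Mstar α₀K ϱ' ϱ ≤ RM1 x.toKIdx)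
    -- [g35 «KESC-CP»] the bond socket row `hKBA` of «KESC-CO» is DISCHARGED BY NAME: dag-n06-c g35 ✓`B9CubeDirInverseBondSocketAtOne.exists_bondSocket` (`mDirC_posDef` — print p.395
    -- «Δ′_a is positive … hence the existence of R» + [4] (2.21)–(2.22) p.226 at U = 1; inverse `kDirC`; hypothesis `0 < b₀` = `θ.hb.1`)
    (BA₂ : ℝ) (hBA₂ : 0 ≤ BA₂)
    (hDatBu : ∀ x, q.M₁ ≤ (geo9Y x).M → ∀ α₀ : ℝ, 0 < α₀ → c * (geo9Y x).M * α₀ ≤ q.a₁ → ∀ U : (bg9YR (Matrix (Fin N) (Fin N) ℂ) (specialUnitaryUnits (Fin N)) R₁ R₂ x).Cfg, (bg9YR (Matrix (Fin N) (Fin N) ℂ) (specialUnitaryUnits (Fin N)) R₁ R₂ x).Reg335 c α₀ U →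
      ∀ c' : ↥(cubes x.toKIdx.D.toDomains), B9Cor36GDirKnitRowsAtMemberY.DatumBUY x.toKIdx c' U (gdira₁ N θ.d₆ θ.ℓ₆ θ.hd' θ.hL' θ.b₀ θ.b₁ Mstar α₀K ϱ' ϱ) α₀K ϱ')
    (hRflA : ∀ x, q.M₁ ≤ (geo9Y x).M → ∀ α₀ : ℝ, 0 < α₀ → c * (geo9Y x).M * α₀ ≤ q.a₁ → ∀ U : (bg9YR (Matrix (Fin N) (Fin N) ℂ) (specialUnitaryUnits (Fin N)) R₁ R₂ x).Cfg, (bg9YR (Matrix (Fin N) (Fin N) ℂ) (specialUnitaryUnits (Fin N)) R₁ R₂ x).Reg335 c α₀ U →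
      ∀ (c' : ↥(cubes x.toKIdx.D.toDomains)) u A Q T C ξ Λ, B9Cor36GDirKnitRowsAtMemberY.DatumBWit x.toKIdx c' U (gdira₁ N θ.d₆ θ.ℓ₆ θ.hd' θ.hL' θ.b₀ θ.b₁ Mstar α₀K ϱ' ϱ) α₀K ϱ' u A Q T C ξ Λ →
      ∀ (Rr : ℝ) (Hc : Prop) (ν : Fin (θ.d₆ + 1)), HasMajorant (g := toB6 (B9CubeGeometryInputs.geoCK x.toKIdx c') Rr Hc) (B9Cor35GCubeInputsAtOne.blkBK x.toKIdx c')
        (B9Cor35GDirInputsAtOne.GiK (trBasis N) x.toKIdx (B9Cor35GDirKnitInputsAtOne.TKnitCY x.toKIdx c' (B9Eq337CutFieldDirY.cutCfgS x.toKIdx T (kGeo x.toKIdx).eta A))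
            (bondsOverY x.toKIdx (B9Cor35GpDirInputsAtOne.dirDomY x.toKIdx c')) *
          conj (trBasis N) (B9CoReadingCoords.cdsBₗ x.toKIdx (fun _ _ => (1 : (Matrix (Fin N) (Fin N) ℂ)ˣ)) ν))
        (fun a a' => BA₂ * (B9CubeGeometryInputs.geoCK x.toKIdx c').len a * Real.exp (-(gdirδ N θ.d₆ θ.ℓ₆ θ.hd' θ.hL' θ.b₀ θ.b₁ Mstar α₀K ϱ' ϱ * (B9CubeGeometryInputs.geoCK x.toKIdx c').dist a a'))))
    (hBcA'' : (coordBound39 (trBasis N) * ∑ j, ‖trBasis N j‖) ^ 2 * ((BA₂ + gdirB N θ.d₆ θ.ℓ₆ θ.hd' θ.hL' θ.b₀ θ.b₁ Mstar α₀K ϱ' ϱ) * B6.c1 (gdirdB N θ.d₆ θ.ℓ₆ θ.hd' θ.hL' θ.b₀ θ.b₁ Mstar α₀K ϱ' ϱ) (gdirδ N θ.d₆ θ.ℓ₆ θ.hd' θ.hL' θ.b₀ θ.b₁ Mstar α₀K ϱ' ϱ) (9 / 5000)) ≤ BcA)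
    (hδA'' : q.δ₀ ≤ (1 - 9 / 5000) * gdirδ N θ.d₆ θ.ℓ₆ θ.hd' θ.hL' θ.b₀ θ.b₁ Mstar α₀K ϱ' ϱ)
    -- [CASCADE-K «KC»] THE SECT.-D NETWORK's INPUTS (the binders of «KD» `t312_t313_opsYSectESt_knit_KD` that «KA» does not already carry): edition 125's network numerics ∕ tables, the 22 pins of the Sect.-D operator record, the Sect.-D composite letter pins and the displayed KNIT LAWS (node00-def-Y ruling (α))
    (hRP2 : ∀ (x : MemberY θ.d₆ θ.ℓ₆ θ.hd' θ.hL' θ.b₀ θ.b₁ Mstar) (α₀ : ℝ) (U : (bg9YR (Matrix (Fin N) (Fin N) ℂ) (specialUnitaryUnits (Fin N)) R₁ R₂ x).Cfg), (bg9YR (Matrix (Fin N) (Fin N) ℂ) (specialUnitaryUnits (Fin N)) R₁ R₂ x).Reg336 c α₀ U → 0 ≤ α₀ ∧ (bg9YP (Matrix (Fin N) (Fin N) ℂ) (specialUnitaryUnits (Fin N)) x).Reg336 c35Y α₀ U) (hα3 : 3 * p.α ≤ (1 - p.αF) * (1 - 2 * p.α)) (bHXT : ∀ x : MemberY θ.d₆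 θ.ℓ₆ θ.hd' θ.hL' θ.b₀ θ.b₁ Mstar, (bg9YR (Matrix (Fin N) (Fin N) ℂ) (specialUnitaryUnits (Fin N)) R₁ R₂ x).Cfg → ℝ → BlockNorm (toB6 (geo9Y x) 1 (H x)) ((XSK (TrIdx N) x.toKIdx) → ℝ)) (hbHXT : ∀ (x : MemberY θ.d₆ θ.ℓ₆ θ.hd' θ.hL' θ.b₀ θ.b₁ Mstar) (U : (bg9YR (Matrix (Fin N) (Fin N) ℂ) (specialUnitaryUnits (Fin N)) R₁ R₂ x).Cfg), bHXT x U = fun ε => letI : Fintype (B9GeoNormsKLevelV1.geo9K x.toKIdx).Site := (inferInstance : Fintype (geo9Y x).Site); bHZPIfam (κ := TrIdx N) x.toKIdx (trBasis N) (taxiS x.toKIdx (bg9YR (Matrix (Fin N) (Fin N) ℂ) (specialUnitaryUnits (Fin N)) R₁ R₂ x) (fun U => U) U) (R := (1 : ℝ)) (H := H x) ε) (hopI : ∀ x, p.M₁ ≤ (geo9Y x).M → ∀ α₀ : ℝ, 0 < α₀ → c * (geo9Y x).M * α₀ ≤ p.a₁ → ∀ U : (bg9YR (Matrix (Fin N)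 (Fin N) ℂ) (specialUnitaryUnits (Fin N)) R₁ R₂ x).Cfg, (bg9YR (Matrix (Fin N) (Fin N) ℂ) (specialUnitaryUnits (Fin N)) R₁ R₂ x).Reg335 c α₀ U → InputLegsPair37 (opsWalkYO x (trBasis N) (bg9YR (Matrix (Fin N) (Fin N) ℂ) (specialUnitaryUnits (Fin N)) R₁ R₂ x) (fun U => U) (parKnitY x.toKIdx) (bI x) (fun cc : ↥(cubes x.toKIdx.D.toDomains) => GpDirY x.toKIdx cc (parKnitCubeY x.toKIdx cc) (B9Cor35GpDirInputsAtOne.dirDomY x.toKIdx cc))) (dirOpsWalkYO x (trBasis N) (bg9YR (Matrix (Fin N) (Fin N) ℂ) (specialUnitaryUnits (Fin N)) R₁ R₂ x) (fun U => U) (parKnitY x.toKIdx) (bI x) (fun cc : ↥(cubes x.toKIdx.D.toDomains) => GpDirY x.toKIdx cc (parKnitCubeY x.toKIdx cc) (B9Cor35GpDirInputsAtOne.dirDomY x.toKIdx cc))) (𝔭 x) 1 (H x) (bHXT x U) (SI x) p.BI p.BI2 p.δ₀ U ∧ FactorsInputPair37Dir (opsWalkYO x (trBasis N) (bg9YR (Matrix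 (Fin N) (Fin N) ℂ) (specialUnitaryUnits (Fin N)) R₁ R₂ x) (fun U => U) (parKnitY x.toKIdx) (bI x) (fun cc : ↥(cubes x.toKIdx.D.toDomains) => GpDirY x.toKIdx cc (parKnitCubeY x.toKIdx cc) (B9Cor35GpDirInputsAtOne.dirDomY x.toKIdx cc))) (dirOpsWalkYO x (trBasis N) (bg9YR (Matrix (Fin N) (Fin N) ℂ) (specialUnitaryUnits (Fin N)) R₁ R₂ x) (fun U => U) (parKnitY x.toKIdx) (bI x) (fun cc : ↥(cubes x.toKIdx.D.toDomains) => GpDirY x.toKIdx cc (parKnitCubeY x.toKIdx cc) (B9Cor35GpDirInputsAtOne.dirDomY x.toKIdx cc))) (dirLettersWalkYO x (trBasis N) (bg9YR (Matrix (Fin N) (Fin N) ℂ) (specialUnitaryUnits (Fin N)) R₁ R₂ x) (fun U => U) (parKnitY x.toKIdx) (bI x) (fun cc : ↥(cubes x.toKIdx.D.toDomains) => GpDirY x.toKIdx cc (parKnitCubeY x.toKIdx cc) (B9Cor35GpDirInputsAtOne.dirDomY x.toKIdx cc))) 1 (H x) (bHXT x U) p.θI p.δ₀ U) (S2A : ∀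 x : MemberY θ.d₆ θ.ℓ₆ θ.hd' θ.hL' θ.b₀ θ.b₁ Mstar, ↥(cubes x.toKIdx.D.toDomains) → Finset (geo9Y x).Site) (bHXTA : ∀ x : MemberY θ.d₆ θ.ℓ₆ θ.hd' θ.hL' θ.b₀ θ.b₁ Mstar, (bg9YR (Matrix (Fin N) (Fin N) ℂ) (specialUnitaryUnits (Fin N)) R₁ R₂ x).Cfg → ℝ → BlockNorm (toB6 (geo9Y x) 1 (H x)) ((XBK (TrIdx N) x.toKIdx) → ℝ)) (hbHXTA : ∀ (x : MemberY θ.d₆ θ.ℓ₆ θ.hd' θ.hL' θ.b₀ θ.b₁ Mstar) (U : (bg9YR (Matrix (Fin N) (Fin N) ℂ) (specialUnitaryUnits (Fin N)) R₁ R₂ x).Cfg), bHXTA x U = fun ε => letI : Fintype (B9GeoNormsKLevelV1.geo9K x.toKIdx).Site := (inferInstance : Fintype (geo9Y x).Site); bHZKPIfam (κ := TrIdx N) x.toKIdx (trBasis N) (taxiB x.toKIdx (bg9YR (Matrix (Fin N) (Fin N) ℂ) (specialUnitaryUnits (Fin N)) R₁ R₂ x) (fun U => U) U) (R := (1 : ℝ))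 (H := H x) ε) (hopIA : ∀ x, q.M₁ ≤ (geo9Y x).M → ∀ α₀ : ℝ, 0 < α₀ → c * (geo9Y x).M * α₀ ≤ q.a₁ → ∀ U : (bg9YR (Matrix (Fin N) (Fin N) ℂ) (specialUnitaryUnits (Fin N)) R₁ R₂ x).Cfg, (bg9YR (Matrix (Fin N) (Fin N) ℂ) (specialUnitaryUnits (Fin N)) R₁ R₂ x).Reg335 c α₀ U → InputLegsPair310 (ops310WalkYO x (trBasis N) (bg9YR (Matrix (Fin N) (Fin N) ℂ) (specialUnitaryUnits (Fin N)) R₁ R₂ x) (fun U => U) (bI x) (lettersYOfRecordV11K N θ.toStage3Params Mstar (resYOfRecordPK N θ.toStage3Params Mstar) x).GA (fun cc : ↥(cubes x.toKIdx.D.toDomains) => GDirCKY x.toKIdx cc (DPDsDirCubeY x.toKIdx cc (B9Cor35GpDirInputsAtOne.dirDomY x.toKIdx cc)) (bondsOverY x.toKIdx (B9Cor35GpDirInputsAtOne.dirDomY x.toKIdx cc))) (S0coKq x.toKIdx (trBasis N) (bg9YR (Matrix (Fin N) (Fin N) ℂ) (specialUnitaryUnits (Fin N)) R₁ R₂ x)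 (fun V => V) (qKnitOfRecord N θ.toStage3Params x.toKIdx) (qsKnitOfRecord N θ.toStage3Params x.toKIdx) (parKnitY x.toKIdx) (GpPhysY x.toKIdx (parKnitY x.toKIdx))) (fun U => eq3105FamQLY x.toKIdx (trBasis N) (qKnitOfRecord N θ.toStage3Params x.toKIdx) (qsKnitOfRecord N θ.toStage3Params x.toKIdx) (parKnitY x.toKIdx) (GpPhysY x.toKIdx (parKnitY x.toKIdx)) (fun cc : ↥(cubes x.toKIdx.D.toDomains) => GDirCKY x.toKIdx cc (DPDsDirCubeY x.toKIdx cc (B9Cor35GpDirInputsAtOne.dirDomY x.toKIdx cc)) (bondsOverY x.toKIdx (B9Cor35GpDirInputsAtOne.dirDomY x.toKIdx cc))) (fun cc : ↥(cubes x.toKIdx.D.toDomains) => (DPDsDirCubeY x.toKIdx cc (B9Cor35GpDirInputsAtOne.dirDomY x.toKIdx cc))) (fun (cc : ↥(cubes x.toKIdx.D.toDomains)) (U : (bg9YR (Matrix (Fin N) (Fin N) ℂ) (specialUnitaryUnits (Fin N)) R₁ R₂ x).Cfg) => (P1DirCubeY x.toKIdx cc (hTY x.toKIdx cc) (B9Cor35GpDirInputsAtOne.dirDomY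 x.toKIdx cc)) U) U) (fun U => eq3105FamQTLY x.toKIdx (trBasis N) (qKnitOfRecord N θ.toStage3Params x.toKIdx) (qsKnitOfRecord N θ.toStage3Params x.toKIdx) (parKnitY x.toKIdx) (GpPhysY x.toKIdx (parKnitY x.toKIdx)) (fun cc : ↥(cubes x.toKIdx.D.toDomains) => GDirCKY x.toKIdx cc (DPDsDirCubeY x.toKIdx cc (B9Cor35GpDirInputsAtOne.dirDomY x.toKIdx cc)) (bondsOverY x.toKIdx (B9Cor35GpDirInputsAtOne.dirDomY x.toKIdx cc))) (fun cc : ↥(cubes x.toKIdx.D.toDomains) => (DPDsDirCubeY x.toKIdx cc (B9Cor35GpDirInputsAtOne.dirDomY x.toKIdx cc))) (fun (cc : ↥(cubes x.toKIdx.D.toDomains)) (U : (bg9YR (Matrix (Fin N) (Fin N) ℂ) (specialUnitaryUnits (Fin N)) R₁ R₂ x).Cfg) => (P1DirCubeY x.toKIdx cc (hTY x.toKIdx cc) (B9Cor35GpDirInputsAtOne.dirDomY x.toKIdx cc)) U) U) (SFA x)) (dirOps310WalkYO x (trBasis N) (bg9YR (Matrix (Fin N) (Fin N) ℂ) (specialUnitaryUnits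 (Fin N)) R₁ R₂ x) (fun U => U) (bI x) (lettersYOfRecordV11K N θ.toStage3Params Mstar (resYOfRecordPK N θ.toStage3Params Mstar) x).GA (fun cc : ↥(cubes x.toKIdx.D.toDomains) => GDirCKY x.toKIdx cc (DPDsDirCubeY x.toKIdx cc (B9Cor35GpDirInputsAtOne.dirDomY x.toKIdx cc)) (bondsOverY x.toKIdx (B9Cor35GpDirInputsAtOne.dirDomY x.toKIdx cc))) (S0coKq x.toKIdx (trBasis N) (bg9YR (Matrix (Fin N) (Fin N) ℂ) (specialUnitaryUnits (Fin N)) R₁ R₂ x) (fun V => V) (qKnitOfRecord N θ.toStage3Params x.toKIdx) (qsKnitOfRecord N θ.toStage3Params x.toKIdx) (parKnitY x.toKIdx) (GpPhysY x.toKIdx (parKnitY x.toKIdx))) (fun U => eq3105FamQLY x.toKIdx (trBasis N) (qKnitOfRecord N θ.toStage3Params x.toKIdx) (qsKnitOfRecord N θ.toStage3Params x.toKIdx) (parKnitY x.toKIdx) (GpPhysY x.toKIdx (parKnitY x.toKIdx)) (fun cc : ↥(cubes x.toKIdx.D.toDomains) => GDirCKY x.toKIdx cc (DPDsDirCubeY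 x.toKIdx cc (B9Cor35GpDirInputsAtOne.dirDomY x.toKIdx cc)) (bondsOverY x.toKIdx (B9Cor35GpDirInputsAtOne.dirDomY x.toKIdx cc))) (fun cc : ↥(cubes x.toKIdx.D.toDomains) => (DPDsDirCubeY x.toKIdx cc (B9Cor35GpDirInputsAtOne.dirDomY x.toKIdx cc))) (fun (cc : ↥(cubes x.toKIdx.D.toDomains)) (U : (bg9YR (Matrix (Fin N) (Fin N) ℂ) (specialUnitaryUnits (Fin N)) R₁ R₂ x).Cfg) => (P1DirCubeY x.toKIdx cc (hTY x.toKIdx cc) (B9Cor35GpDirInputsAtOne.dirDomY x.toKIdx cc)) U) U) (fun U => eq3105FamQTLY x.toKIdx (trBasis N) (qKnitOfRecord N θ.toStage3Params x.toKIdx) (qsKnitOfRecord N θ.toStage3Params x.toKIdx) (parKnitY x.toKIdx) (GpPhysY x.toKIdx (parKnitY x.toKIdx)) (fun cc : ↥(cubes x.toKIdx.D.toDomains) => GDirCKY x.toKIdx cc (DPDsDirCubeY x.toKIdx cc (B9Cor35GpDirInputsAtOne.dirDomY x.toKIdx cc)) (bondsOverY x.toKIdx (B9Cor35GpDirInputsAtOne.dirDomY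 x.toKIdx cc))) (fun cc : ↥(cubes x.toKIdx.D.toDomains) => (DPDsDirCubeY x.toKIdx cc (B9Cor35GpDirInputsAtOne.dirDomY x.toKIdx cc))) (fun (cc : ↥(cubes x.toKIdx.D.toDomains)) (U : (bg9YR (Matrix (Fin N) (Fin N) ℂ) (specialUnitaryUnits (Fin N)) R₁ R₂ x).Cfg) => (P1DirCubeY x.toKIdx cc (hTY x.toKIdx cc) (B9Cor35GpDirInputsAtOne.dirDomY x.toKIdx cc)) U) U) (SFA x)) (𝔭A x) 1 (H x) (bHXTA x U) (SIA x) q.BI q.BI2 q.δ₀ U ∧ FactorsInputPair310 (ops310WalkYO x (trBasis N) (bg9YR (Matrix (Fin N) (Fin N) ℂ) (specialUnitaryUnits (Fin N)) R₁ R₂ x) (fun U => U) (bI x) (lettersYOfRecordV11K N θ.toStage3Params Mstar (resYOfRecordPK N θ.toStage3Params Mstar) x).GA (fun cc : ↥(cubes x.toKIdx.D.toDomains) => GDirCKY x.toKIdx cc (DPDsDirCubeY x.toKIdx cc (B9Cor35GpDirInputsAtOne.dirDomY x.toKIdx cc)) (bondsOverY x.toKIdx (B9Cor35GpDirInputsAtOne.dirDomY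 x.toKIdx cc))) (S0coKq x.toKIdx (trBasis N) (bg9YR (Matrix (Fin N) (Fin N) ℂ) (specialUnitaryUnits (Fin N)) R₁ R₂ x) (fun V => V) (qKnitOfRecord N θ.toStage3Params x.toKIdx) (qsKnitOfRecord N θ.toStage3Params x.toKIdx) (parKnitY x.toKIdx) (GpPhysY x.toKIdx (parKnitY x.toKIdx))) (fun U => eq3105FamQLY x.toKIdx (trBasis N) (qKnitOfRecord N θ.toStage3Params x.toKIdx) (qsKnitOfRecord N θ.toStage3Params x.toKIdx) (parKnitY x.toKIdx) (GpPhysY x.toKIdx (parKnitY x.toKIdx)) (fun cc : ↥(cubes x.toKIdx.D.toDomains) => GDirCKY x.toKIdx cc (DPDsDirCubeY x.toKIdx cc (B9Cor35GpDirInputsAtOne.dirDomY x.toKIdx cc)) (bondsOverY x.toKIdx (B9Cor35GpDirInputsAtOne.dirDomY x.toKIdx cc))) (fun cc : ↥(cubes x.toKIdx.D.toDomains) => (DPDsDirCubeY x.toKIdx cc (B9Cor35GpDirInputsAtOne.dirDomY x.toKIdx cc))) (fun (cc : ↥(cubes x.toKIdx.D.toDomains)) (U : (bg9YR (Matrix (Fin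 N) (Fin N) ℂ) (specialUnitaryUnits (Fin N)) R₁ R₂ x).Cfg) => (P1DirCubeY x.toKIdx cc (hTY x.toKIdx cc) (B9Cor35GpDirInputsAtOne.dirDomY x.toKIdx cc)) U) U) (fun U => eq3105FamQTLY x.toKIdx (trBasis N) (qKnitOfRecord N θ.toStage3Params x.toKIdx) (qsKnitOfRecord N θ.toStage3Params x.toKIdx) (parKnitY x.toKIdx) (GpPhysY x.toKIdx (parKnitY x.toKIdx)) (fun cc : ↥(cubes x.toKIdx.D.toDomains) => GDirCKY x.toKIdx cc (DPDsDirCubeY x.toKIdx cc (B9Cor35GpDirInputsAtOne.dirDomY x.toKIdx cc)) (bondsOverY x.toKIdx (B9Cor35GpDirInputsAtOne.dirDomY x.toKIdx cc))) (fun cc : ↥(cubes x.toKIdx.D.toDomains) => (DPDsDirCubeY x.toKIdx cc (B9Cor35GpDirInputsAtOne.dirDomY x.toKIdx cc))) (fun (cc : ↥(cubes x.toKIdx.D.toDomains)) (U : (bg9YR (Matrix (Fin N) (Fin N) ℂ) (specialUnitaryUnits (Fin N)) R₁ R₂ x).Cfg) => (P1DirCubeY x.toKIdx cc (hTY x.toKIdx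 cc) (B9Cor35GpDirInputsAtOne.dirDomY x.toKIdx cc)) U) U) (SFA x)) (dirOps310WalkYO x (trBasis N) (bg9YR (Matrix (Fin N) (Fin N) ℂ) (specialUnitaryUnits (Fin N)) R₁ R₂ x) (fun U => U) (bI x) (lettersYOfRecordV11K N θ.toStage3Params Mstar (resYOfRecordPK N θ.toStage3Params Mstar) x).GA (fun cc : ↥(cubes x.toKIdx.D.toDomains) => GDirCKY x.toKIdx cc (DPDsDirCubeY x.toKIdx cc (B9Cor35GpDirInputsAtOne.dirDomY x.toKIdx cc)) (bondsOverY x.toKIdx (B9Cor35GpDirInputsAtOne.dirDomY x.toKIdx cc))) (S0coKq x.toKIdx (trBasis N) (bg9YR (Matrix (Fin N) (Fin N) ℂ) (specialUnitaryUnits (Fin N)) R₁ R₂ x) (fun V => V) (qKnitOfRecord N θ.toStage3Params x.toKIdx) (qsKnitOfRecord N θ.toStage3Params x.toKIdx) (parKnitY x.toKIdx) (GpPhysY x.toKIdx (parKnitY x.toKIdx))) (fun U => eq3105FamQLY x.toKIdx (trBasis N) (qKnitOfRecord N θ.toStage3Params x.toKIdx) (qsKnitOfRecord N θ.toStage3Params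 x.toKIdx) (parKnitY x.toKIdx) (GpPhysY x.toKIdx (parKnitY x.toKIdx)) (fun cc : ↥(cubes x.toKIdx.D.toDomains) => GDirCKY x.toKIdx cc (DPDsDirCubeY x.toKIdx cc (B9Cor35GpDirInputsAtOne.dirDomY x.toKIdx cc)) (bondsOverY x.toKIdx (B9Cor35GpDirInputsAtOne.dirDomY x.toKIdx cc))) (fun cc : ↥(cubes x.toKIdx.D.toDomains) => (DPDsDirCubeY x.toKIdx cc (B9Cor35GpDirInputsAtOne.dirDomY x.toKIdx cc))) (fun (cc : ↥(cubes x.toKIdx.D.toDomains)) (U : (bg9YR (Matrix (Fin N) (Fin N) ℂ) (specialUnitaryUnits (Fin N)) R₁ R₂ x).Cfg) => (P1DirCubeY x.toKIdx cc (hTY x.toKIdx cc) (B9Cor35GpDirInputsAtOne.dirDomY x.toKIdx cc)) U) U) (fun U => eq3105FamQTLY x.toKIdx (trBasis N) (qKnitOfRecord N θ.toStage3Params x.toKIdx) (qsKnitOfRecord N θ.toStage3Params x.toKIdx) (parKnitY x.toKIdx) (GpPhysY x.toKIdx (parKnitY x.toKIdx)) (fun cc : ↥(cubes x.toKIdx.D.toDomains)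 => GDirCKY x.toKIdx cc (DPDsDirCubeY x.toKIdx cc (B9Cor35GpDirInputsAtOne.dirDomY x.toKIdx cc)) (bondsOverY x.toKIdx (B9Cor35GpDirInputsAtOne.dirDomY x.toKIdx cc))) (fun cc : ↥(cubes x.toKIdx.D.toDomains) => (DPDsDirCubeY x.toKIdx cc (B9Cor35GpDirInputsAtOne.dirDomY x.toKIdx cc))) (fun (cc : ↥(cubes x.toKIdx.D.toDomains)) (U : (bg9YR (Matrix (Fin N) (Fin N) ℂ) (specialUnitaryUnits (Fin N)) R₁ R₂ x).Cfg) => (P1DirCubeY x.toKIdx cc (hTY x.toKIdx cc) (B9Cor35GpDirInputsAtOne.dirDomY x.toKIdx cc)) U) U) (SFA x)) 1 (H x) (bHXTA x U) q.θI q.δ₀ U) (h36A2 : ∀ x, q.M₁ ≤ (geo9Y x).M → ∀ α₀ : ℝ, 0 < α₀ → c * (geo9Y x).M * α₀ ≤ q.a₁ → ∀ U : (bg9YR (Matrix (Fin N) (Fin N) ℂ) (specialUnitaryUnits (Fin N)) R₁ R₂ x).Cfg, (bg9YR (Matrix (Fin N) (Fin N) ℂ) (specialUnitaryUnits (Fin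 N)) R₁ R₂ x).Reg335 c α₀ U → L2TwoLegs310 (ops310WalkYO x (trBasis N) (bg9YR (Matrix (Fin N) (Fin N) ℂ) (specialUnitaryUnits (Fin N)) R₁ R₂ x) (fun U => U) (bI x) (lettersYOfRecordV11K N θ.toStage3Params Mstar (resYOfRecordPK N θ.toStage3Params Mstar) x).GA (fun cc : ↥(cubes x.toKIdx.D.toDomains) => GDirCKY x.toKIdx cc (DPDsDirCubeY x.toKIdx cc (B9Cor35GpDirInputsAtOne.dirDomY x.toKIdx cc)) (bondsOverY x.toKIdx (B9Cor35GpDirInputsAtOne.dirDomY x.toKIdx cc))) (S0coKq x.toKIdx (trBasis N) (bg9YR (Matrix (Fin N) (Fin N) ℂ) (specialUnitaryUnits (Fin N)) R₁ R₂ x) (fun V => V) (qKnitOfRecord N θ.toStage3Params x.toKIdx) (qsKnitOfRecord N θ.toStage3Params x.toKIdx) (parKnitY x.toKIdx) (GpPhysY x.toKIdx (parKnitY x.toKIdx))) (fun U => eq3105FamQLY x.toKIdx (trBasis N) (qKnitOfRecord N θ.toStage3Params x.toKIdx) (qsKnitOfRecord N θ.toStage3Params x.toKIdx) (parKnitY x.toKIdx)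 (GpPhysY x.toKIdx (parKnitY x.toKIdx)) (fun cc : ↥(cubes x.toKIdx.D.toDomains) => GDirCKY x.toKIdx cc (DPDsDirCubeY x.toKIdx cc (B9Cor35GpDirInputsAtOne.dirDomY x.toKIdx cc)) (bondsOverY x.toKIdx (B9Cor35GpDirInputsAtOne.dirDomY x.toKIdx cc))) (fun cc : ↥(cubes x.toKIdx.D.toDomains) => (DPDsDirCubeY x.toKIdx cc (B9Cor35GpDirInputsAtOne.dirDomY x.toKIdx cc))) (fun (cc : ↥(cubes x.toKIdx.D.toDomains)) (U : (bg9YR (Matrix (Fin N) (Fin N) ℂ) (specialUnitaryUnits (Fin N)) R₁ R₂ x).Cfg) => (P1DirCubeY x.toKIdx cc (hTY x.toKIdx cc) (B9Cor35GpDirInputsAtOne.dirDomY x.toKIdx cc)) U) U) (fun U => eq3105FamQTLY x.toKIdx (trBasis N) (qKnitOfRecord N θ.toStage3Params x.toKIdx) (qsKnitOfRecord N θ.toStage3Params x.toKIdx) (parKnitY x.toKIdx) (GpPhysY x.toKIdx (parKnitY x.toKIdx)) (fun cc : ↥(cubes x.toKIdx.D.toDomains) => GDirCKY x.toKIdx cc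 (DPDsDirCubeY x.toKIdx cc (B9Cor35GpDirInputsAtOne.dirDomY x.toKIdx cc)) (bondsOverY x.toKIdx (B9Cor35GpDirInputsAtOne.dirDomY x.toKIdx cc))) (fun cc : ↥(cubes x.toKIdx.D.toDomains) => (DPDsDirCubeY x.toKIdx cc (B9Cor35GpDirInputsAtOne.dirDomY x.toKIdx cc))) (fun (cc : ↥(cubes x.toKIdx.D.toDomains)) (U : (bg9YR (Matrix (Fin N) (Fin N) ℂ) (specialUnitaryUnits (Fin N)) R₁ R₂ x).Cfg) => (P1DirCubeY x.toKIdx cc (hTY x.toKIdx cc) (B9Cor35GpDirInputsAtOne.dirDomY x.toKIdx cc)) U) U) (SFA x)) 1 (H x) (S2A x) q.B2 q.δ₀ U ∧ FactorsL2_310 (ops310WalkYO x (trBasis N) (bg9YR (Matrix (Fin N) (Fin N) ℂ) (specialUnitaryUnits (Fin N)) R₁ R₂ x) (fun U => U) (bI x) (lettersYOfRecordV11K N θ.toStage3Params Mstar (resYOfRecordPK N θ.toStage3Params Mstar) x).GA (fun cc : ↥(cubes x.toKIdx.D.toDomains) => GDirCKY x.toKIdx cc (DPDsDirCubeY x.toKIdx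 cc (B9Cor35GpDirInputsAtOne.dirDomY x.toKIdx cc)) (bondsOverY x.toKIdx (B9Cor35GpDirInputsAtOne.dirDomY x.toKIdx cc))) (S0coKq x.toKIdx (trBasis N) (bg9YR (Matrix (Fin N) (Fin N) ℂ) (specialUnitaryUnits (Fin N)) R₁ R₂ x) (fun V => V) (qKnitOfRecord N θ.toStage3Params x.toKIdx) (qsKnitOfRecord N θ.toStage3Params x.toKIdx) (parKnitY x.toKIdx) (GpPhysY x.toKIdx (parKnitY x.toKIdx))) (fun U => eq3105FamQLY x.toKIdx (trBasis N) (qKnitOfRecord N θ.toStage3Params x.toKIdx) (qsKnitOfRecord N θ.toStage3Params x.toKIdx) (parKnitY x.toKIdx) (GpPhysY x.toKIdx (parKnitY x.toKIdx)) (fun cc : ↥(cubes x.toKIdx.D.toDomains) => GDirCKY x.toKIdx cc (DPDsDirCubeY x.toKIdx cc (B9Cor35GpDirInputsAtOne.dirDomY x.toKIdx cc)) (bondsOverY x.toKIdx (B9Cor35GpDirInputsAtOne.dirDomY x.toKIdx cc))) (fun cc : ↥(cubes x.toKIdx.D.toDomains) => (DPDsDirCubeY x.toKIdx cc (B9Cor35GpDirInputsAtOne.dirDomY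 x.toKIdx cc))) (fun (cc : ↥(cubes x.toKIdx.D.toDomains)) (U : (bg9YR (Matrix (Fin N) (Fin N) ℂ) (specialUnitaryUnits (Fin N)) R₁ R₂ x).Cfg) => (P1DirCubeY x.toKIdx cc (hTY x.toKIdx cc) (B9Cor35GpDirInputsAtOne.dirDomY x.toKIdx cc)) U) U) (fun U => eq3105FamQTLY x.toKIdx (trBasis N) (qKnitOfRecord N θ.toStage3Params x.toKIdx) (qsKnitOfRecord N θ.toStage3Params x.toKIdx) (parKnitY x.toKIdx) (GpPhysY x.toKIdx (parKnitY x.toKIdx)) (fun cc : ↥(cubes x.toKIdx.D.toDomains) => GDirCKY x.toKIdx cc (DPDsDirCubeY x.toKIdx cc (B9Cor35GpDirInputsAtOne.dirDomY x.toKIdx cc)) (bondsOverY x.toKIdx (B9Cor35GpDirInputsAtOne.dirDomY x.toKIdx cc))) (fun cc : ↥(cubes x.toKIdx.D.toDomains) => (DPDsDirCubeY x.toKIdx cc (B9Cor35GpDirInputsAtOne.dirDomY x.toKIdx cc))) (fun (cc : ↥(cubes x.toKIdx.D.toDomains)) (U : (bg9YR (Matrix (Fin N) (Fin N) ℂ)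 (specialUnitaryUnits (Fin N)) R₁ R₂ x).Cfg) => (P1DirCubeY x.toKIdx cc (hTY x.toKIdx cc) (B9Cor35GpDirInputsAtOne.dirDomY x.toKIdx cc)) U) U) (SFA x)) 1 (H x) q.θ2 q.δ₀ U) (hcnt2A : ∀ x (a : (geo9Y x).Site), (∑ c, if a ∈ S2A x c then (1 : ℝ) else 0) ≤ q.N2)
             (bH13 : ∀ x : MemberY θ.d₆ θ.ℓ₆ θ.hd' θ.hL' θ.b₀ θ.b₁ Mstar, (bg9YR (Matrix (Fin N) (Fin N) ℂ) (specialUnitaryUnits (Fin N)) R₁ R₂ x).Cfg → BlockNorm (toB6 (geo9Y x) 1 (H x)) (XSK (TrIdx N) x.toKIdx → ℝ)) (δ12₀ δK12 σ12 ρ12 a12 M12 B12₃ δ12₃ ρ13 α12 : ℝ) (ρf12 : ℝ) (hρf12 : 0 < ρf12) (hρf1 : ρf12 + σ12 ≤ (1 - α12) * ρ12) (hρf2 : ρf12 + 2 * σ12 + α12 * ρ12 ≤ ρ12) (hB12₃ : 0 ≤ B12₃) (hσ12 : 0 < σ12) (hρ12 : 0 < ρ12) (hρS12 : ρ12 ≤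 δ12₀) (hρδ12 : ρ12 + 2 * σ12 ≤ δK12) (hρ₃12 : ρ12 + σ12 ≤ δ12₃) (ha12 : 0 < a12)
    -- [«KE₂»] node00-def-Y's x-free knit numerics for the three folded laws (✓p795647 `OpsYKnitGuardAdaptersKD`): `4α₀ᴷ ≤ c₂′`, the B8-Prop-7 exponential window, `α₀ᴷ ≤ α_Q`, `k_col·α₀ᴷ < 1`, `a12 ≤ aK`
    (hαK4 : 4 * α₀K ≤ c2' (θ.d₆ + 1) (θ.ℓ₆ + 1)) (hexpK : Real.exp (4 * (800 * (((θ.d₆ + 1 : ℕ) : ℝ) + 1) ^ 2 * (((θ.d₆ + 1 : ℕ) : ℝ) + 4)) * α₀K) < 2) (hsmallK : kCol (θ.d₆ + 1) (θ.ℓ₆ + 1) * α₀K < 1) (ha12K : a12 ≤ aK) (hM12 : 0 < M12)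
    -- [«KE₃»] x-free knit numerics for the folded laws (dag-n06-l ✓`N06KnitLawsAtRecordKE`, ✓`N06Eq346KnitLegAtPinsR`): the (2.60) floor `2·log L ≤ δ12₃(2L²−1)M12` and the K-0 coercivity window `(d+1)²α₀ᴷ ≤ 1/100`
    (hM12q : (2 : ℝ) * Real.log (((θ.ℓ₆ + 1 : ℕ) : ℝ)) ≤ δ12₃ * (2 * ((θ.ℓ₆ : ℝ) + 1) ^ 2 - 1) * M12) (hαdK : ((θ.d₆ : ℝ) + 1) ^ 2 * α₀K ≤ 1 / 100) (hα12 : 0 < α12) (hα12' : α12 ≤ 1 / 2) (hδ₃₀ : δ12₃ < δ12₀) (hδ12₀ : δ12₀ ≤ (1 - 3 * q.αF) * ((1 - 2 * q.α) * q.δ₀)) (t12 δT12 ρS σS : ℝ) (ht12 : 0 ≤ t12) (hσS : 0 < σS) (hρST : ρS ≤ δT12) (hρS₀ : ρS + σS ≤ δ12₀) (hδKS : δK12 + q.αF * ((1 - 2 * q.α) * q.δ₀) ≤ ρS) (hσSK : σS ≤ δK12) (bXH : ∀ x : MemberY θ.d₆ θ.ℓ₆ θ.hd' θ.hL' θ.b₀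 θ.b₁ Mstar, (bg9YR (Matrix (Fin N) (Fin N) ℂ) (specialUnitaryUnits (Fin N)) R₁ R₂ x).Cfg → BlockNorm (toB6 (geo9Y x) 1 (H x)) (XBK (TrIdx N) x.toKIdx → ℝ)) (w13 wX : ℝ → ℝ) (hw13₀ : ∀ s, 0 ≤ w13 s) (hw13₁ : ∀ s, w13 s ≤ 1) (hwX₀ : ∀ s, 0 ≤ wX s) (hwX₁ : ∀ s, wX s ≤ 1) (hbH13 : ∀ (x : MemberY θ.d₆ θ.ℓ₆ θ.hd' θ.hL' θ.b₀ θ.b₁ Mstar) (U : (bg9YR (Matrix (Fin N) (Fin N) ℂ) (specialUnitaryUnits (Fin N)) R₁ R₂ x).Cfg), bH13 x U = letI : Fintype (B9GeoNormsKLevelV1.geo9K x.toKIdx).Site := (inferInstance : Fintype (geo9Y x).Site); bHZPG (κ := TrIdx N) x.toKIdx (trBasis N) (taxiS x.toKIdx (bg9YR (Matrix (Fin N) (Fin N) ℂ) (specialUnitaryUnits (Fin N)) R₁ R₂ x) (fun U => U) U) (R := (1 : ℝ)) (H := H x) w13 hw13₀ hw13₁) (hbXH : ∀ (x : MemberY θ.d₆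 θ.ℓ₆ θ.hd' θ.hL' θ.b₀ θ.b₁ Mstar) (U : (bg9YR (Matrix (Fin N) (Fin N) ℂ) (specialUnitaryUnits (Fin N)) R₁ R₂ x).Cfg), bXH x U = letI : Fintype (B9GeoNormsKLevelV1.geo9K x.toKIdx).Site := (inferInstance : Fintype (geo9Y x).Site); bHZKPG (κ := TrIdx N) x.toKIdx (trBasis N) (taxiB x.toKIdx (bg9YR (Matrix (Fin N) (Fin N) ℂ) (specialUnitaryUnits (Fin N)) R₁ R₂ x) (fun U => U) U) (R := (1 : ℝ)) (H := H x) wX hwX₀ hwX₁) (hρ13 : 0 < ρ13) (hρ13ρ : ρ13 + 5 * σ12 ≤ ρ12) (hσρ13 : 3 * σ12 < (1 - α12) * ρ13) (B13₄ : ℝ) (Bx13 : ℝ → ℝ) (hB13₄ : 0 ≤ B13₄) (hBx13 : ∀ β, 0 ≤ β → β < 1 → 0 ≤ Bx13 β) (tJ δB rT : ℝ) (ha1J : 10 * ((θ.ℓ₆ + 1 : ℕ) : ℝ) ^ 7 * a12 ≤ 1) (htJ : 2 * ((θ.d₆ : ℝ) + 1) * (((θ.ℓ₆ + 1 : ℕ)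 : ℝ)) ^ 3 * (N : ℝ) * (10 ^ 4 * ((θ.d₆ : ℝ) + 1) * (10 * ((θ.ℓ₆ + 1 : ℕ) : ℝ) ^ 7)) * Real.exp (3 * δB) ≤ tJ) (hrTP : rT ≤ min ((1 - 2 * p.α) * p.δ₀) δ39 / 8) (hrTB : rT ≤ δB) (hδT12 : 0 ≤ δT12) (hδTr : δT12 + 3 * σS + 3 * (q.αF * ((1 - 2 * q.α) * q.δ₀)) ≤ rT) (ϑF : ℝ) (hϑF : 2 * (10 * (((θ.ℓ₆ + 1 : ℕ) : ℝ)) * a12) * (1 + 10 * (((θ.ℓ₆ + 1 : ℕ) : ℝ)) * a12) * Real.exp (4 * (10 * (((θ.ℓ₆ + 1 : ℕ) : ℝ)) * a12)) * (((θ.ℓ₆ + 1 : ℕ) : ℝ)) ≤ ϑF) (sch : ℝ → ℝ) (hsch0 : ∀ β', 0 ≤ β' → β' < 1 → 0 < sch β') (hsch1 : ∀ β', 0 ≤ β' → β' < 1 → sch β' < 1) (hschβ : ∀ β', 0 ≤ β' → β' < 1 → β' < sch β') (hwsch : ∀ β', 0 ≤ β' → β' < 1 → 0 < w13 (sch β'))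 (δ45 : ℝ) (hδ45 : δ12₃ < δ45) (BZ : ℝ → ℝ) (hBZ : ∀ β', 0 ≤ β' → β' < 1 → 0 ≤ BZ β') (hBZge : ∀ β', 0 ≤ β' → β' < 1 → (((θ.ℓ₆ + 1 : ℕ) : ℝ)) * inputConst45 (exp261 (@geo9Y θ.d₆ θ.ℓ₆ θ.hd' θ.hL' θ.b₀ θ.b₁ Mstar) q.δ₀ q.α) q.δ₀ q.α q.NI q.NF (((θ.ℓ₆ + 1 : ℕ) : ℝ)) (holderConst (exp261 (@geo9Y θ.d₆ θ.ℓ₆ θ.hd' θ.hL' θ.b₀ θ.b₁ Mstar) q.δ₀ q.α) q.δ₀ q.α q.NH q.NF (const37 (exp261 (@geo9Y θ.d₆ θ.ℓ₆ θ.hd' θ.hL' θ.b₀ θ.b₁ Mstar) q.δ₀ q.α) q.δ₀ q.α q.ρ q.B₀ q.Nc q.N' q.Cℓ q.Kc) (q.Bl β') (q.Bt β')) (q.BI2 (sch β' - β') β') (q.θI (sch β')) ≤ BZ β') (hδ45le : δ45 ≤ ((1 - q.αF) * ((1 - 2 * q.α) * q.δ₀) - q.α * q.δ₀)) (δ₂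 : ℝ) (hrT4 : rT ≤ (Literature.MathematicalPhysics.QuantumFieldTheory.Balaban1983to89.B9Eq346GradGpDivAtPinsL2KnitClosed.δ46K θ.d₆ θ.ℓ₆ θ.hd' θ.hL' θ.b₀ θ.b₁ Mstar N c hc)) (hrT2 : rT ≤ δ₂) (hδ₃T : δ12₃ ≤ (1 - 2 * q.αF) * rT - σS) (hδ12₃F : δ12₃ ≤ (1 - 2 * p.αF) * ((1 - 2 * p.α) * p.δ₀)) (δ45Y : ℝ) (hδ45Y : δ12₃ < δ45Y) (BiY : ℝ → ℝ) (hBiY : ∀ β', 0 ≤ β' → β' < 1 → 0 ≤ BiY β') (αW σW δFW : ℝ) (hαW0 : 0 < αW) (hαW1 : αW < 1) (hσW : 0 < σW) (hδFW : 0 < δFW) (hδFP : δFW ≤ min ((1 - 2 * p.α) * p.δ₀) δ39 / 8) (hbudW : 0 ≤ δFW - αW * δFW - 2 * σW) (hδ3W : δ12₃ ≤ δFW - αW * δFW - 2 * σW)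
    (hwschX : ∀ β', 0 ≤ β' → β' < 1 → 0 < wX (sch β')) (δ45W : ℝ) (hδ45W : δFW - αW * δFW - 2 * σW ≤ δ45W) (B45W : ℝ → ℝ) (hB45W : ∀ β', 0 ≤ β' → β' < 1 → 0 ≤ B45W β') (δhW : ℝ) (hδhW : δFW - αW * δFW - σW ≤ δhW) (BhW : ℝ → ℝ) (hBhW : ∀ β', 0 ≤ β' → β' < 1 → 0 ≤ BhW β') (hB45Wge : ∀ β', 0 ≤ β' → β' < 1 → let Cσ : ℝ := ((((θ.ℓ₆ + 1 : ℕ) : ℝ)) * ((((θ.ℓ₆ + 1 : ℕ) : ℝ)) ^ 3 * (2 + 2 * coordBound39 (trBasis N) * basisBound39 (trBasis N) * (((θ.ℓ₆ + 1 : ℕ) : ℝ)) ^ 2)) * Real.exp ((1 - p.αF) * ((1 - 2 * p.α) * p.δ₀) * (2 * (rNear θ.d₆ θ.ℓ₆ + 1) + (((θ.d₆ : ℝ) + 1) * (((θ.ℓ₆ : ℝ) + 1) + 1) + 2)))); let X44 : ℝ := ((((θ.ℓ₆ + 1 : ℕ) : ℝ)) * ((1 + CLip θ.d₆ θ.ℓ₆)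 * inputConst44 (exp261 (@geo9Y θ.d₆ θ.ℓ₆ θ.hd' θ.hL' θ.b₀ θ.b₁ Mstar) p.δ₀ p.α) p.δ₀ p.α p.NI p.N' (p.C (exp261 (@geo9Y θ.d₆ θ.ℓ₆ θ.hd' θ.hL' θ.b₀ θ.b₁ Mstar) p.δ₀ p.α)) (((θ.ℓ₆ + 1 : ℕ) : ℝ)) (p.BI (sch β')) (p.θI (sch β')) * Cσ * B6.c1 (exp261 (@geo9Y θ.d₆ θ.ℓ₆ θ.hd' θ.hL' θ.b₀ θ.b₁ Mstar) p.δ₀ p.α) p.δ₀ p.α)); (((θ.d₆ + 1 : ℕ) : ℝ)) * ((((((θ.ℓ₆ + 1 : ℕ) : ℝ)) * ((1 + CLip θ.d₆ θ.ℓ₆) * inputConst45 (exp261 (@geo9Y θ.d₆ θ.ℓ₆ θ.hd' θ.hL' θ.b₀ θ.b₁ Mstar) p.δ₀ p.α) p.δ₀ p.α p.NI p.N' (((θ.ℓ₆ + 1 : ℕ) : ℝ)) (holderConst (exp261 (@geo9Y θ.d₆ θ.ℓ₆ θ.hd' θ.hL' θ.b₀ θ.b₁ Mstar) p.δ₀ p.α)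 p.δ₀ p.α p.NH p.N' (p.C (exp261 (@geo9Y θ.d₆ θ.ℓ₆ θ.hd' θ.hL' θ.b₀ θ.b₁ Mstar) p.δ₀ p.α)) (p.Bl β') (p.Bt β')) (p.BI2 (sch β' - β') β') (p.θI (sch β')) * Cσ * B6.c1 (exp261 (@geo9Y θ.d₆ θ.ℓ₆ θ.hd' θ.hL' θ.b₀ θ.b₁ Mstar) p.δ₀ p.α) p.δ₀ p.α)) + 2 * coordBound39 (trBasis N) * basisBound39 (trBasis N) * ((θ.ℓ₆ : ℝ) + 1) * Real.exp (((1 - p.αF) * ((1 - 2 * p.α) * p.δ₀) - 3 * (p.α * p.δ₀)) * (((θ.d₆ : ℝ) + 1) * (((θ.ℓ₆ : ℝ) + 1) + 1) + 2)) * ((((θ.d₆ + 1 : ℕ) : ℝ)) ^ 2 * (2 * (10 * (((θ.ℓ₆ + 1 : ℕ) : ℝ)) * (p.a₁ / c)) * (1 + 10 * (((θ.ℓ₆ + 1 : ℕ) : ℝ)) * (p.a₁ / c)) * Real.exp (4 * (10 * (((θ.ℓ₆ + 1 : ℕ) : ℝ)) * (p.a₁ / c)))) * (((θ.ℓ₆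 + 1 : ℕ) : ℝ)) ^ 6) * X44 + coordBound39 (trBasis N) * basisBound39 (trBasis N) * X44 + X44) + X44 + coordBound39 (trBasis N) * basisBound39 (trBasis N) * X44) ≤ B45W β') (hδ45Wle : δ45W ≤ ((1 - p.αF) * ((1 - 2 * p.α) * p.δ₀) - 3 * (p.α * p.δ₀))) (hBhWge : ∀ β', 0 ≤ β' → β' < 1 → ((B9RWSums343Holder.holderConst (B9RWSums347DefiniteFaces.exp261 (@geo9Y θ.d₆ θ.ℓ₆ θ.hd' θ.hL' θ.b₀ θ.b₁ Mstar) p.δ₀ p.α) p.δ₀ p.α p.NH p.N' (p.C (B9RWSums347DefiniteFaces.exp261 (@geo9Y θ.d₆ θ.ℓ₆ θ.hd' θ.hL' θ.b₀ θ.b₁ Mstar) p.δ₀ p.α)) (p.Bl β') (p.Bt β') + 2 * B9Thm39ReadingCoords.coordBound39 (trBasis N) * B9Thm39ReadingCoords.basisBound39 (trBasis N) * ((θ.ℓ₆ : ℝ) + 1) * Real.exp (((1 - 2 * p.α) * p.δ₀) * (((θ.d₆ : ℝ) + 1) * (((θ.ℓ₆ : ℝ) + 1) + 1) + 2)) * ((((θ.d₆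 + 1 : ℕ) : ℝ)) ^ 2 * (2 * (10 * ((θ.ℓ₆ + 1 : ℕ) : ℝ) * (p.a₁ / c)) * (1 + 10 * ((θ.ℓ₆ + 1 : ℕ) : ℝ) * (p.a₁ / c)) * Real.exp (4 * (10 * ((θ.ℓ₆ + 1 : ℕ) : ℝ) * (p.a₁ / c)))) * ((θ.ℓ₆ + 1 : ℕ) : ℝ) ^ 6) * (p.C (B9RWSums347DefiniteFaces.exp261 (@geo9Y θ.d₆ θ.ℓ₆ θ.hd' θ.hL' θ.b₀ θ.b₁ Mstar) p.δ₀ p.α)) + B9Thm39ReadingCoords.coordBound39 (trBasis N) * B9Thm39ReadingCoords.basisBound39 (trBasis N) * (p.C (B9RWSums347DefiniteFaces.exp261 (@geo9Y θ.d₆ θ.ℓ₆ θ.hd' θ.hL' θ.b₀ θ.b₁ Mstar) p.δ₀ p.α)) + (p.C (B9RWSums347DefiniteFaces.exp261 (@geo9Y θ.d₆ θ.ℓ₆ θ.hd' θ.hL' θ.b₀ θ.b₁ Mstar) p.δ₀ p.α))) + (p.C (B9RWSums347DefiniteFaces.exp261 (@geo9Y θ.d₆ θ.ℓ₆ θ.hd'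 θ.hL' θ.b₀ θ.b₁ Mstar) p.δ₀ p.α)) + B9Thm39ReadingCoords.coordBound39 (trBasis N) * B9Thm39ReadingCoords.basisBound39 (trBasis N) * (p.C (B9RWSums347DefiniteFaces.exp261 (@geo9Y θ.d₆ θ.ℓ₆ θ.hd' θ.hL' θ.b₀ θ.b₁ Mstar) p.δ₀ p.α))) ≤ BhW β') (hδhWle : δhW ≤ ((1 - 2 * p.α) * p.δ₀)) (CP : ℝ)
    (hCPge : ((θ.d₆ + 1 : ℕ) : ℝ) * (coordBound39 (trBasis N) * basisBound39 (trBasis N) * nearBlkCntY θ.d₆ θ.ℓ₆ θ.hd' θ.hL' θ.b₀ θ.b₁ Mstar * ((max 1 (N : ℝ) * ((nbrCountY θ.d₆ θ.ℓ₆ θ.hd' θ.hL' θ.b₀ θ.b₁ 2 : ℝ) * p.C (B9RWSums347DefiniteFaces.exp261 (@geo9Y θ.d₆ θ.ℓ₆ θ.hd' θ.hL' θ.b₀ θ.b₁ Mstar) p.δ₀ p.α) * Real.exp (2 * ((1 - 2 * p.α) * p.δ₀)))) * (cR39 (basis39 (Matrix (Fin N) (Fin N) ℂ)) * Fintype.card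 (κ39 (Matrix (Fin N) (Fin N) ℂ)) * B39 * Real.exp (2 * δ39)) * (max 1 (N : ℝ) * ((nbrCountY θ.d₆ θ.ℓ₆ θ.hd' θ.hL' θ.b₀ θ.b₁ 2 : ℝ) * p.C (B9RWSums347DefiniteFaces.exp261 (@geo9Y θ.d₆ θ.ℓ₆ θ.hd' θ.hL' θ.b₀ θ.b₁ Mstar) p.δ₀ p.α) * Real.exp (2 * ((1 - 2 * p.α) * p.δ₀)))) * cg349 θ.d₆ θ.ℓ₆ θ.hd' θ.hL' θ.b₀ θ.b₁ ((1 - 2 * p.α) * p.δ₀) δ39) * Real.exp (2 * (min ((1 - 2 * p.α) * p.δ₀) δ39 / 8))) ≤ CP) (hBxW : ∀ β', 0 ≤ β' → β' < 1 → (cR39 (trBasis N))⁻¹ * ((wX (sch β'))⁻¹ * B45W β' + BhW β' * (CP * (((θ.ℓ₆ + 1 : ℕ) : ℝ))) * ((wX (sch β'))⁻¹ * ((((θ.ℓ₆ + 1 : ℕ) : ℝ)) * Real.exp ((δFW - αW * δFW - σW) * (rNear θ.d₆ θ.ℓ₆ + 1)))) * rowConst261 (@geo9Y θ.d₆ θ.ℓ₆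 θ.hd' θ.hL' θ.b₀ θ.b₁ Mstar) σW * rowConst261 (@geo9Y θ.d₆ θ.ℓ₆ θ.hd' θ.hL' θ.b₀ θ.b₁ Mstar) σW) ≤ Bx13 β') (hBiYge : ∀ β', 0 ≤ β' → β' < 1 → (((θ.ℓ₆ + 1 : ℕ) : ℝ)) * inputConst45 (exp261 (@geo9Y θ.d₆ θ.ℓ₆ θ.hd' θ.hL' θ.b₀ θ.b₁ Mstar) q.δ₀ q.α) q.δ₀ q.α q.NI q.NF (((θ.ℓ₆ + 1 : ℕ) : ℝ)) (holderConst (exp261 (@geo9Y θ.d₆ θ.ℓ₆ θ.hd' θ.hL' θ.b₀ θ.b₁ Mstar) q.δ₀ q.α) q.δ₀ q.α q.NH q.NF (const37 (exp261 (@geo9Y θ.d₆ θ.ℓ₆ θ.hd' θ.hL' θ.b₀ θ.b₁ Mstar) q.δ₀ q.α) q.δ₀ q.α q.ρ q.B₀ q.Nc q.N' q.Cℓ q.Kc) (q.Bl β') (q.Bt β')) (q.BI2 (sch β' - β') β') (q.θI (sch β')) ≤ BiY β') (hδ45Yle : δ45Y ≤ ((1 - q.αF) * ((1 - 2 * q.α)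 * q.δ₀) - q.α * q.δ₀)) (s44 : ℝ) (hs440 : 0 < s44) (hs441 : s44 < 1) (hws44 : 0 < w13 s44) (δ44 : ℝ) (hδ44 : δ12₃ < δ44) (Bi44 : ℝ) (hBi44 : 0 ≤ Bi44) (hB12₃d : ((θ.d₆ : ℝ) + 1) * ((1 + CLip θ.d₆ θ.ℓ₆) * Bi44 * (CJG θ.d₆ θ.ℓ₆ (trBasis N) s44 (thetaL θ.d₆ θ.ℓ₆ ϑF) (w13 s44) (δ12₃ + 1 + 1 / 2 * (δ44 - δ12₃)) * (((θ.ℓ₆ + 1 : ℕ) : ℝ))) * rowConst261 (@geo9Y θ.d₆ θ.ℓ₆ θ.hd' θ.hL' θ.b₀ θ.b₁ Mstar) 1) ≤ B12₃) (hB12₃p : ((θ.d₆ : ℝ) + 1) * (1 * (((θ.d₆ : ℝ) + 1) * ((1 + CLip θ.d₆ θ.ℓ₆) * Bi44 * (CJG θ.d₆ θ.ℓ₆ (trBasis N) s44 (thetaL θ.d₆ θ.ℓ₆ ϑF) (w13 s44) (δ12₃ + 1 + 1 / 2 * (δ44 - δ12₃)) * (((θ.ℓ₆ + 1 : ℕ)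 : ℝ))) * rowConst261 (@geo9Y θ.d₆ θ.ℓ₆ θ.hd' θ.hL' θ.b₀ θ.b₁ Mstar) 1)) * rowConst261 (@geo9Y θ.d₆ θ.ℓ₆ θ.hd' θ.hL' θ.b₀ θ.b₁ Mstar) 1) ≤ B12₃) (hBi44ge : (((θ.ℓ₆ + 1 : ℕ) : ℝ)) * inputConst44 (exp261 (@geo9Y θ.d₆ θ.ℓ₆ θ.hd' θ.hL' θ.b₀ θ.b₁ Mstar) q.δ₀ q.α) q.δ₀ q.α q.NI q.NF (const37 (exp261 (@geo9Y θ.d₆ θ.ℓ₆ θ.hd' θ.hL' θ.b₀ θ.b₁ Mstar) q.δ₀ q.α) q.δ₀ q.α q.ρ q.B₀ q.Nc q.N' q.Cℓ q.Kc) (((θ.ℓ₆ + 1 : ℕ) : ℝ)) (q.BI s44) (q.θI s44) ≤ Bi44) (hδ44le : δ44 ≤ ((1 - q.αF) * ((1 - 2 * q.α) * q.δ₀) - q.α * q.δ₀)) (hwX44 : 0 < wX s44) (B44G δ44G : ℝ) (hB44G : 0 ≤ B44G) (hδ44G : δFW - αW * δFW - 2 * σW ≤ δ44G) (hB44Gge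 : let Cσ : ℝ := ((((θ.ℓ₆ + 1 : ℕ) : ℝ)) * ((((θ.ℓ₆ + 1 : ℕ) : ℝ)) ^ 3 * (2 + 2 * coordBound39 (trBasis N) * basisBound39 (trBasis N) * (((θ.ℓ₆ + 1 : ℕ) : ℝ)) ^ 2)) * Real.exp ((1 - p.αF) * ((1 - 2 * p.α) * p.δ₀) * (2 * (rNear θ.d₆ θ.ℓ₆ + 1) + (((θ.d₆ : ℝ) + 1) * (((θ.ℓ₆ : ℝ) + 1) + 1) + 2)))); (((θ.ℓ₆ + 1 : ℕ) : ℝ)) * ((((θ.d₆ + 1 : ℕ) : ℝ)) * ((1 + CLip θ.d₆ θ.ℓ₆) * inputConst44 (exp261 (@geo9Y θ.d₆ θ.ℓ₆ θ.hd' θ.hL' θ.b₀ θ.b₁ Mstar) p.δ₀ p.α) p.δ₀ p.α p.NI p.N' (p.C (exp261 (@geo9Y θ.d₆ θ.ℓ₆ θ.hd' θ.hL' θ.b₀ θ.b₁ Mstar) p.δ₀ p.α)) (((θ.ℓ₆ + 1 : ℕ) : ℝ)) (p.BI s44) (p.θI s44) * Cσ * B6.c1 (exp261 (@geo9Y θ.d₆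 θ.ℓ₆ θ.hd' θ.hL' θ.b₀ θ.b₁ Mstar) p.δ₀ p.α) p.δ₀ p.α)) ≤ B44G) (hδ44Gle : δ44G ≤ ((1 - p.αF) * ((1 - 2 * p.α) * p.δ₀) - 3 * (p.α * p.δ₀)))
    (hB₃wG : (cR39 (trBasis N))⁻¹ * ((wX s44)⁻¹ * B44G + (((θ.d₆ + 1 : ℕ) : ℝ) * p.C (B9RWSums347DefiniteFaces.exp261 (@geo9Y θ.d₆ θ.ℓ₆ θ.hd' θ.hL' θ.b₀ θ.b₁ Mstar) p.δ₀ p.α)) * (CP * (((θ.ℓ₆ + 1 : ℕ) : ℝ))) * ((wX s44)⁻¹ * ((((θ.ℓ₆ + 1 : ℕ) : ℝ)) * Real.exp ((δFW - αW * δFW - σW) * (rNear θ.d₆ θ.ℓ₆ + 1)))) * rowConst261 (@geo9Y θ.d₆ θ.ℓ₆ θ.hd' θ.hL' θ.b₀ θ.b₁ Mstar) σW * rowConst261 (@geo9Y θ.d₆ θ.ℓ₆ θ.hd' θ.hL' θ.b₀ θ.b₁ Mstar) σW) ≤ B12₃) (BHG : ℝ) (hBHG : 0 ≤ BHG) (hwBhG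 : ∀ s, 0 < s → s < 1 → wX s * holderConst (exp261 (@geo9Y θ.d₆ θ.ℓ₆ θ.hd' θ.hL' θ.b₀ θ.b₁ Mstar) q.δ₀ q.α) q.δ₀ q.α q.NH q.NF (const37 (exp261 (@geo9Y θ.d₆ θ.ℓ₆ θ.hd' θ.hL' θ.b₀ θ.b₁ Mstar) q.δ₀ q.α) q.δ₀ q.α q.ρ q.B₀ q.Nc q.N' q.Cℓ q.Kc) (q.Bl s) (q.Bt s) ≤ BHG) (B43 δ43 : ℝ) (hB43 : 0 ≤ B43) (B₀D : ℝ) (hB₀D : 0 ≤ B₀D) (hbudD : ∀ s : ℝ, 0 < s → s < 1 → w13 s * ((((θ.d₆ + 1 : ℕ) : ℝ)) * (B9RWSums343Holder.holderConst (B9RWSums347DefiniteFaces.exp261 (@geo9Y θ.d₆ θ.ℓ₆ θ.hd' θ.hL' θ.b₀ θ.b₁ Mstar) p.δ₀ p.α) p.δ₀ p.α p.NH p.N' (p.C (B9RWSums347DefiniteFaces.exp261 (@geo9Y θ.d₆ θ.ℓ₆ θ.hd' θ.hL' θ.b₀ θ.b₁ Mstar) p.δ₀ p.α)) (p.Bl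 s) (p.Bt s) + 2 * B9Thm39ReadingCoords.coordBound39 (trBasis N) * B9Thm39ReadingCoords.basisBound39 (trBasis N) * ((θ.ℓ₆ : ℝ) + 1) * Real.exp (((1 - 2 * p.α) * p.δ₀) * (((θ.d₆ : ℝ) + 1) * (((θ.ℓ₆ : ℝ) + 1) + 1) + 2)) * ((((θ.d₆ + 1 : ℕ) : ℝ)) ^ 2 * (2 * (10 * ((θ.ℓ₆ + 1 : ℕ) : ℝ) * (p.a₁ / c)) * (1 + 10 * ((θ.ℓ₆ + 1 : ℕ) : ℝ) * (p.a₁ / c)) * Real.exp (4 * (10 * ((θ.ℓ₆ + 1 : ℕ) : ℝ) * (p.a₁ / c)))) * ((θ.ℓ₆ + 1 : ℕ) : ℝ) ^ 6) * (p.C (B9RWSums347DefiniteFaces.exp261 (@geo9Y θ.d₆ θ.ℓ₆ θ.hd' θ.hL' θ.b₀ θ.b₁ Mstar) p.δ₀ p.α)) + B9Thm39ReadingCoords.coordBound39 (trBasis N) * B9Thm39ReadingCoords.basisBound39 (trBasis N) * (p.C (B9RWSums347DefiniteFaces.exp261 (@geo9Y θ.d₆ θ.ℓ₆ θ.hd'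 θ.hL' θ.b₀ θ.b₁ Mstar) p.δ₀ p.α)) + (p.C (B9RWSums347DefiniteFaces.exp261 (@geo9Y θ.d₆ θ.ℓ₆ θ.hd' θ.hL' θ.b₀ θ.b₁ Mstar) p.δ₀ p.α)))) ≤ B₀D) (hB43ge : (((θ.ℓ₆ + 1 : ℕ) : ℝ)) * ((((θ.d₆ + 1 : ℕ) : ℝ)) * (p.C (B9RWSums347DefiniteFaces.exp261 (@geo9Y θ.d₆ θ.ℓ₆ θ.hd' θ.hL' θ.b₀ θ.b₁ Mstar) p.δ₀ p.α)) + B₀D) * Real.exp (((1 - 2 * p.α) * p.δ₀) * (rNear θ.d₆ θ.ℓ₆ + 1)) ≤ B43) (hδ43le : δ43 ≤ ((1 - 2 * p.α) * p.δ₀)) (ρrg : ℝ) (hρrg0 : 0 ≤ ρrg) (hbudrg : ρrg + σW + αW * δFW ≤ δFW) (hbud43 : ρrg + σW ≤ δ43) (hδ₃rg : δ12₃ ≤ ρrg) (hB₃rg : B43 * (cR39 (trBasis N))⁻¹ * rowConst261 (@geo9Y θ.d₆ θ.ℓ₆ θ.hd' θ.hL' θ.b₀ θ.b₁ Mstar)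 σW + CTel θ.d₆ θ.ℓ₆ (trBasis N) ρrg (CP * (((θ.ℓ₆ + 1 : ℕ) : ℝ)) * ((((θ.d₆ + 1 : ℕ) : ℝ) * p.C (B9RWSums347DefiniteFaces.exp261 (@geo9Y θ.d₆ θ.ℓ₆ θ.hd' θ.hL' θ.b₀ θ.b₁ Mstar) p.δ₀ p.α)) * (cR39 (trBasis N))⁻¹ * rowConst261 (@geo9Y θ.d₆ θ.ℓ₆ θ.hd' θ.hL' θ.b₀ θ.b₁ Mstar) σW) * rowConst261 (@geo9Y θ.d₆ θ.ℓ₆ θ.hd' θ.hL' θ.b₀ θ.b₁ Mstar) σW) (CP * (((θ.ℓ₆ + 1 : ℕ) : ℝ)) * ((((θ.d₆ + 1 : ℕ) : ℝ) * p.C (B9RWSums347DefiniteFaces.exp261 (@geo9Y θ.d₆ θ.ℓ₆ θ.hd' θ.hL' θ.b₀ θ.b₁ Mstar) p.δ₀ p.α)) * (cR39 (trBasis N))⁻¹ * rowConst261 (@geo9Y θ.d₆ θ.ℓ₆ θ.hd' θ.hL' θ.b₀ θ.b₁ Mstar) σW) * rowConst261 (@geo9Y θ.d₆ θ.ℓ₆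 θ.hd' θ.hL' θ.b₀ θ.b₁ Mstar) σW) ≤ B12₃) (τS δP : ℝ) (hτS : 0 < τS) (hρP12 : ρ12 + 2 * σ12 ≤ δP) (hU8a : δK12 + 3 * σS + 4 * τS ≤ (1 - 2 * p.α) * p.δ₀) (hU8b : δK12 + 3 * σS + 4 * τS ≤ min ((1 - 2 * p.α) * p.δ₀) δ39 / 8) (hU8c : δK12 + 3 * σS + 4 * τS ≤ δ₂) (hU8d : δK12 + 3 * σS + 5 * τS ≤ δ44G) (hU8e : δK12 + 3 * σS + 4 * τS ≤ δB) (hU8f : δK12 + 2 * σS + τS ≤ δ43) (hU8g : δK12 + τS + σS ≤ δT12) (hU8h : δK12 + τS + σS ≤ δ12₃) (hU8i : δK12 + τS + σS ≤ δP) (hU8j : δP + 2 * τS ≤ δ12₀) (hU8k : δP + σS + 2 * τS ≤ δ12₃) (τR : ℝ) (hτR : 0 < τR) (hR8a : δ12₃ + 5 * τR + 3 * σS + 4 * τS ≤ (1 - 2 * p.α) * p.δ₀) (hR8b : δ12₃ + 5 * τR + 3 * σS + 4 * τS ≤ min ((1 - 2 * p.α) * p.δ₀) δ39 / 8) (hR8c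 : δ12₃ + 5 * τR + 3 * σS + 4 * τS ≤ δ₂)
    (hR8d : δ12₃ + 5 * τR + 3 * σS + 5 * τS ≤ δ44G) (hR8e : δ12₃ + 5 * τR + 3 * σS + 4 * τS ≤ δB) (hR8f : δ12₃ + 5 * τR + 2 * σS + τS ≤ δ43) (hR8g : δ12₃ + 5 * τR + τS + σS ≤ δT12) (hR8h : δ12₃ + 5 * τR + 2 * σS + 3 * τS < δ12₀) (hR8i : δ12₃ + 5 * τR + 2 * σS + 3 * τS < δ44) (hR8j : δ12₃ + 5 * τR + 2 * σS + 3 * τS < δ45) (hR8k : δ12₃ + 5 * τR + 2 * σS + 3 * τS < δ45Y) (δQs : ℝ) (hδQs1 : δ12₀ + 1 ≤ δQs) (hδQs2 : δ12₃ + σ12 ≤ δQs) (hδQs3 : δ12₃ + 1 ≤ δQs)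
    -- [«KCX″» ∕ «KD″»] THE Δ⁽²⁾ PRECHAIN's KNIT INPUTS DISPLAYED ((3.137) is DERIVED inside «KD″»; dag-n06-l (L1)/(L2)): c2-form residual reading `h𝔯𝔠`, its (3.36) majorant `hC2` + window `κC δC2`, the G_D-road rate `ρG`, the (3.15) letter of `Q` `hQ15`, `hT16`, `α₀ᴷ ≤ α_Q`, the neighbour floor `hM₀'`
    (κC δC2 : ℝ) (hκC : 0 ≤ κC) (hgap : δ₂ < δC2)
    -- [«KE₄X»] the x-free (3.36)∕Prop-7 window of the c2-form majorant fold (dag-n06-l `c2FormMaj_c2YOfRecord_of_hβ1` at ITS OWN x-free `α₀'` (WA ✓p776410's texts VERBATIM — witnessed by ✓`…NumericsWitnessX`), `a := a12`; `hwKa hwbb hwsmall hwc3 hw145 hw155 hδC2 hκ2` shapes)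
    (α₀' bb : ℝ) (hwKa : 2 * (10 * ((θ.ℓ₆ : ℝ) + 1) * a12) * (1 + 10 * ((θ.ℓ₆ : ℝ) + 1) * a12) * Real.exp (4 * (10 * ((θ.ℓ₆ : ℝ) + 1) * a12)) * ((θ.ℓ₆ : ℝ) + 1) ^ 4 < α₀') (hwα3 : C0 (θ.d₆ + 1) * α₀' ≤ 1 / 3) (hwα4 : 4 * α₀' ≤ c2' (θ.d₆ + 1) (θ.ℓ₆ + 1)) (hwbb : 0 < bb) (hwsmall : Real.exp (4 * (800 * (((θ.d₆ + 1 : ℕ) : ℝ) + 1) ^ 2 * (((θ.d₆ + 1 : ℕ) : ℝ) + 4)) * α₀') * (1 + 8 * (131072 * (((θ.d₆ + 1 : ℕ) : ℝ) + 1) ^ 2) * bb) ≤ 2) (hwc3 : 4 * bb < c3 (θ.d₆ + 1) (θ.ℓ₆ + 1)) (hw145 : 8 * ((θ.d₆ + 1 : ℕ) : ℝ) * thetaGen (θ.d₆ + 1) (θ.ℓ₆ + 1) α₀' * ((θ.ℓ₆ : ℝ) + 1)⁻¹ ^ 4 ≤ 1) (hw155 : (2 * ((θ.ℓ₆ : ℝ)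 + 1) - 1) * ((θ.ℓ₆ : ℝ) + 1)⁻¹ ^ 2 + 2 * ((θ.d₆ + 1 : ℕ) : ℝ) * thetaGen (θ.d₆ + 1) (θ.ℓ₆ + 1) α₀' * ((θ.ℓ₆ : ℝ) + 1)⁻¹ ^ 3 + 1 / 8 * (1 + 2 * ((θ.d₆ + 1 : ℕ) : ℝ) * thetaGen (θ.d₆ + 1) (θ.ℓ₆ + 1) α₀' * ((θ.ℓ₆ : ℝ) + 1)⁻¹ ^ 2 + 2 * ((θ.d₆ + 1 : ℕ) : ℝ) * C3Gen (θ.d₆ + 1) (θ.ℓ₆ + 1) * bb) * ((θ.ℓ₆ : ℝ) + 1)⁻¹ ^ 2 ≤ 1) (hδC2 : 0 ≤ δC2) (hκ2 : C3Gen (θ.d₆ + 1) (θ.ℓ₆ + 1) * Real.exp (2 * δC2 * ((θ.ℓ₆ : ℝ) + 4)) ≤ 2 * κC) (ρG : ℝ) (hρG : 0 < ρG) (hρGP : ρG + σS ≤ δP) (hρGK : ρG + 2 * σS ≤ δK12) (hT16 : (α₀K * (2 * ((θ.d₆ : ℝ) + 1) * kCol (θ.d₆ + 1) (θ.ℓ₆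 + 1) + 8 * ((θ.d₆ : ℝ) + 2) ^ 2)) ^ 2 * (2 * (N : ℝ) * θ.b₁) * (2 * ((θ.d₆ : ℝ) + 1) * Cth θ.d₆) ≤ θ.b₀ / 256) (hαQK : α₀K ≤ alphaQ (θ.d₆ + 1) (θ.ℓ₆ + 1)) (hM₀' : nbrM₀Y θ.d₆ θ.ℓ₆ θ.hd' θ.hL' θ.b₀ θ.b₁ ((θ.ℓ₆ : ℝ) + 4) ≤ Mstar)
    -- [«KC»] the (3.48) display in WA∕KD's spelling (`oneCubeOps39YF … 𝔏 …`; the same row as `h348` above at the record, both `rfl` there) — KD's `h348` input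
    (ha17 : q.a₁ / c ≤ B9Thm311KnitRow17ThresholdsY.knitRow17a₁ N θ.toStage3Params Mstar) (hM17q : B9Thm311KnitRow17ThresholdsY.knitRow17M₁ N θ.toStage3Params Mstar ≤ q.M₁) (ha39K : c35Y * a39 ≤ c * B9Thm32KnitRows1516ThresholdsY.knit348a₁ N θ.toStage3Params Mstar) (hB39K : B9Thm32KnitRows1516ThresholdsY.knit348B₀ N θ.toStage3Params Mstar ≤ B39) (hδ39K : δ39 ≤ B9Thm32KnitRows1516ThresholdsY.knit348δ₀ N θ.toStage3Params Mstar)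
    : B9LeafX (Y9OfRecordUPbParHX N θ.toStage3Params Mstar (opsYSectESt N θ.toStage3Params Mstar (opsYS349NuOfLettersH N θ.toStage3Params Mstar (lettersYOfRecordV11K N θ.toStage3Params Mstar (resYOfRecordPK N θ.toStage3Params Mstar)) (fun x => parSymY x.toKIdx) (expsYOfRecordV3Par N θ.toStage3Params Mstar (lettersYOfRecordV11K N θ.toStage3Params Mstar (resYOfRecordPK N θ.toStage3Params Mstar)) 𝔈₀ R₁ R₂ bI (fun x : MemberY θ.d₆ θ.ℓ₆ θ.hd' θ.hL' θ.b₀ θ.b₁ Mstar => parKnitY x.toKIdx) (fun x : MemberY θ.d₆ θ.ℓ₆ θ.hd' θ.hL' θ.b₀ θ.b₁ Mstar => parSymY x.toKIdx) (fun x : MemberY θ.d₆ θ.ℓ₆ θ.hd' θ.hL' θ.b₀ θ.b₁ Mstar => qKnitOfRecord N θ.toStage3Params x.toKIdx) (fun x : MemberY θ.d₆ θ.ℓ₆ θ.hd' θ.hL' θ.b₀ θ.b₁ Mstar => qsKnitOfRecord N θ.toStage3Params x.toKIdx) α' r39 B39 p q p3 q3 pM qM H (fun (x : MemberY θ.d₆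 θ.ℓ₆ θ.hd' θ.hL' θ.b₀ θ.b₁ Mstar) (cc : ↥(cubes x.toKIdx.D.toDomains)) => GpDirY x.toKIdx cc (parKnitCubeY x.toKIdx cc) (B9Cor35GpDirInputsAtOne.dirDomY x.toKIdx cc)) (fun (x : MemberY θ.d₆ θ.ℓ₆ θ.hd' θ.hL' θ.b₀ θ.b₁ Mstar) (cc : ↥(cubes x.toKIdx.D.toDomains)) => nearPinY x cc) (fun x : MemberY θ.d₆ θ.ℓ₆ θ.hd' θ.hL' θ.b₀ θ.b₁ Mstar => ops310WalkYO x (trBasis N) (bg9YR (Matrix (Fin N) (Fin N) ℂ) (specialUnitaryUnits (Fin N)) R₁ R₂ x) (fun U => U) (bI x) (lettersYOfRecordV11K N θ.toStage3Params Mstar (resYOfRecordPK N θ.toStage3Params Mstar) x).GA (fun cc : ↥(cubes x.toKIdx.D.toDomains) => GDirCKY x.toKIdx cc (DPDsDirCubeY x.toKIdx cc (B9Cor35GpDirInputsAtOne.dirDomY x.toKIdx cc)) (bondsOverY x.toKIdx (B9Cor35GpDirInputsAtOne.dirDomY x.toKIdx cc))) (S0coKq x.toKIdx (trBasis N) (bg9YR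 (Matrix (Fin N) (Fin N) ℂ) (specialUnitaryUnits (Fin N)) R₁ R₂ x) (fun V => V) (qKnitOfRecord N θ.toStage3Params x.toKIdx) (qsKnitOfRecord N θ.toStage3Params x.toKIdx) (parKnitY x.toKIdx) (GpPhysY x.toKIdx (parKnitY x.toKIdx))) (fun U => eq3105FamQLY x.toKIdx (trBasis N) (qKnitOfRecord N θ.toStage3Params x.toKIdx) (qsKnitOfRecord N θ.toStage3Params x.toKIdx) (parKnitY x.toKIdx) (GpPhysY x.toKIdx (parKnitY x.toKIdx)) (fun cc : ↥(cubes x.toKIdx.D.toDomains) => GDirCKY x.toKIdx cc (DPDsDirCubeY x.toKIdx cc (B9Cor35GpDirInputsAtOne.dirDomY x.toKIdx cc)) (bondsOverY x.toKIdx (B9Cor35GpDirInputsAtOne.dirDomY x.toKIdx cc))) (fun cc : ↥(cubes x.toKIdx.D.toDomains) => (DPDsDirCubeY x.toKIdx cc (B9Cor35GpDirInputsAtOne.dirDomY x.toKIdx cc))) (fun (cc : ↥(cubes x.toKIdx.D.toDomains)) (U : (bg9YR (Matrix (Fin N) (Fin N) ℂ) (specialUnitaryUnits (Fin N)) R₁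 R₂ x).Cfg) => (P1DirCubeY x.toKIdx cc (hTY x.toKIdx cc) (B9Cor35GpDirInputsAtOne.dirDomY x.toKIdx cc)) U) U) (fun U => eq3105FamQTLY x.toKIdx (trBasis N) (qKnitOfRecord N θ.toStage3Params x.toKIdx) (qsKnitOfRecord N θ.toStage3Params x.toKIdx) (parKnitY x.toKIdx) (GpPhysY x.toKIdx (parKnitY x.toKIdx)) (fun cc : ↥(cubes x.toKIdx.D.toDomains) => GDirCKY x.toKIdx cc (DPDsDirCubeY x.toKIdx cc (B9Cor35GpDirInputsAtOne.dirDomY x.toKIdx cc)) (bondsOverY x.toKIdx (B9Cor35GpDirInputsAtOne.dirDomY x.toKIdx cc))) (fun cc : ↥(cubes x.toKIdx.D.toDomains) => (DPDsDirCubeY x.toKIdx cc (B9Cor35GpDirInputsAtOne.dirDomY x.toKIdx cc))) (fun (cc : ↥(cubes x.toKIdx.D.toDomains)) (U : (bg9YR (Matrix (Fin N) (Fin N) ℂ) (specialUnitaryUnits (Fin N)) R₁ R₂ x).Cfg) => (P1DirCubeY x.toKIdx cc (hTY x.toKIdx cc) (B9Cor35GpDirInputsAtOne.dirDomY x.toKIdx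 cc)) U) U) (SFA x)) (fun x : MemberY θ.d₆ θ.ℓ₆ θ.hd' θ.hL' θ.b₀ θ.b₁ Mstar => rd310WalkYO x (bg9YR (Matrix (Fin N) (Fin N) ℂ) (specialUnitaryUnits (Fin N)) R₁ R₂ x) (fun U => U) (κ := TrIdx N) (fun cc : ↥(cubes x.toKIdx.D.toDomains) => nearAPinCY x.toKIdx cc (B9Cor35GpDirInputsAtOne.dirDomY x.toKIdx cc)) (AgreeFA x)) 𝔬12)) (lettersYOfRecordV11K N θ.toStage3Params Mstar (resYOfRecordPK N θ.toStage3Params Mstar)) (sectEStYOfRecordV7 N θ.toStage3Params Mstar 𝔢₀) 𝔴) (fun j : B9SectionCarryingMembersV1.SCMemberY θ.d₆ θ.ℓ₆ θ.hd' θ.hL' θ.b₀ θ.b₁ Mstar => j.val) bR (fun j => C37KY (specialUnitaryUnits (Fin N)) j.val (B9SectionCarryingMembersV1.SCMemberY.ιBsc j) (fun α₀ U => (bg9YC (Matrix (Fin N) (Fin N) ℂ) (specialUnitaryUnits (Fin N)) (extraYPb (Matrix (Fin N) (Fin N) ℂ) (specialUnitaryUnits (Fin N))) j.val).Reg335 c35Y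 α₀ U) (cqY θ.d₆) CqK MK aInv (ϱ' * (((θ.ℓ₆ + 1 : ℕ) : ℝ)) ^ 3 / 3)) C38 (fun j => parKnitY j.val.toKIdx) (fun j => parSymY j.val.toKIdx) (fun j => GAQY j.val.toKIdx (qKnitOfRecord N θ.toStage3Params j.val.toKIdx) (qsKnitOfRecord N θ.toStage3Params j.val.toKIdx) (parKnitY j.val.toKIdx) (GpY j.val.toKIdx (parKnitY j.val.toKIdx))))
    := by
  have hfin := N06AtOpsYSectEStKnitRecordKESCCP.b9LeafXUR_opsYSectESt_knitRecord_KESCCP (J := B9SectionCarryingMembersV1.SCMemberY θ.d₆ θ.ℓ₆ θ.hd' θ.hL' θ.b₀ θ.b₁ Mstar) (f := fun j => j.val) (ιB := fun j => B9SectionCarryingMembersV1.SCMemberY.ιBsc j) (hι := fun j s => B9SectionCarryingMembersV1.SCMemberY.hιsc j s) (hSC := fun j => j.surjective_beta) (θ := θ) (hθ := hθ) (Mstar := Mstar) (𝔢₀ := 𝔢₀) (𝔴 := 𝔴) (𝔈₀ := 𝔈₀) (R₁ := R₁) (R₂ := R₂) (c := c) (hcB := hcB) (hc := hc) (hGR :=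 hGR) (hRP1 := hRP1) (hP1 := hP1) (hP2 := hP2) (bI := bI) (hbI := hbI) (α' := α') (r39 := r39) (δ39 := δ39) (B39 := B39) (a39 := a39) (hα'0 := hα'0) (hα'1 := hα'1) (hr39 := hr39) (hrδ39 := hrδ39) (hB39 := hB39) (ha39 := ha39) (p := p) (q := q) (hp := hp) (hq := hq) (α₀K := α₀K) (aK := aK) (hαK := hαK) (hαK3 := hαK3) (hαK2 := hαK2) (hKplK := hKplK) (hpaK := hpaK) (hqaK := hqaK) (p3 := p3) (q3 := q3) (hp3 := hp3) (hq3 := hq3) (pM := pM) (qM := qM) (hpM := hpM) (hqM := hqM) (H := H) (hM₀ := hM₀) (𝔭 := 𝔭) (h𝔭 := h𝔭) (bHX := bHX) (hbHX := hbHX) (SH := SH) (S3 := S3) (SI := SI) (Bc := Bc) (hBc := hBc) (hM₀N := hM₀N) (hB₀ge := hB₀ge) (δM := δM) (hδM := hδM) (hM1L := hM1L) (hδ1L := hδ1L) (hθ1L := hθ1L) (hMixO := hMixO) (hOneO := hOneO) (hmixO := hmixO) (hM36 := hM36) (hN36 := hN36) (hT36 := hT36) (hDat36u := hDat36u) (hB36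 := hB36) (hδ36 := hδ36) (h36H := h36H) (hcntH := hcntH) (hcnt3 := hcnt3) (hcntI := hcntI) (hMw := hMw) (hNMw := hNMw) (hM3 := hM3) (hρ3 := hρ3) (hNc := hNc) (hN' := hN') (hCℓ := hCℓ) (hKc := hKc) (hθ₀ := hθ₀) (SFA := SFA) (AgreeFA := AgreeFA) (hρ3A := hρ3A) (hNcA := hNcA) (hN'A := hN'A) (hCℓA := hCℓA) (hKcA := hKcA) (hcntFA := hcntFA) (hfacA := hfacA) (hinvA12n := hinvA12n) (hRfagrA := hRfagrA) (𝔭A := 𝔭A) (h𝔭A := h𝔭A) (bHXA := bHXA) (SHA := SHA) (S3A := S3A) (SIA := SIA) (SMA := SMA) (hbHXA := hbHXA) (h36HA := h36HA) (hcntHA := hcntHA) (hcnt3A := hcnt3A) (hcntIA := hcntIA) (hcntMA := hcntMA) (BcA := BcA) (hBcA := hBcA) (hB₀geA := hB₀geA) (𝔬12 := 𝔬12) (h𝔬12 := h𝔬12) (E14₁ := E14₁) (E14₂ := E14₂) (T14₁ := T14₁) (T14₂ := T14₂) (X14₁ := X14₁) (M14₁ := M14₁) (X14₂ := X14₂) (M14₂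 := M14₂) (diam14 := diam14) (r14 := r14) (hr14 := hr14) (near14₁ := near14₁) (first14₁ := first14₁) (chain14₁ := chain14₁) (near14₂ := near14₂) (first14₂ := first14₂) (chain14₂ := chain14₂) (h14₁ := h14₁) (h14₂ := h14₂) (W14₁ := W14₁) (W14₂ := W14₂) (hW14₁ := hW14₁) (hW14₂ := hW14₂) (hcnt14₁ := hcnt14₁) (hcnt14₂ := hcnt14₂) (hexp14 := hexp14) (a₀E := a₀E) (δ₁E := δ₁E) (B₁E := B₁E) (ha₀E := ha₀E) (hδ₁E := hδ₁E) (hB₁E := hB₁E) (hE := hE) (ιR := ιR) (bR := bR) (C38 := C38) (CqK := CqK) (MK := MK) (aInv := aInv) (ϱ' := ϱ') (hCqK := hCqK) (haInv := haInv) (haIR := haIR) (hα8 := hα8) (hα4N := hα4N) (hαπN := hαπN) (haIK := haIK) (ϱ := ϱ) (hϱ' := hϱ') (hϱ := hϱ) (hsmall' := hsmall') (hc₃' := hc₃') (hϱ'1 := hϱ'1) (hEc := hEc) (hdX := hdX) (hsmall := hsmall) (hc₃ := hc₃) (hM₀K := hM₀K) (h26 := h26) (hMA := hMA) (hNA :=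 hNA) (hTA := hTA) (BA₂ := BA₂) (hBA₂ := hBA₂) (hDatBu := hDatBu) (hRflA := hRflA) (hBcA'' := hBcA'') (hδA'' := hδA'') (hRP2 := hRP2) (hα3 := hα3) (bHXT := bHXT) (hbHXT := hbHXT) (hopI := hopI) (S2A := S2A) (bHXTA := bHXTA) (hbHXTA := hbHXTA) (hopIA := hopIA) (h36A2 := h36A2) (hcnt2A := hcnt2A) (bH13 := bH13) (δ12₀ := δ12₀) (δK12 := δK12) (σ12 := σ12) (ρ12 := ρ12) (a12 := a12) (M12 := M12) (B12₃ := B12₃) (δ12₃ := δ12₃) (ρ13 := ρ13) (α12 := α12) (ρf12 := ρf12) (hρf12 := hρf12) (hρf1 := hρf1) (hρf2 := hρf2) (hB12₃ := hB12₃) (hσ12 := hσ12) (hρ12 := hρ12) (hρS12 := hρS12) (hρδ12 := hρδ12) (hρ₃12 := hρ₃12) (ha12 := ha12) (hαK4 := hαK4) (hexpK := hexpK) (hsmallK := hsmallK) (ha12K := ha12K) (hM12 := hM12) (hM12q := hM12q) (hαdK := hαdK) (hα12 := hα12) (hα12' := hα12') (hδ₃₀ := hδ₃₀) (hδ12₀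 := hδ12₀) (t12 := t12) (δT12 := δT12) (ρS := ρS) (σS := σS) (ht12 := ht12) (hσS := hσS) (hρST := hρST) (hρS₀ := hρS₀) (hδKS := hδKS) (hσSK := hσSK) (bXH := bXH) (w13 := w13) (wX := wX) (hw13₀ := hw13₀) (hw13₁ := hw13₁) (hwX₀ := hwX₀) (hwX₁ := hwX₁) (hbH13 := hbH13) (hbXH := hbXH) (hρ13 := hρ13) (hρ13ρ := hρ13ρ) (hσρ13 := hσρ13) (B13₄ := B13₄) (Bx13 := Bx13) (hB13₄ := hB13₄) (hBx13 := hBx13) (tJ := tJ) (δB := δB) (rT := rT) (ha1J := ha1J) (htJ := htJ) (hrTP := hrTP) (hrTB := hrTB) (hδT12 := hδT12) (hδTr := hδTr) (ϑF := ϑF) (hϑF := hϑF) (sch := sch) (hsch0 := hsch0) (hsch1 := hsch1) (hschβ := hschβ) (hwsch := hwsch) (δ45 := δ45) (hδ45 := hδ45) (BZ := BZ) (hBZ := hBZ) (hBZge := hBZge) (hδ45le := hδ45le) (δ₂ := δ₂) (hrT4 := hrT4) (hrT2 := hrT2) (hδ₃T := hδ₃T) (hδ12₃F := hδ12₃F)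 (δ45Y := δ45Y) (hδ45Y := hδ45Y) (BiY := BiY) (hBiY := hBiY) (αW := αW) (σW := σW) (δFW := δFW) (hαW0 := hαW0) (hαW1 := hαW1) (hσW := hσW) (hδFW := hδFW) (hδFP := hδFP) (hbudW := hbudW) (hδ3W := hδ3W) (hwschX := hwschX) (δ45W := δ45W) (hδ45W := hδ45W) (B45W := B45W) (hB45W := hB45W) (δhW := δhW) (hδhW := hδhW) (BhW := BhW) (hBhW := hBhW) (hB45Wge := hB45Wge) (hδ45Wle := hδ45Wle) (hBhWge := hBhWge) (hδhWle := hδhWle) (CP := CP) (hCPge := hCPge) (hBxW := hBxW) (hBiYge := hBiYge) (hδ45Yle := hδ45Yle) (s44 := s44) (hs440 := hs440) (hs441 := hs441) (hws44 := hws44) (δ44 := δ44) (hδ44 := hδ44) (Bi44 := Bi44) (hBi44 := hBi44) (hB12₃d := hB12₃d) (hB12₃p := hB12₃p) (hBi44ge := hBi44ge) (hδ44le := hδ44le) (hwX44 := hwX44) (B44G := B44G) (δ44G := δ44G) (hB44G := hB44G) (hδ44G := hδ44G) (hB44Gge := hB44Gge) (hδ44Gle := hδ44Gle) (hB₃wG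 := hB₃wG) (BHG := BHG) (hBHG := hBHG) (hwBhG := hwBhG) (B43 := B43) (δ43 := δ43) (hB43 := hB43) (B₀D := B₀D) (hB₀D := hB₀D) (hbudD := hbudD) (hB43ge := hB43ge) (hδ43le := hδ43le) (ρrg := ρrg) (hρrg0 := hρrg0) (hbudrg := hbudrg) (hbud43 := hbud43) (hδ₃rg := hδ₃rg) (hB₃rg := hB₃rg) (τS := τS) (δP := δP) (hτS := hτS) (hρP12 := hρP12) (hU8a := hU8a) (hU8b := hU8b) (hU8c := hU8c) (hU8d := hU8d) (hU8e := hU8e) (hU8f := hU8f) (hU8g := hU8g) (hU8h := hU8h) (hU8i := hU8i) (hU8j := hU8j) (hU8k := hU8k) (τR := τR) (hτR := hτR) (hR8a := hR8a) (hR8b := hR8b) (hR8c := hR8c) (hR8d := hR8d) (hR8e := hR8e) (hR8f := hR8f) (hR8g := hR8g) (hR8h := hR8h) (hR8i := hR8i) (hR8j := hR8j) (hR8k := hR8k) (δQs := δQs) (hδQs1 := hδQs1) (hδQs2 := hδQs2) (hδQs3 := hδQs3) (κC := κC) (δC2 := δC2) (hκC := hκC) (hgap := hgap) (α₀' := α₀')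 (bb := bb) (hwKa := hwKa) (hwα3 := hwα3) (hwα4 := hwα4) (hwbb := hwbb) (hwsmall := hwsmall) (hwc3 := hwc3) (hw145 := hw145) (hw155 := hw155) (hδC2 := hδC2) (hκ2 := hκ2) (ρG := ρG) (hρG := hρG) (hρGP := hρGP) (hρGK := hρGK) (hT16 := hT16) (hαQK := hαQK) (hM₀' := hM₀') (ha17 := ha17) (hM17q := hM17q) (ha39K := ha39K) (hB39K := hB39K) (hδ39K := hδ39K)
  exact hfin

end Pointed

end Summit.QuantumFields.YangMills.BalabanUVNodes.N06AtOpsYSectEStKnitRecordKESCCPVal
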